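import Summits.QuantumFields.YangMills.Theorems.BalabanUVNodesN24K1R9ByNameOfCofinalBetaSocketV23GridGBChildrenSplitSlot8Thm1AEPosN09T5AtGaussPinPrintedZBY
import Literature.MathematicalPhysics.QuantumFieldTheory.Balaban1983to89.Node00.CarriersB8SubBPCutP5Kappa
import Summits.QuantumFields.YangMills.Theorems.BalabanUVNodesN05SubBP2DK2PerKappaSlotExistsOfBindersLettersPerDoorL
import Literature.MathematicalPhysics.QuantumFieldTheory.Balaban1983to89.B9Thm33BindersUniformZdPerNestedEta
import Literature.MathematicalPhysics.QuantumFieldTheory.Balaban1983to89.Node00.Record12NumericsFamilyFiniteDim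
import Summits.QuantumFields.YangMills.Theorems.BalabanUVNodesN06AtOpsYSectEStKnitPairKC
import Literature.MathematicalPhysics.QuantumFieldTheory.Balaban1983to89.B9SectionCarryingMembersV1
import Literature.MathematicalPhysics.QuantumFieldTheory.Balaban1983to89.Node00.CarriersZSectE
import Summits.QuantumFields.YangMills.Theorems.BalabanUVNodesN08AlphaEq324RowACReMassedZSlot
import Literature.MathematicalPhysics.QuantumFieldTheory.Balaban1983to89.Node00.Record12NumericsFamilyTraceState

/-!
# CASCADE-K EDITION «KC» (director-ym №383 «K4 n24-c»; seat g22, INTENT-2, generator `genFaceK.py` = a SPLICE over the tree bytes of the K1 FACE OF RECORD #11884 ✓p782330 `…N24K1FaceTrN06WASCN07N08N09T5V23CofJunctionLSlot8KappaPrimeAtGaussPinPrintedZBY`).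
WHAT CHANGED AND NOTHING ELSE: (1) NODE N06's certificate = dag-n06-d's CASCADE-K piece K3 `N06AtOpsYSectEStKnitPairKC.b9LeafXUR_opsYSectESt_knit_pairKC` (the Stage-11 certificate skeleton at node00-def-Y's KNIT object of record
`opsYNuStOfRecordV11KSE …`, carrier `Y9OfRecordUPbParH`, transporters `parKnitY ∕ parSymY`, the `GAQY` letter) INSTEAD OF the V6E-pair edition «WA» `N06AtOpsYNuOfRecordV6EPairWA.b9LeafXUR_opsYNuOfRecordV6E_pairWA`: the N06 display below is THAT certificate's
430 DISPLAYED binders in 385 groups — the certificate is LETTER-GENERIC: its letter record `𝔏` is INSTANTIATED here at node00-def-Y's knit letters of record `lettersYOfRecordV11K 2 (stage3OfFamily F) (Mstar F) (𝔯 F)` and its 12 letter pins `h𝔏…` are closed by `rfl` (as n06-d's «KB» did for «KA»), so the pinned object is `opsYNuStOfRecordV11KSE …` by definitional unfolding (`Node00.opsYNuStOfRecordV11KSE_eq_opsYSectESt`); `𝔯` is displayed in `𝔏`'s place (instantiation (α5) kept: `J := SCMemberY …`, `f := SCMemberY.val`, `ιB := SCMemberY.ιBsc` CONSTRUCTED,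 off the display; the K-certificates carry no `hι`), VERBATIM up to `N := 2`,
`θ.toStage3Params ∕ θ.<Stage-3 field> ↦ (stage3OfFamily F)…` and Skolemisation in `F` (instance binders `instN06_1…8`; inner-binder α-renames [(['hcntH'], 'c'), (['hcnt3'], 'c'), (['hcntI'], 'c'), (['hcntHA'], 'c'), (['hcnt3A'], 'c'), (['hcntIA'], 'c'), (['hcntMA'], 'c'), (['near14₁'], 'p'), (['near14₁'], 'q'), (['near14₂'], 'p'), (['near14₂'], 'q'), (['hcnt2A'], 'c')]); w.r.t. «WA» the Sect.-D network letters∕numerics, the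
O5 `hZ` display, FLAG №8's W-letter rows and `h𝔯 ∕ hRP2 ∕ instNE` are GONE (derived inside «KA» or no longer read), and the K-rows `α₀K aK hαK hαK3 hαK2 hKplK hpaK hqaK` (knit-letter numerics), `MR hMR hΔAK` (row 17 at the knit letter),
`t312K t313K` (Sect.-D outputs), `s349K`, `s3132K`, `hBK` (coded Sect.-B step) are NEW — each DISPLAYED here exactly as the certificate displays it, nobody's theorem on this face; (2) the `have h06` is TYPED at the
K-certificate's conclusion at `F` and fed by `@b9LeafXUR_opsYSectESt_knit_pairKC 2 _ _ F θ₁₁ hθ₁₁ …` (door view and admissibility terms byte-identical to #11884's); (3) import∕open of the certificate module swapped and the certificate's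
own `open` list merged; namespace∕theorem re-tagged «WASC» ↦ «KCSC».  EVERY OTHER BYTE of the statement and proof (letters, `hN06`, `hN07`, `hN08`, `h09`, `hN09T`, `h10`, `h11N`, `hEfl`, `h13pos`, the cofinal β-socket `hβc`,
the `refine` of the cofinal engine ✓p782234, the N05∕N06-slot proof) IS #11884's.  HONEST: a re-key of the N06 display to the knit certificate; N06 NOT discharged (its K-rows and letter schemas are hypotheses
here); the carrier-generic socket stays junk-inhabitable (no N06 → K1 credit); K1⁹ CONDITIONAL; no count ∕ pointer moved by this file; the TOP-PAIR ∕ face-of-record pointers are the chair's.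
INHERITED HEADER of #11884 (read «WA» as the previous N06 key where it describes the N06 display):
# NODE N24 (B2) — THE K1 FACE OVER THE ENGINE v2, COFINAL β-SOCKET EDITION (director-ym №402 (R) ∕ №406 (2); P3 g84 (R1)) AT N06's EDITION «WA», INSTANTIATION (α5): K0⁷ ⊕ NODE O DISPLAYED AS ONE BINDER `hβc` —
# the sign-free β-BOX and the four RUN ROWS at a RADIUS SUPPLIED BY THE PRODUCER (doors' half-window Z3 member; box part = k0's `K0BoxCofinalRadii` body) — IN PLACE OF ✓p781921's `h3` (∀-radius V23 stub text) AND `hrowsR` (∀-door rows);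
# N06 = «WA»'s certificate binders VERBATIM, N07 ∕ N08 ∕ N09 ∕ N10 ∕ N11 ∕ N13 slots AS ON ✓p781921; K1⁹ `StabilityBRunRowsAtRecordR13SepCoPHV` (stmt-QuantumFields-27364) BY ITS ROUTE NAME, ONE `refine` of `…N24K1R9ByNameOfCofinalBetaSocketV23GridGBChildrenSplitSlot8Thm1AEPosN09T5AtGaussPinPrintedZBY` §2

COFINAL β-SOCKET EDITION (THIS FILE; seat g21, INTENT-5, generator `genFaceCof.py` over the ✓p781921 tree bytes).  WHY (director-ym №402 FACT∕(R), №406 (2); P3 g84 `ENGINE-v2-cofinal-socket.md`): ✓p781921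
bills K0⁷'s box (`h3`, every radius) and NODE O's rows (`hrowsR`, every door `0 < a₀ ≤ 1∕(109824·L²)`) at EVERY small radius, stronger than K1⁹ needs on exactly the axis director №398 weakened K0's
doors on; a producer valid only along radii → 0 ((α_cof)∕(κ_cof)) or on `]0, a⋆(F)]` ((α_small)) would not inhabit them as typed.  STATEMENT DELTA w.r.t. ✓p781921: `h3` GONE, `hrowsR` GONE, NEW last
binder `hβc : ∀ F, ∀ a > 0, ∃ a₀, 0 < a₀ ≤ a ∧ ∃ (γ₀ ε₂₉ β′) (j ε₀ B₃ B₃′ a₁ Efl logz), 0 < γ₀ ∧ 0 < ε₂₉ ∧ ⟨abs box at θ₁₃ᶜᶜᴹᵂᶻᴮ(j; ½; a₀; …) on ]0, γ₀]⟩ ∧ ∃ (b r γ₁ M), 0 < γ₁ ∧ ⟨rows (i) (iv) (C)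
at level γ₁⟩` (= the cofinal engine's `hβc` VERBATIM); EVERY OTHER BINDER (the N06 block of «WA», `hN06`, `hN07`, `hN08`, `h09 hN09T h10 h11N hEfl h13pos`, `ε`, `Efl`, `M₁ R hM₁`) and the
CONCLUSION are BYTE-IDENTICAL; the one `refine` names the cofinal engine's §2 and passes `hβc` last.  Import delta: engine v2 ↦ the cofinal engine `…N24K1R9ByNameOfCofinalBetaSocketV23GridGBChildrenSplitSlot8Thm1AEPosN09T5AtGaussPinPrintedZBY`
(this seat, INTENT-4; its prelude takes the radius from `hβc`, reads the K0 door there, re-letters the box by k0's census and moves the rows to the window edition by `K1RunRowsBoxCongr`); `K0V23Defs` no longer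
imported∕opened (no K0 stub text is displayed: stub 1ᴮ proved, 2′ printed, 3ᴬ′ᴮ∕«2′» subsumed by `hβc`).  In the inherited prose BELOW every «`h3` = the ONE open registered V23 stub» phrase now reads «`hβc`
= the cofinal β-socket», and «`hrowsR` per door» reads «the rows inside `hβc` at the producer's radius».  Nothing of Bałaban newly asserted; K0⁷ ∕ N06 ∕ N09 ∕ N24 NOT discharged; no count∕pointer claimed.
INHERITED HEADER of ✓p781921 (engine-v2 edition note, then face-101's N06-keyed lineage and child-slot accounts; read with the substitutions above):
ENGINE v2 EDITION = ✓p781921 `…N24K1FaceTrN06WASCN07N08N09T5V23JunctionLSlot8KappaPrimeAtGaussPinPrintedZBY` (its header: why the «N09T5» lineage is red by import post-campaign, the engine swap, `h1G3` GONE ∕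
`h3` RETYPED to the V23 text, the import delta, closure ∩ residue = ∅) — not repeated here.
INHERITED HEADER of the WA-keyed face-101 bytes (N06-keyed lineage and child-slot accounts; read with the substitutions above):
EDITION (α5) AT N06's EDITION «WA» (THIS FILE = the K1 FACE OF RECORD #11576 ✓p774703 `…N24K1FaceTrN06VUSCN07N08N09T5JunctionLSlot8KappaPrimeAtGaussPinPrintedZBY` — VU-keyed, over the engine «N09T5» #11022 ✓p755526 with the door-pinned per-door display; referee dag-ref-H g35 READ-617 PASS · NON-VACUITY rows carried · 0 NIT-blocking, chair lead g37 ■ #11576 2026-08-30 13:24Z (director-ym №378 waiver); lineage: the (α5) face of record p737119 at «UD» (FLAG №8′ CLOSED OF RECORD on it, director-ym №302∕№303, dag-ref-H g33 V-591∕V-592, chair T-300″) re-keyed «UJ» p740270 → «UN» p745609 → «UT» p750549 (#10992, ■ BATCH 66) → over «N09T5» p755614 (#11026, ■ BATCH 68) → «VD» p759737 (#11108, ■ BATCH 73) → «VH» p763064 (#11173, ■ BATCH 76) → «VL» p765906 (#11256) → «VO» p768254 (#11396) → «VQ» p771275 (#11520) → «VU» p774703 (#11576) — with the N06 certificate read from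 edition «WA» instead of «VU»; the instantiation (α5), the engine «N09T5», the door pins and every other slot UNCHANGED).  HISTORY OF THE INSTANTIATION: FLAG №8 was RE-OPENED AT THE (α4) FACE ONLY — chair lead g30 T-299⁺ 2026-08-29 17:36Z, YM-PLAN v0.13.34 row 06; referee dag-ref-H g33 VERDICT 587 RE-LABELLED + INSTANTIATION VERDICT «LOCATED-19: YES»; kernel witness dag-n06-c g18 `B9BetaNotchMemberV1.not_exists_sections_memberY` p735619).  At (α4) (`J := MemberY …`, `f := id`; face `…N24K1FaceTrN06UDN07N08N09T3JunctionLSlot8KappaPrimeAtGaussPinPrintedZBY` p731579) the displayed pair `(ιB F) (hι F)` asked a RIGHT INVERSE of `β` at EVERY member of the record, and the tree's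
index set `MemberY` contains «notch» members whose `β` is not onto ([Balaban1984PropagatorsII] (2.3) p.224, (2.45) p.231 as typed): that pair is UNSATISFIABLE for every `F`, so the (α4) face was VACUOUS at
its l.253 (A3).  HERE the certificate's free index `{J : Type} (f : J → MemberY …)` is instantiated at the SURJECTIVE-β SUB-FAMILY — `J := {x : MemberY (stage3OfFamily F).d₆ … (Mstar F) // Function.Surjective (β x.toKIdx.hN x.toKIdx.D x.toKIdx.hk)}`, `f := Subtype.val` — and the pair is CONSTRUCTED (Mathlib), not displayed: `ιB := fun j => Function.surjInv j.2`,
`hι := fun j s => Function.surjInv_eq j.2 s` (dag-n06-c g18's published cure, 2026-08-29 17:33Z).  The three remaining `J`-indexed rows `C38 hunitA hnbrB` are displayed over that sub-family (`j.1` = the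
member; at editions from «UF» on only `C38` is left of them — `hunitA` is SUPPLIED inside the certificate by dag-n06-c∕dag-n06-j, `hnbrB` likewise gone); the certificate's own member-indexed `∀ x : MemberY …` rows are ITS text (edition «UD») and stay verbatim.  The sub-family is NON-EMPTY at every `M⋆` — a constant-level member (one empty top
level) has `β` onto: `B8Thm2TorusMemberCatalogue.surjective_beta_of_constLev` ∕ `exists_constLev_member`, packaged as a `MemberY` by dag-n06-c's carrier `B9SectionCarryingMembersV1`
(`exists_member_surjective_beta`, `SCMemberY.nonempty`; its `SCMemberY` IS this subtype) — CITED, not re-proved: no binder of this face needs it.  HONEST SCOPE of the N06 pin after (α5): the leaf is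
certified over the section-carrying members ONLY (node00-def-Y g28: the coded carrier's design intends the whole member type — this is NARROWER and says so); N06 NOT discharged; the engine's `∃ Y₀`
socket stays junk-inhabitable (no N06 → K1 credit); 388 displayed N06 binders = «WA»'s 390 (as Skolemised here) minus `ιB hι`.  STATEMENT DELTA w.r.t. the K1 face of record #11576 ✓p774703 = the N06 display re-keyed «VU» → «WA» ONLY (instantiation (α5), engine «N09T5» ✓p755526 by import, the five door-pinned per-door families `h09 hN09T h11N h13pos hrowsR`, the N07∕N08∕N10∕N13-`hEfl`∕K0 slots and the conclusion BY NAME untouched; w.r.t. the previous face of record #11520 ✓p771275 (VQ-keyed) = that delta + the N06-display delta «VQ» → «VU» (GONE 3 `hC2 h36A hGsqAS` · NEW 19 = 12 window numerics + `h36A' OcA hGsqOA BcA hBcA hB₀geA h36Ab` · RETYPED 0)). W.r.t. #11576 binder by binder (VU → VW → VY → WA): GONE the eight mix∕fac cube∕walk letters of VU and `hfacO` (WA); NEW `O near hnear hOagr hOsym hOloc hOlocT hmixO` (VW∕VY) + `δM hδM hM1L hδ1L hθ1L hMixO hOneO` (WA); RETYPED `h36b h36H hopI h𝔈` (VW: cube∕walk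 letters ↦ the generic `O`-letter) — exact lists in the INTENT line's binderdiff.

TRACK A (YM-PLAN §2d, node N24 of 28 = binder B2), seat `pub-ymgap-dag-n24-c` (R134 s2; gen 20, INTENT-101).  Summits lane; count-neutral.  [4] = [Balaban1985BackgroundPropagators]; [B8] = [Balaban1985RegularSpaces];
[V] = [Balaban1989LargeFieldII]; [III] = [Balaban1988Convergent]; [I] = [Balaban1987RG1]; [B11] = [Balaban1985Variational].

WHAT THE FACE IS — COMPACT FORM (the edition-by-edition lineage of the N06 display «UD» → … → «WA», of the N09 door editions «N09T»…«N09T5», of the instantiations (α3)∕(α4)∕(α5) and of the engine editions is in the module docstring of the K1 FACE OF RECORD #11884 ✓p782330 `…N24K1FaceTrN06WASCN07N08N09T5V23CofJunctionLSlot8KappaPrimeAtGaussPinPrintedZBY` VERBATIM and is not repeated here — this file's statement differs from #11884 ONLY in the N06 block, see the CASCADE-K paragraph above).  The theorem = ONE `refine` of the COFINAL β-SOCKET ENGINE ✓p782234 `…N24K1R9ByNameOfCofinalBetaSocketV23GridGBChildrenSplitSlot8Thm1AEPosN09T5AtGaussPinPrintedZBY` §2 — the K1 engine at the Z3 member (`εbg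 := a₀`, printed z, witness slot `Slot8κ′`), K0⁷ ⊕ NODE O entering as the ONE binder `hβc` (sign-free β-box + run rows (i)(iv)(C) at a producer radius) — with FOUR child slots FED BY NAME and their suppliers' hypotheses DISPLAYED: NODE N06 = dag-n06-d's Stage-11 certificate (HERE the CASCADE-K edition «KC» `N06AtOpsYSectEStKnitPairKC.b9LeafXUR_opsYSectESt_knit_pairKC`) by a per-door `have` typed at N06's object of record and fed to the engine's carrier-generic socket `∃ Y₀ : PrintedCarriers9X, B9LeafX Y₀` (JUNK-INHABITABLE — `exists_b9LeafX_vacuous`; the N06 binders are load-bearing for the typed `have`, NOT for the conclusion through that socket; NO N06 → K1 credit is claimed); NODE N07 = NODE 00's Sect.-E presentation `CarriersZSectE.b11Leaf_Z11OfRecord_withSectE_of_parts` at print's letters from `hN07` (the presentation, n16's bridges + laws + capped existence leaves, sign∕size relations, the six remaining printed parts `Prop2∕3∕5∕8Printed`, `SectFPrinted`, `Prop9Printed`); NODE N08 = dag-n08-w4's `…N08AlphaEq324RowACReMassedZSlot.printedUV3V_at_slotOfRecord_of_coreLTAtAC_of_massBoundZAE_of_consts` at `N := 2, L := F.L` from `hN08`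 (the (α)-AC residual); NODE N09's THEOREM-3 door = dag-n09-w2's `thm3Member_forall_stage13SepCoPH_onDomains_of_axialOn_of_reg8_of_suppPt` INSIDE the engine from `hN09T` (the eight structural Thm-3 input rows at the door's letters; `hle := le_rfl`, threshold `ε₀ := 2a₀∕L²` chosen inside; per-door caveat LOCATED-N09NUM as on #11884) + the Lemma-4 leaf `h09`; N10 `h10` (display-only); N11 `h11N` (n11's supplier rows at the Gauss pin); N13 `h13pos` + `hEfl`; N05 inside the N05∕N06 slot `hN06` (43 conjuncts: Hölder pair + [4]'s letters) read through dag-n05-d's ζ-L door BY NAME with print's trace state `(τ, C_τ) = (tr, 2)` on `(stage3OfFamily F).𝔸 = M₂(ℂ)` by name (`Record12NumericsFamilyTraceState.exists_traceState_stage3OfFamily`).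

WHICH CHILD BLOCKS AT THE Z3 GAUSS PIN AFTER THIS FILE (= its hypotheses): K0⁷ ⊕ NODE O = `hβc`, the COFINAL β-SOCKET (abs box + run rows at a producer radius; K0's stub 1ᴮ proved, 2′ printed); the LOCATED-K0ε₀ letter `2a₀ ≤ ε₀L²` DERIVED inside the engine (DEF-1 g29: ε₀-blind β, edition «N09T3»); per `F` at `stage3OfFamily F`: the N05∕N06 slot `hN06`;
**N06 = 388 of edition «WA»'s 390 certificate binders VERBATIM** (as Skolemised here; `ιB hι` CONSTRUCTED at (α5), `C38` over the section-carrying sub-family); **N07 `hN07`**;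
**N08 `hN08`**; N10 `h10` (display-only, inhabited AS TYPED, p685841); per door: N09 `h09` ([I] Lemma 4 leaf) + **`hN09T` (the eight structural Thm-3 input rows)**, N11 `h11N` (FLAG №1), N13 `h13pos` + `hEfl`,
NODE O `hrowsR`; `0 < ε`.  OFF the bill: N06's ∕ N07's bare leaves, N08's bare slot, N09's Thm-3 CONCLUSION and its EPSBG letter, N13's level 0, `logz`, the trace state.

FLAG №14 (director-ym №256) — STATE OF RECORD: the family dictionary is RECORD-NONABELIAN (`(stage3OfFamily F).𝔸 = Matrix (Fin 2) (Fin 2) ℂ`, `rfl`, `Record12NumericsColourTie.stage3OfFamily_𝔸`;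
`FiniteDimensional ℝ (stage3OfFamily F).𝔸` BY NAME from `Node00.finiteDimensional_𝔸_stage3OfFamily`); N06's certificate binders read the dictionary's GEOMETRY only (`d₆ ℓ₆ hd' hL' b₀ b₁`; 0 occurrences
of `θ.𝔸`) over print's cube class with coefficients `Matrix (Fin 2) (Fin 2) ℂ` ∕ `specialUnitaryUnits (Fin 2)` (SU(2) AS TYPED); no K-display movement claimed.

HONEST FRAMING.  Composition BY NAME (one typed `have` per door for N06, one `refine` of the engine, p688041's N05∕N06-slot proof); NO estimate of Bałaban's proved here; every family DISPLAYED as a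
hypothesis (CONDITIONAL, audit `proof.conditional`) — every letter schema of N06's certificate and every N09 input family REMAINS a displayed hypothesis, now on the K1 face; `Efl`, `ε` FREE; NOT a
claim that the Z3 member IS K1⁹'s witness; NO open V23 stub proved or closed (stub 1ᴮ's proof is k0's, consumed through the engine's door package); **N06, N07, N08, N09 NOT discharged** (no «DISCHARGE CLAIMED» line exists for any; the chair books discharges on
referee reads, R417); N05's discharge is R467's; N10 ∕ N11 ∕ N13 NOT discharged; N24 COMPOSITE — no count moved (typed 28∕28 · discharged 8∕28, 8∕27 excl. NODE O); K0⁷ «V23 1∕2 (+2′)» (chair B89) ∕ K1⁹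
stmt-QuantumFields-27364 (DECIDING; v10 0∕6, HARD FREEZE respected — Theorems side only) ∕ K3⁸ OPEN; one finite 𝕋⁴ programme at fixed ε, Bałaban AS PRINTED; R4 = the conditional finite-𝕋⁴ rung
`BalabanLadder.UV` only — NOT continuum ∕ ℝ⁴ ∕ OS ∕ mass gap ∕ Clay: the Yang–Mills mass gap is NOT proved by any of this.  No `sorry`, `def`, `instance`, `notation`.  Elaboration options as the
certificate's own (`maxHeartbeats 800000`, `synthInstance.maxSize 2048`, `maxRecDepth 8192`).
-/

noncomputable section

open scoped Matrix.Norms.L2Operator BigOperators open Filter Topology MeasureTheory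

namespace Summit.QuantumFields.YangMills.BalabanUVNodes.N24K1FaceTrN06KCSCN07N08N09T5V23CofJunctionLSlot8KappaPrimeAtGaussPinPrintedZBY

open Literature.MathematicalPhysics.QuantumFieldTheory.Balaban1983to89 open Literature.MathematicalPhysics.QuantumFieldTheory.Balaban1983to89.Node00 open DagBinding T4Continuum T4DatumAssembly FlowStepRuns AveragingRT open FlowStep (RGEqH prefixOf BetaLowerH BetaUpperH clampPrefix Y) open Literature.MathematicalPhysics.QuantumFieldTheory.Balaban1983to89.B8LeafModelZd (ZdIdx)

open Literature.MathematicalPhysics.QuantumFieldTheory.Balaban1983to89.B9SupplySockB9P3ZdLetters (OpsZd)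

open Literature.MathematicalPhysics.QuantumFieldTheory.Balaban1983to89.B9SupplySockB9P3ZdH2Per (holderAtIH2Per_anti)

open T4TermwiseTorus (IsPeriodic) open MatrixLog B7Prop2Explicit B7Prop1Local B7Eq92Concrete open B8Ineq132 (InAk covDerivFwd) open B8Eq119TwistedAxial (bgT) open B8Eq140Level (SideTouches) open B8Eq138LandauZd (covLap QT) open B7Eq78Linearization (zdBlocking QprimeIter) open B8Eq1117Concrete (XSpace) open B8Prop5ContractionKLevel (Bd2) open B8LambdaSpaceKLevel (wt)

open Summit.QuantumFields.YangMills.Theorems.BalabanUVNodesN11GaussianCertificateDefs (gaussPinH) open Summit.QuantumFields.YangMills.Theorems.BalabanUVNodesN11Sect3SupplyChainDefs (Sect3Supplier) open Summit.QuantumFields.YangMills.Theorems.BalabanUVNodesN11Sect3SupplyChainObligationsDefs (SupplierObligations OperandRowsAlongChain) open Summit.QuantumFields.YangMills.BalabanUVNodes.N05SubBP2DK2PerKappaSlotExistsOfBindersLettersPerDoorL (exists_residB8_slot8κ'_of_bindersLettersPer_doorL) open Summit.QuantumFields.YangMills.BalabanUVNodes.N24K1R9ByNameOfCofinalBetaSocketV23GridGBChildrenSplitSlot8Thm1AEPosN09T5AtGaussPinPrintedZBY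 (N24_stabilityBRunRowsAtRecordR13SepCoPHV_byName_of_cofinalBetaSocketZBV23_of_childrenSplitSlot8DoorPinnedN09Thm3InputsN11SupplierRowsThm1AEPos_atGaussPinPrintedZB_pinY) open T4Continuum (T4Family) open Node00 open B9PinMembersKLevelV1 (MemberY geo9Y) open B9PinGeometryKLevelV1 (c35Y) open B7Prop2SpecialUnitary (specialUnitaryUnits) open B9CoReadingCoordsHolderAdm (holderProbesKA) open B9CoReadingCoordsHolderSNear (holderProbesSN) open B9WalkLettersOpsO (opsWalkYO dirOpsWalkYO dirLettersWalkYO agreeWalkYO) open B9Thm37CubeCoverCommutators (cutMulY hTY) open Node00 (SiteY SiteOpY deltaPrimeAY) open B9WalkLettersOps (nearDomY) open B9SmoothHolderClassPI (bHZPIfam bHZKPIfam) open B9RWSums347DefiniteFaces (exp261) open B9RWSums344Input (inputConst44 inputConst45) open B9RWSums343Holder (holderConst) open B9Thm37Whole (const37) open B9WalkLettersOps (thetaWalkY KcWalkY) open B9SmoothHolderClassP (bHZPG bHZKPG) open B9SmoothHolderClassPProducers (CTel) open B9Ineq349SiteThresholdRateNamed (cg349) open B9Thm39ReadingAtLetters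 (basis39 κ39) open B9MultiscaleSmoothPartitionYNear (rNear) open B9Thm313WholeDvHolderAtPinsGraded (thetaL CJG) open B9MultiscaleSmoothPartitionYLip (CLip) open B9GradViaDivLettersTransported (taxiS taxiB) open B9BackgroundsKLevelV1P (bg9YP) open B9RWSums346MixedFactorOfLegsY (MLeg BLeg) open Node00.OpsYBondMapOfRecord (bIYOfRecord) open B9Thm315SectEStarRepAtLettersR (DecayMidOnStY) open B9BackgroundsKLevelV1R (RegFamY MemOfFam bg9YR regYP335 regYP336) open B9LeafXClassAntitone (ClassIncl) open B9PinGeometryKLevelV1B (c35B) open DagBinding (B9LeafX) open B9Thm39WholeBlk (Conv348Blk) open B9Thm39OneCubeReadingAtLettersY (oneCubeOps39YF) open B9RowSum261DefiniteFaces (rowConst261) open B11SectG (BlockNorm) open B9Thm34Ext (toB6) open B9CoRealizesRelAtLetters (RelB) open B6Ineq2142KLevelV1 (β) open B9PinGeometryKLevelV1 (kLab) open B9Thm314GpFlatTorusGeometry (tdistK OmegaC) open B9Thm314WholePinGeometry (locDataY) open B9Thm314WholePair (locData₂)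
open B9Thm314WholePairWalks (pairWalkSets) open B9Thm314WholeSummation (WalkSetsSpec WalkWeightsSummable) open B9SectCWalkTermsAllNorms (Thm310AllNormsPrinted) open B9Thm314WholeExpansionReads (ExpansionReads) open B9Thm314WholeCancellationLayer (pairOp) open B7Prop2Explicit (C0 c2') open B6RandomWalk (HasMajorant) open B6GlobalChartV1 (blkV1) open B9GeoNbrCountBlocksY (nbrM₀BY nbrCountBY) open B9SectBAllBlocksGeometryY (geoBY) open B6Geom246MultiLevelBox (blkOf) open B9Eq352DivFormLetters (conj) open B9Eq352GradLetters (diffLetter) open B9Thm310Whole (Ops310 WalkReading310 Sizes310 StaticOK310 Locality310) open B9Thm310WholeDir (DirLetters310 Identities310₂) open B9RWSumsDefinitePins (PinPrims) open B9RWSumsDefinitePinsPair (PairPrims) open B9RWSumsDefinitePinsPairM (MixedPrims) open B9Thm37KLetterDir (HolderV37Dir FactorsInputPair37Dir) open B9RWSums344InputPair (InputLegsPair37 InputLegsPair310 FactorsInputPair310) open B9RWSums346MixedPair (L2MixedLegs310 FactorsL2Mixed310 L2MixedLegs37) open B9CoReadingCoordsTranspose (TrIdx trBasis) open B9RWSums346SecondDiff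 (DirOps310 L2SecondLegs310) open B9RWSums346SecondDiffGp (L2SecondLegs37) open B9Thm37Glue (IsTransposePair) open B9RWSums346Two (L2TwoLegs310 FactorsL2_310) open B9RWSums343Holder (HolderProbes HolderLegs310 FactorsHolder310) open B9RWSums343HolderGp (HolderLegs37) open B9Thm39ReadingCoords (cR39) open B9CoReadingCoords (XBK blkBK GcoK DcoK DscoK LcoK coordOpK cdBₗ cdsBₗ) open B9CoReadingCoordsS (XSK sIK) open B9Thm311ReadingCoords (IsSymmTr) open B9GeoNbrCountKLevelV1 (nbrM₀Y nbrCountY) open B9CoReadingCoordsH (XHK) open scoped Matrix.Norms.L2Operator open B9CoReadingCoordsHolder (PK) open B9CoReadingCoordsInput (bHK) open B9CoReadingCoordsInputS (bHS) open B9WalkLettersCoordsS (SblkY walkCntM₀Y walkCntY nearBlkCntY) open B6Cover236MultiLevelBlocks (cubes) open B9Thm39ReadingCoords (coordBound39 basisBound39) open B9RowSum261DefiniteFaces (rowConst261) open B9MultiscaleSmoothPartitionYNear (rNear) open Node00 (CfgY IBondY) open B9Eq360DeltaPrimeAY (AfldY) open Summit.QuantumFields.YangMills.BalabanUVNodes.N06AtOpsYSectEStKnitPairKC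 (b9LeafXUR_opsYSectESt_knit_pairKC) open Literature.MathematicalPhysics.QuantumFieldTheory.Balaban1983to89.B9SectionCarryingMembersV1 (SCMemberY)
open Node00.OpsYSectDCoords (TpicoK T2coK RcoK) open Node00.OpsYOps312OfRecordPar (S0coKq QcoKHq QscoKHq CcoKq C1coKq) open B9CoReadingCoordsH (blkHK HcoK) open Node00.OpsYQLetter (qKnitOfRecord qsKnitOfRecord) open B9B8AveragingJunction (parKnitY) open B9C2FormBoxRegimeY (Kpl) open B6KLevelCensusIndexV1 (kGeo) open B9Thm311ReadingCoords (PosDefTr) open Node00 (Y9OfRecordUPbParH kernelFamilyS kernelFamilyB cqY GAQY GpY parBY opsYSectESt deltaAQY) open B9SectBCodedReadingsUParH (SectBStepUPar) open B9SectBKerFrameCodedYR (CinvY) open B9SectBCodedClassGY (C37GY) open Node00 (opsYS349NuOfLettersH) open Node00.OpsYExpsOfRecordV3Par (expsYOfRecordV3Par) open B9Thm39OneCubeReadingAtLettersY (oneCubeOps39) open B9Thm39ReadingAtLetters (L39) open B9Ineq349SiteFromConv348 (blk39F) open B9BackgroundsKLevelV1R (siteKernelR) open B9SectDSup (weightNorm)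 open B9BackgroundsKLevelV1R (fineKernelR) open B9GeoLemma21KLevelV1 (geo9Y_len_pos) open B9Thm312Whole (cNorm) open B11SectG (HasMaj) open B9Thm311ReadingCoords (PosDefTr) open B9CoReadingCoordsS (blkSK GcoS) open B6Ineq2142KLevelV1 (lvl) open B9PerturbationL2Delta2 (D2coK) open B9Thm313WholeRgdFrom3152 (Ids3152) open B9SectDSup (weightNorm) open B9LettersHZAtOne (plateau_pos) open B9Thm312WholeIdentitiesSplit (Ids3124) open Node00.OpsYSectDCoords (DvcoKH DvscoKH) open B9SectBCodedClassR (bg9YC extraYPb)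

set_option maxHeartbeats 2400000 in set_option synthInstance.maxSize 2048 in set_option maxRecDepth 8192 in
/-- **★★★★ THE K1 FACE AT THE Z3 MEMBER, EDITION «N09T5» AT N06's CASCADE-K EDITION «KC» (knit object of record), INSTANTIATION (α5)** — K1⁹ `StabilityBRunRowsAtRecordR13SepCoPHV` (stmt-QuantumFields-27364) BY ITS ROUTE NAME: ONE `refine` of the «N09T3»
engine's §2 (the two REGISTERED V22-Z stubs displayed BY NAME; per-door rows at the Gauss pin of `θZB(π)`, `εbg := a₀`, printed z) with NODE N06's leaf = a per-door `have` TYPED AT N06's OBJECT OF RECORD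
`B9LeafX (Y9OfRecordUPbParH (J := SCMemberY (stage3OfFamily F).d₆ (stage3OfFamily F).ℓ₆ (stage3OfFamily F).hd' (stage3OfFamily F).hL' (stage3OfFamily F).b₀ (stage3OfFamily F).b₁ (Mstar F)) 2 (stage3OfFamily F) (Mstar F) (opsYNuStOfRecordV11KSE 2 (stage3OfFamily F) (Mstar F) (𝔯 F) (sectEStYOfRecordV7 2 (stage3OfFamily F) (Mstar F) (𝔢₀ F)) (𝔴 F) (𝔈 F)) SCMemberY.val (bR F) SCMemberY.ιBsc (C38 F) (fun (j : SCMemberY (stage3OfFamily F).d₆ (stage3OfFamily F).ℓ₆ (stage3OfFamily F).hd' (stage3OfFamily F).hL' (stage3OfFamily F).b₀ (stage3OfFamily F).b₁ (Mstar F)) => parKnitY j.val.toKIdx) (fun (j : SCMemberY (stage3OfFamily F).d₆ (stage3OfFamily F).ℓ₆ (stage3OfFamily F).hd' (stage3OfFamily F).hL' (stage3OfFamily F).b₀ (stage3OfFamily F).b₁ (Mstar F)) => parSymY j.val.toKIdx) (fun (j : SCMemberY (stage3OfFamily F).d₆ (stage3OfFamily F).ℓ₆ (stage3OfFamily F).hd'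 (stage3OfFamily F).hL' (stage3OfFamily F).b₀ (stage3OfFamily F).b₁ (Mstar F)) => GAQY j.val.toKIdx (qKnitOfRecord 2 (stage3OfFamily F) j.val.toKIdx) (qsKnitOfRecord 2 (stage3OfFamily F) j.val.toKIdx) (parKnitY j.val.toKIdx) (GpY j.val.toKIdx (parKnitY j.val.toKIdx))))`
proved by dag-n06-d's CASCADE-K certificate `N06AtOpsYSectEStKnitPairKC.b9LeafXUR_opsYSectESt_knit_pairKC` (edition «KC») at the door view (instantiation (α5): `J` = the surjective-`β` members, `f := Subtype.val`, `ιB := SCMemberY.ιBsc` (`Function.surjInv`; the K-certificates carry no `hι`); its other binders = this theorem's N06 hypotheses VERBATIM, Skolemised in `F`) and fed to the engine's carrier-generic (junk-inhabitable —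
header) socket as `⟨_, h06 F …⟩`; NODE N07's leaf by `⟨ζ.withSectE E, CarriersZSectE.b11Leaf_Z11OfRecord_withSectE_of_parts …⟩` from `hN07`; NODE N08's slot by dag-n08-w4's
`printedUV3V_at_slotOfRecord_of_coreLTAtAC_of_massBoundZAE_of_consts` from `hN08`; NODE N09's THEOREM-3 door by dag-n09-w2's `thm3Member_forall_stage13SepCoPH_onDomains_of_axialOn_of_reg8_of_suppPt`
INSIDE the engine from `hN09T` (`hle := le_rfl`; threshold `ε₀ := 2a₀∕L²` chosen inside); N05 through ζ-L at `Slot8κ′` with print's trace state by name.  CONDITIONAL (every family displayed; audit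
`proof.conditional`); not a closure; NO stub used as proved; N06 ∕ N07 ∕ N08 ∕ N09 ∕ N10 ∕ N11 ∕ N13 NOT discharged; no N06 → K1 credit claimed; no count moved.
[cite: Balaban1985BackgroundPropagators, Thms 3.1–3.15 pp.397–432, (3.40)–(3.47) pp.397–398, (3.87)–(3.90) pp.408–409, (3.117)–(3.121) p.419; Balaban1985RegularSpaces, Lemma 1 p.79 – Thm 8 p.101, Prop. 5 p.94, Prop. 6 p.99; Balaban1989LargeFieldII, Thm 1 p.355, (0.1) pp.355–356, (0.15) p.360; Balaban1988Convergent, Theorem p.245, Cor. 3 (2.50) p.264, (3.16)–(3.25) pp.268–270; Balaban1987RG1, (0.14)–(0.17) pp.254–255, Thm 3 p.264, §1 pp.263–264; Balaban1988RG2Cluster, Lemmas 1–3 pp.9–20; Balaban1985Variational, Thm 1 p.279, Props 2–9 pp.281–309, Sect. E (111)–(121) pp.293–296; Balaban1985UV3, Thm 1 p.257, Thm 2 p.272, (41) p.266 (bookkeeping)] -/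
theorem N24_stabilityBRunRowsAtRecordR13SepCoPHV_byName_of_cofinalBetaSocketZBV23_of_n06TorusDataLettersLSlot8KappaPrime_n06CertificateKCSC_n07PartsSectE_n08ResidualAC_doorPinned_n09Thm3Inputs_trM2_stage3DoorFree_n13LevelZero_atGaussPinPrintedZB_pinY (M₁ R : ℕ) (hM₁ : 1 ≤ M₁) (ε : ℝ) (hεz : 0 < ε)
    (Efl : T4Family → ℕ → ℝ → ℝ → ℝ → ℝ → ℝ → ℝ → ℝ → B12.RunParams → ℕ → ℝ)
    -- N05∕N06 SLOT (per F): print's trace state `(τ, C_τ)` is OFF this display since edition «Tr» — a THEOREM at the record algebra `(stage3OfFamily F).𝔸 = M₂(ℂ)` (NODE 00 `Record12NumericsFamilyTraceState`), fed in the proof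
    (hN06 : ∀ (F : T4Family) [FiniteDimensional ℝ (stage3OfFamily F).𝔸],
      ∃ (β : ℝ) (len : B7Prop1Explicit.Site (stage3OfFamily F).D → ℝ) (B₀'H B₂' BG BR cL : ℝ),
        0 ≤ β ∧ (∀ v : B7Prop1Explicit.Site (stage3OfFamily F).D, 0 < len v → 1 ≤ len v) ∧
        0 < B₀'H ∧ 0 ≤ B₂' ∧ 0 ≤ BG ∧ 0 ≤ BR ∧ 0 < cL ∧
        (∀ a : IdxB8SubDPerκ (stage3OfFamily F) (M₁ * (stage3OfFamily F).L) M₁ R, ∀ α₀ : ℝ, 0 < α₀ → α₀ ≤ cL → ∀ U₀ : B7Prop1Explicit.Site (stage3OfFamily F).D → Fin (stage3OfFamily F).D → (stage3OfFamily F).𝔸ˣ, (∀ x κ, U₀ x κ ∈ unitaryUnits (stage3OfFamily F).𝔸) → IsPeriodic (M₁ * (stage3OfFamily F).L) U₀ →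
      InAk (stage3OfFamily F).L a.toZdIdx.k a.toZdIdx.η α₀ a.toZdIdx.Ω U₀ → ∀ n, 1 ≤ n → n ≤ a.toZdIdx.k →
      ∃ (g Δ : (B7Prop1Explicit.Site (stage3OfFamily F).D → (stage3OfFamily F).𝔸) →ₗ[ℂ] (B7Prop1Explicit.Site (stage3OfFamily F).D → (stage3OfFamily F).𝔸)) (q : (B7Prop1Explicit.Site (stage3OfFamily F).D → (stage3OfFamily F).𝔸) →ₗ[ℂ] (ℕ → B7Prop1Explicit.Site (stage3OfFamily F).D → (stage3OfFamily F).𝔸)) (qs : (ℕ → B7Prop1Explicit.Site (stage3OfFamily F).D → (stage3OfFamily F).𝔸) →ₗ[ℂ] (B7Prop1Explicit.Site (stage3OfFamily F).D → (stage3OfFamily F).𝔸))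
        (Aw c : (ℕ → B7Prop1Explicit.Site (stage3OfFamily F).D → (stage3OfFamily F).𝔸) →ₗ[ℂ] (ℕ → B7Prop1Explicit.Site (stage3OfFamily F).D → (stage3OfFamily F).𝔸)) (H' : XSpace (stage3OfFamily F).D n (stage3OfFamily F).𝔸 →ₗ[ℂ] (B7Prop1Explicit.Site (stage3OfFamily F).D → (stage3OfFamily F).𝔸)),
        (∀ x, (∀ (z : B7Prop1Explicit.Site (stage3OfFamily F).D) (i : Fin (stage3OfFamily F).D), x (z + ((M₁ * (stage3OfFamily F).L) : ℤ) • B7Prop1Explicit.e i) = x z) → ∀ y ∈ a.toZdIdx.Ω 0, (Δ (g x) + qs (Aw (q (g x)))) y = x y) ∧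
        (∀ f, (∀ (z : B7Prop1Explicit.Site (stage3OfFamily F).D) (i : Fin (stage3OfFamily F).D), f (z + ((M₁ * (stage3OfFamily F).L) : ℤ) • B7Prop1Explicit.e i) = f z) → q (g (g (qs (c (q f))))) = q f) ∧
        (∀ (f : B7Prop1Explicit.Site (stage3OfFamily F).D → (stage3OfFamily F).𝔸) (z : B7Prop1Explicit.Site (stage3OfFamily F).D) (i : Fin (stage3OfFamily F).D), g f (z + ((M₁ * (stage3OfFamily F).L) : ℤ) • B7Prop1Explicit.e i) = g f z) ∧
        (∀ f : B7Prop1Explicit.Site (stage3OfFamily F).D → (stage3OfFamily F).𝔸, (∀ (z : B7Prop1Explicit.Site (stage3OfFamily F).D) (i : Fin (stage3OfFamily F).D), f (z + ((M₁ * (stage3OfFamily F).L) : ℤ) • B7Prop1Explicit.e i) = f z) →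
      ∀ (z : B7Prop1Explicit.Site (stage3OfFamily F).D) (i : Fin (stage3OfFamily F).D), qs (c (q f)) (z + ((M₁ * (stage3OfFamily F).L) : ℤ) • B7Prop1Explicit.e i) = qs (c (q f)) z) ∧
        (∀ (f : B7Prop1Explicit.Site (stage3OfFamily F).D → (stage3OfFamily F).𝔸), ∀ x ∈ a.toZdIdx.Ω 0, Δ f x = covLap a.toZdIdx.η U₀ ((a.toZdIdx.Ω 0).indicator f) x) ∧
        (∀ (μ : ℕ → B7Prop1Explicit.Site (stage3OfFamily F).D → (stage3OfFamily F).𝔸), ∀ x ∈ a.toZdIdx.Ω 0, qs μ x = QT (stage3OfFamily F).L n (a.toZdIdx.Λs n) U₀ μ x) ∧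
        (∀ (f : B7Prop1Explicit.Site (stage3OfFamily F).D → (stage3OfFamily F).𝔸) (j : ℕ), j ≤ n → ∀ y ∈ a.toZdIdx.Λs n j, q f j y = QprimeIter (zdBlocking (stage3OfFamily F).D (stage3OfFamily F).L) (bgT (stage3OfFamily F).L U₀) j f y) ∧
        (∀ (X : XSpace (stage3OfFamily F).D n (stage3OfFamily F).𝔸) (x : B7Prop1Explicit.Site (stage3OfFamily F).D), ‖H' X x‖ ≤ B₀'H * ‖X‖) ∧
        (∀ j, j ≤ n → ∀ (X : XSpace (stage3OfFamily F).D n (stage3OfFamily F).𝔸), ∀ b ∈ {b : B7Prop1Explicit.Site (stage3OfFamily F).D × Fin (stage3OfFamily F).D | SideTouches (a.toZdIdx.Ω j) b.1 b.2},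
      wt (stage3OfFamily F).L a.toZdIdx.η j * ‖covDerivFwd a.toZdIdx.η U₀ b.2 (H' X) b.1‖ ≤ B₀'H * ‖X‖) ∧
        (∀ X : XSpace (stage3OfFamily F).D n (stage3OfFamily F).𝔸, Bd2 (stage3OfFamily F).L a.toZdIdx.η n a.toZdIdx.Ω (covLap a.toZdIdx.η U₀ (H' X)) (B₂' * ‖X‖)) ∧
        (∀ (X : XSpace (stage3OfFamily F).D n (stage3OfFamily F).𝔸) (x : B7Prop1Explicit.Site (stage3OfFamily F).D), x ∉ a.toZdIdx.Ω 0 → H' X x = 0) ∧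
        (∀ X Y : XSpace (stage3OfFamily F).D n (stage3OfFamily F).𝔸, (∀ b, Y b = -star (X b)) → ∀ x, H' Y x = -star (H' X x)) ∧
        (∀ X : XSpace (stage3OfFamily F).D n (stage3OfFamily F).𝔸, (∀ (b : Fin (n + 1) × B7Prop1Explicit.Site (stage3OfFamily F).D) (i : Fin (stage3OfFamily F).D), X (b.1, b.2 + (((M₁ * (stage3OfFamily F).L) : ℤ) / ((stage3OfFamily F).L : ℤ) ^ (b.1 : ℕ)) • B7Prop1Explicit.e i) = X b) →
      ∀ (z : B7Prop1Explicit.Site (stage3OfFamily F).D) (i : Fin (stage3OfFamily F).D), H' X (z + ((M₁ * (stage3OfFamily F).L) : ℤ) • B7Prop1Explicit.e i) = H' X z) ∧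
        (∀ (Y : XSpace (stage3OfFamily F).D n (stage3OfFamily F).𝔸), (∀ (b : Fin (n + 1) × B7Prop1Explicit.Site (stage3OfFamily F).D) (i : Fin (stage3OfFamily F).D), Y (b.1, b.2 + (((M₁ * (stage3OfFamily F).L) : ℤ) / ((stage3OfFamily F).L : ℤ) ^ (b.1 : ℕ)) • B7Prop1Explicit.e i) = Y b) →
      ∀ (j : ℕ) (hj : j ≤ n) (y : B7Prop1Explicit.Site (stage3OfFamily F).D), y ∈ a.toZdIdx.Λs n j →
      QprimeIter (zdBlocking (stage3OfFamily F).D (stage3OfFamily F).L) (bgT (stage3OfFamily F).L U₀) j (H' Y) y = Y (⟨j, Nat.lt_succ_of_le hj⟩, y)) ∧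
        (∀ (f : B7Prop1Explicit.Site (stage3OfFamily F).D → (stage3OfFamily F).𝔸) (r : ℝ), 0 ≤ r → Bd2 (stage3OfFamily F).L a.toZdIdx.η n a.toZdIdx.Ω f r →
      (∀ x, ‖g f x‖ ≤ BG * r) ∧ ∀ j, j ≤ n → ∀ b ∈ {b : B7Prop1Explicit.Site (stage3OfFamily F).D × Fin (stage3OfFamily F).D | SideTouches (a.toZdIdx.Ω j) b.1 b.2},
        wt (stage3OfFamily F).L a.toZdIdx.η j * ‖covDerivFwd a.toZdIdx.η U₀ b.2 (g f) b.1‖ ≤ BG * r) ∧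
        (∀ (f : B7Prop1Explicit.Site (stage3OfFamily F).D → (stage3OfFamily F).𝔸) (x : B7Prop1Explicit.Site (stage3OfFamily F).D), x ∉ a.toZdIdx.Ω 0 → g f x = 0) ∧
        (∀ f : B7Prop1Explicit.Site (stage3OfFamily F).D → (stage3OfFamily F).𝔸, (∀ j, j ≤ n → ∀ x ∈ a.toZdIdx.Ω j, IsSelfAdjoint (f x)) → ∀ x, IsSelfAdjoint (g f x)) ∧
        (∀ (f : B7Prop1Explicit.Site (stage3OfFamily F).D → (stage3OfFamily F).𝔸) (r : ℝ), 0 ≤ r → Bd2 (stage3OfFamily F).L a.toZdIdx.η n a.toZdIdx.Ω f r → Bd2 (stage3OfFamily F).L a.toZdIdx.η n a.toZdIdx.Ω (f - g (qs (c (q (g f))))) (BR * r)) ∧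
        (∀ f : B7Prop1Explicit.Site (stage3OfFamily F).D → (stage3OfFamily F).𝔸, (∀ j, j ≤ n → ∀ x ∈ a.toZdIdx.Ω j, IsSelfAdjoint (f x)) →
      ∀ j, j ≤ n → ∀ x ∈ a.toZdIdx.Ω j, IsSelfAdjoint ((f - g (qs (c (q (g f))))) x))) ∧
        (∀ a : IdxB8LanCκPer (stage3OfFamily F) (M₁ * (stage3OfFamily F).L) M₁ R, ∀ α₀ : ℝ, 0 < α₀ → α₀ ≤ cL → InAk (stage3OfFamily F).L a.toZdLanIdx.k a.toZdLanIdx.η α₀ a.toZdLanIdx.Ω a.toZdLanIdx.U₀ →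
      ∃ (g Δ : (B7Prop1Explicit.Site (stage3OfFamily F).D → (stage3OfFamily F).𝔸) →ₗ[ℂ] (B7Prop1Explicit.Site (stage3OfFamily F).D → (stage3OfFamily F).𝔸)) (q : (B7Prop1Explicit.Site (stage3OfFamily F).D → (stage3OfFamily F).𝔸) →ₗ[ℂ] (ℕ → B7Prop1Explicit.Site (stage3OfFamily F).D → (stage3OfFamily F).𝔸)) (qs : (ℕ → B7Prop1Explicit.Site (stage3OfFamily F).D → (stage3OfFamily F).𝔸) →ₗ[ℂ] (B7Prop1Explicit.Site (stage3OfFamily F).D → (stage3OfFamily F).𝔸))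
        (Aw c : (ℕ → B7Prop1Explicit.Site (stage3OfFamily F).D → (stage3OfFamily F).𝔸) →ₗ[ℂ] (ℕ → B7Prop1Explicit.Site (stage3OfFamily F).D → (stage3OfFamily F).𝔸)) (H' : XSpace (stage3OfFamily F).D a.toZdLanIdx.k (stage3OfFamily F).𝔸 →ₗ[ℂ] (B7Prop1Explicit.Site (stage3OfFamily F).D → (stage3OfFamily F).𝔸)),
        (∀ x : B7Prop1Explicit.Site (stage3OfFamily F).D → (stage3OfFamily F).𝔸, (∀ (z : B7Prop1Explicit.Site (stage3OfFamily F).D) (i : Fin (stage3OfFamily F).D), x (z + ((M₁ * (stage3OfFamily F).L) : ℤ) • B7Prop1Explicit.e i) = x z) → (∃ C : ℝ, ∀ y, ‖x y‖ ≤ C) →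
          g (Δ x + qs (Aw (q x))) = x) ∧
        (∀ φ : ℕ → B7Prop1Explicit.Site (stage3OfFamily F).D → (stage3OfFamily F).𝔸, (∀ n, n ≤ a.toZdLanIdx.k → ∀ (y : B7Prop1Explicit.Site (stage3OfFamily F).D) (i : Fin (stage3OfFamily F).D), φ n (y + (((M₁ * (stage3OfFamily F).L) : ℤ) / ((stage3OfFamily F).L : ℤ) ^ n) • B7Prop1Explicit.e i) = φ n y) →
          qs (c (q (g (g (qs φ))))) = qs φ) ∧
        (∀ (f : B7Prop1Explicit.Site (stage3OfFamily F).D → (stage3OfFamily F).𝔸), ∀ x ∈ a.toZdLanIdx.Ω 0, Δ f x = covLap a.toZdLanIdx.η a.toZdLanIdx.U₀ ((a.toZdLanIdx.Ω 0).indicator f) x) ∧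
        (∀ (μ : ℕ → B7Prop1Explicit.Site (stage3OfFamily F).D → (stage3OfFamily F).𝔸), ∀ x ∈ a.toZdLanIdx.Ω 0, qs μ x = QT (stage3OfFamily F).L a.toZdLanIdx.k a.toZdLanIdx.Λ a.toZdLanIdx.U₀ μ x) ∧
        (∀ (f : B7Prop1Explicit.Site (stage3OfFamily F).D → (stage3OfFamily F).𝔸) (n : ℕ), n ≤ a.toZdLanIdx.k → ∀ y ∈ a.toZdLanIdx.Λ n, q f n y = QprimeIter (zdBlocking (stage3OfFamily F).D (stage3OfFamily F).L) (bgT (stage3OfFamily F).L a.toZdLanIdx.U₀) n f y) ∧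
        (∀ (f : B7Prop1Explicit.Site (stage3OfFamily F).D → (stage3OfFamily F).𝔸) (n : ℕ) (y : B7Prop1Explicit.Site (stage3OfFamily F).D), ¬ (n ≤ a.toZdLanIdx.k ∧ y ∈ a.toZdLanIdx.Λ n) → q f n y = 0) ∧
        (∀ (f : B7Prop1Explicit.Site (stage3OfFamily F).D → (stage3OfFamily F).𝔸) (z : B7Prop1Explicit.Site (stage3OfFamily F).D) (i : Fin (stage3OfFamily F).D), g f (z + ((M₁ * (stage3OfFamily F).L) : ℤ) • B7Prop1Explicit.e i) = g f z) ∧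
        (∀ μ : ℕ → B7Prop1Explicit.Site (stage3OfFamily F).D → (stage3OfFamily F).𝔸, ∀ n, n ≤ a.toZdLanIdx.k → ∀ (y : B7Prop1Explicit.Site (stage3OfFamily F).D) (i : Fin (stage3OfFamily F).D), Aw μ n (y + (((M₁ * (stage3OfFamily F).L) : ℤ) / ((stage3OfFamily F).L : ℤ) ^ n) • B7Prop1Explicit.e i) = Aw μ n y) ∧
        (∀ (X : XSpace (stage3OfFamily F).D a.toZdLanIdx.k (stage3OfFamily F).𝔸) (x : B7Prop1Explicit.Site (stage3OfFamily F).D), ‖H' X x‖ ≤ B₀'H * ‖X‖) ∧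
        (∀ n, n ≤ a.toZdLanIdx.k → ∀ (X : XSpace (stage3OfFamily F).D a.toZdLanIdx.k (stage3OfFamily F).𝔸), ∀ b ∈ {b : B7Prop1Explicit.Site (stage3OfFamily F).D × Fin (stage3OfFamily F).D | SideTouches (a.toZdLanIdx.Ω n) b.1 b.2},
          wt (stage3OfFamily F).L a.toZdLanIdx.η n * ‖covDerivFwd a.toZdLanIdx.η a.toZdLanIdx.U₀ b.2 (H' X) b.1‖ ≤ B₀'H * ‖X‖) ∧
        (∀ X : XSpace (stage3OfFamily F).D a.toZdLanIdx.k (stage3OfFamily F).𝔸, Bd2 (stage3OfFamily F).L a.toZdLanIdx.η a.toZdLanIdx.k a.toZdLanIdx.Ω (covLap a.toZdLanIdx.η a.toZdLanIdx.U₀ (H' X)) (B₂' * ‖X‖)) ∧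
        (∀ X : XSpace (stage3OfFamily F).D a.toZdLanIdx.k (stage3OfFamily F).𝔸, (∀ (q : Fin (a.toZdLanIdx.k + 1) × B7Prop1Explicit.Site (stage3OfFamily F).D) (i : Fin (stage3OfFamily F).D), X (q.1, q.2 + (((M₁ * (stage3OfFamily F).L) : ℤ) / ((stage3OfFamily F).L : ℤ) ^ (q.1 : ℕ)) • B7Prop1Explicit.e i) = X q) →
          ∀ (z : B7Prop1Explicit.Site (stage3OfFamily F).D) (i : Fin (stage3OfFamily F).D), H' X (z + ((M₁ * (stage3OfFamily F).L) : ℤ) • B7Prop1Explicit.e i) = H' X z) ∧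
        (∀ (Y : XSpace (stage3OfFamily F).D a.toZdLanIdx.k (stage3OfFamily F).𝔸), (∀ (q : Fin (a.toZdLanIdx.k + 1) × B7Prop1Explicit.Site (stage3OfFamily F).D) (i : Fin (stage3OfFamily F).D), Y (q.1, q.2 + (((M₁ * (stage3OfFamily F).L) : ℤ) / ((stage3OfFamily F).L : ℤ) ^ (q.1 : ℕ)) • B7Prop1Explicit.e i) = Y q) →
          ∀ (n : ℕ) (hn : n ≤ a.toZdLanIdx.k) (y : B7Prop1Explicit.Site (stage3OfFamily F).D), y ∈ a.toZdLanIdx.Λ n →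
          QprimeIter (zdBlocking (stage3OfFamily F).D (stage3OfFamily F).L) (bgT (stage3OfFamily F).L a.toZdLanIdx.U₀) n (H' Y) y = Y (⟨n, Nat.lt_succ_of_le hn⟩, y)) ∧
        (∀ (f : B7Prop1Explicit.Site (stage3OfFamily F).D → (stage3OfFamily F).𝔸) (r : ℝ), 0 ≤ r → Bd2 (stage3OfFamily F).L a.toZdLanIdx.η a.toZdLanIdx.k a.toZdLanIdx.Ω f r →
          (∀ x, ‖g f x‖ ≤ BG * r) ∧ ∀ n, n ≤ a.toZdLanIdx.k → ∀ b ∈ {b : B7Prop1Explicit.Site (stage3OfFamily F).D × Fin (stage3OfFamily F).D | SideTouches (a.toZdLanIdx.Ω n) b.1 b.2},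
            wt (stage3OfFamily F).L a.toZdLanIdx.η n * ‖covDerivFwd a.toZdLanIdx.η a.toZdLanIdx.U₀ b.2 (g f) b.1‖ ≤ BG * r) ∧
        (∀ (f : B7Prop1Explicit.Site (stage3OfFamily F).D → (stage3OfFamily F).𝔸) (r : ℝ), 0 ≤ r → Bd2 (stage3OfFamily F).L a.toZdLanIdx.η a.toZdLanIdx.k a.toZdLanIdx.Ω f r →
          Bd2 (stage3OfFamily F).L a.toZdLanIdx.η a.toZdLanIdx.k a.toZdLanIdx.Ω (f - g (qs (c (q (g f))))) (BR * r))))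
    -- NODE N06's LEAF: dag-n06-d's Stage-11 certificate b9LeafXUR_opsYSectESt_knit_pairKC (CASCADE-K «KC») — its binders VERBATIM (N := 2, θ.toStage3Params := stage3OfFamily F), Skolemised in F; instantiation (α5) (`J := SCMemberY …`, `f := SCMemberY.val`, `ιB := SCMemberY.ιBsc`)
    (Mstar : ∀ F : T4Family, ℕ) (𝔯 : ∀ F : T4Family, ResY 2 (stage3OfFamily F) (Mstar F)) (𝔢₀ : ∀ F : T4Family, SectEY 2 (stage3OfFamily F) (Mstar F)) (𝔴 : ∀ F : T4Family, RWEY 2 (stage3OfFamily F) (Mstar F)) (𝔈 : ∀ F : T4Family, ExpsY 2 (stage3OfFamily F) (Mstar F)) (𝔈₀ : ∀ F : T4Family, ExpsY 2 (stage3OfFamily F) (Mstar F)) (R₁ R₂ : ∀ F : T4Family, RegFamY (stage3OfFamily F).d₆ (stage3OfFamily F).ℓ₆ (stage3OfFamily F).hd' (stage3OfFamily F).hL' (stage3OfFamily F).b₀ (stage3OfFamily F).b₁ (Mstar F) (Matrix (Fin 2) (Fin 2) ℂ)) (c : ∀ F : T4Family, ℝ) (hcB : ∀ F : T4Family, c35B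 (stage3OfFamily F).ℓ₆ ≤ (c F)) (hc : ∀ F : T4Family, 0 < (c F)) (hGR : ∀ F : T4Family, MemOfFam (specialUnitaryUnits (Fin 2)) (R₁ F)) (hRP1 : ∀ F : T4Family, ∀ (x : MemberY (stage3OfFamily F).d₆ (stage3OfFamily F).ℓ₆ (stage3OfFamily F).hd' (stage3OfFamily F).hL' (stage3OfFamily F).b₀ (stage3OfFamily F).b₁ (Mstar F)) (α₀ : ℝ) (U : (bg9YR (Matrix (Fin 2) (Fin 2) ℂ) (specialUnitaryUnits (Fin 2)) (R₁ F) (R₂ F) x).Cfg), (bg9YR (Matrix (Fin 2) (Fin 2) ℂ) (specialUnitaryUnits (Fin 2)) (R₁ F) (R₂ F) x).Reg335 (c F) α₀ U → 0 ≤ α₀ ∧ (bg9YP (Matrix (Fin 2) (Fin 2) ℂ) (specialUnitaryUnits (Fin 2)) x).Reg335 c35Y α₀ U) (hP1 : ∀ F : T4Family, ClassIncl (regYP335 (Matrix (Fin 2) (Fin 2) ℂ) (specialUnitaryUnits (Fin 2))) c35Y (R₁ F) (c F)) (hP2 : ∀ F : T4Family, ClassIncl (regYP336 (Matrix (Fin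 2) (Fin 2) ℂ) (specialUnitaryUnits (Fin 2))) c35Y (R₂ F) (c F)) (instN06_1 : ∀ F : T4Family, ∀ x : MemberY (stage3OfFamily F).d₆ (stage3OfFamily F).ℓ₆ (stage3OfFamily F).hd' (stage3OfFamily F).hL' (stage3OfFamily F).b₀ (stage3OfFamily F).b₁ (Mstar F), Fintype (geo9Y x).Site) (instN06_2 : ∀ F : T4Family, ∀ x : MemberY (stage3OfFamily F).d₆ (stage3OfFamily F).ℓ₆ (stage3OfFamily F).hd' (stage3OfFamily F).hL' (stage3OfFamily F).b₀ (stage3OfFamily F).b₁ (Mstar F), DecidableEq (geo9Y x).Site) (instN06_3 : ∀ F : T4Family, ∀ x : MemberY (stage3OfFamily F).d₆ (stage3OfFamily F).ℓ₆ (stage3OfFamily F).hd' (stage3OfFamily F).hL' (stage3OfFamily F).b₀ (stage3OfFamily F).b₁ (Mstar F), Fintype (geoBY x).Site) (instN06_4 : ∀ F : T4Family, ∀ x : MemberY (stage3OfFamily F).d₆ (stage3OfFamily F).ℓ₆ (stage3OfFamily F).hd' (stage3OfFamily F).hL' (stage3OfFamily F).b₀ (stage3OfFamily F).b₁ (Mstar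 F), DecidableRel (RelB x.toKIdx)) (bI : ∀ F : T4Family, ∀ x : MemberY (stage3OfFamily F).d₆ (stage3OfFamily F).ℓ₆ (stage3OfFamily F).hd' (stage3OfFamily F).hL' (stage3OfFamily F).b₀ (stage3OfFamily F).b₁ (Mstar F), FBondY x.toKIdx → IBondY x.toKIdx) (hbI : ∀ F : T4Family, (bI F) = bIYOfRecord (stage3OfFamily F) (Mstar F)) (α' r39 δ39 B39 a39 M39 : ∀ F : T4Family, ℝ) (hα'0 : ∀ F : T4Family, 0 < (α' F)) (hα'1 : ∀ F : T4Family, (α' F) < 1) (hr39 : ∀ F : T4Family, 0 < (r39 F)) (hrδ39 : ∀ F : T4Family, (r39 F) ≤ (δ39 F)) (hB39 : ∀ F : T4Family, 0 < (B39 F)) (ha39 : ∀ F : T4Family, 0 < (a39 F)) (hM39 : ∀ F : T4Family, 0 < (M39 F))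
    (h348 : ∀ F : T4Family, ∀ x : MemberY (stage3OfFamily F).d₆ (stage3OfFamily F).ℓ₆ (stage3OfFamily F).hd' (stage3OfFamily F).hL' (stage3OfFamily F).b₀ (stage3OfFamily F).b₁ (Mstar F), (M39 F) ≤ (geo9Y x).M → ∀ α₀ : ℝ, 0 < α₀ → (c F) * (geo9Y x).M * α₀ ≤ (a39 F) → ∀ U : (bg9YR (Matrix (Fin 2) (Fin 2) ℂ) (specialUnitaryUnits (Fin 2)) (R₁ F) (R₂ F) x).Cfg, (bg9YR (Matrix (Fin 2) (Fin 2) ℂ) (specialUnitaryUnits (Fin 2)) (R₁ F) (R₂ F) x).Reg335 (c F) α₀ U → Conv348Blk (oneCubeOps39 (geo9Y x) (bg9YR (Matrix (Fin 2) (Fin 2) ℂ) (specialUnitaryUnits (Fin 2)) (R₁ F) (R₂ F) x) (blk39F (Matrix (Fin 2) (Fin 2) ℂ) x.toKIdx ((bI F) x)) (L39 x.toKIdx (parKnitY x.toKIdx) ((lettersYOfRecordV11K 2 (stage3OfFamily F) (Mstar F) (𝔯 F)) x).Gp)) (B39 F) (δ39 F) U) (ιA AA : ∀ F : T4Family, MemberY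 (stage3OfFamily F).d₆ (stage3OfFamily F).ℓ₆ (stage3OfFamily F).hd' (stage3OfFamily F).hL' (stage3OfFamily F).b₀ (stage3OfFamily F).b₁ (Mstar F) → Type) (instN06_5 : ∀ F : T4Family, ∀ x, Fintype ((ιA F) x)) (instN06_6 : ∀ F : T4Family, ∀ x, Fintype ((AA F) x)) (p q : ∀ F : T4Family, PinPrims) (hp : ∀ F : T4Family, (p F).OK) (hq : ∀ F : T4Family, (q F).OK) (α₀K aK : ∀ F : T4Family, ℝ) (hαK : ∀ F : T4Family, 0 < (α₀K F)) (hαK3 : ∀ F : T4Family, C0 ((stage3OfFamily F).d₆ + 1) * (α₀K F) ≤ 1 / 3) (hαK2 : ∀ F : T4Family, 2 * (α₀K F) ≤ c2' ((stage3OfFamily F).d₆ + 1) ((stage3OfFamily F).ℓ₆ + 1)) (hKplK : ∀ F : T4Family, ∀ (i : B6KLevelCensusIndexV1.KIdx (stage3OfFamily F).d₆ (stage3OfFamily F).ℓ₆ (stage3OfFamily F).hd' (stage3OfFamily F).hL' (stage3OfFamily F).b₀ (stage3OfFamily F).b₁) (a : ℝ), 0 ≤ a → a ≤ (aK F) → Kpl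 i a * (kGeo i).L ^ 4 < (α₀K F)) (hpaK : ∀ F : T4Family, (p F).a₁ / (c F) ≤ (aK F)) (hqaK : ∀ F : T4Family, (q F).a₁ / (c F) ≤ (aK F)) (p3 q3 : ∀ F : T4Family, PairPrims) (hp3 : ∀ F : T4Family, (p3 F).OK) (hq3 : ∀ F : T4Family, (q3 F).OK) (pM qM : ∀ F : T4Family, MixedPrims) (hpM : ∀ F : T4Family, (pM F).OK) (hqM : ∀ F : T4Family, (qM F).OK) (H : ∀ F : T4Family, MemberY (stage3OfFamily F).d₆ (stage3OfFamily F).ℓ₆ (stage3OfFamily F).hd' (stage3OfFamily F).hL' (stage3OfFamily F).b₀ (stage3OfFamily F).b₁ (Mstar F) → Prop) (hM₀ : ∀ F : T4Family, nbrM₀Y (stage3OfFamily F).d₆ (stage3OfFamily F).ℓ₆ (stage3OfFamily F).hd' (stage3OfFamily F).hL' (stage3OfFamily F).b₀ (stage3OfFamily F).b₁ 2 ≤ (Mstar F)) (𝔭 : ∀ F : T4Family, ∀ x : MemberY (stage3OfFamily F).d₆ (stage3OfFamily F).ℓ₆ (stage3OfFamily F).hd' (stage3OfFamily F).hL' (stage3OfFamily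 F).b₀ (stage3OfFamily F).b₁ (Mstar F), HolderProbes (geo9Y x) (bg9YR (Matrix (Fin 2) (Fin 2) ℂ) (specialUnitaryUnits (Fin 2)) (R₁ F) (R₂ F) x) (XSK (TrIdx 2) x.toKIdx) (XSK (TrIdx 2) x.toKIdx) (PK (SiteY x.toKIdx) (Fin ((stage3OfFamily F).d₆ + 1)) (TrIdx 2)) (PK (SiteY x.toKIdx) (Fin ((stage3OfFamily F).d₆ + 1)) (TrIdx 2))) (h𝔭 : ∀ F : T4Family, ∀ x : MemberY (stage3OfFamily F).d₆ (stage3OfFamily F).ℓ₆ (stage3OfFamily F).hd' (stage3OfFamily F).hL' (stage3OfFamily F).b₀ (stage3OfFamily F).b₁ (Mstar F), (𝔭 F) x = holderProbesSN x.toKIdx (trBasis 2) (bg9YR (Matrix (Fin 2) (Fin 2) ℂ) (specialUnitaryUnits (Fin 2)) (R₁ F) (R₂ F) x) (fun U => U) (parSymY x.toKIdx) ((bI F) x)) (bHX : ∀ F : T4Family, ∀ x : MemberY (stage3OfFamily F).d₆ (stage3OfFamily F).ℓ₆ (stage3OfFamily F).hd' (stage3OfFamily F).hL' (stage3OfFamily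 F).b₀ (stage3OfFamily F).b₁ (Mstar F), ℝ → BlockNorm (toB6 (geo9Y x) 1 ((H F) x)) ((XSK (TrIdx 2) x.toKIdx) → ℝ))
    (hbHX : ∀ F : T4Family, ∀ x : MemberY (stage3OfFamily F).d₆ (stage3OfFamily F).ℓ₆ (stage3OfFamily F).hd' (stage3OfFamily F).hL' (stage3OfFamily F).b₀ (stage3OfFamily F).b₁ (Mstar F), (bHX F) x = fun ε => letI : Fintype (B9GeoNormsKLevelV1.geo9K x.toKIdx).Site := (inferInstance : Fintype (geo9Y x).Site); bHS x.toKIdx (sIK x.toKIdx ((bI F) x)) ε) (SH S3 SI : ∀ F : T4Family, ∀ x : MemberY (stage3OfFamily F).d₆ (stage3OfFamily F).ℓ₆ (stage3OfFamily F).hd' (stage3OfFamily F).hL' (stage3OfFamily F).b₀ (stage3OfFamily F).b₁ (Mstar F), ↥(cubes x.toKIdx.D.toDomains) → Finset (geo9Y x).Site) (Bc : ∀ F : T4Family, ℝ) (hBc : ∀ F : T4Family, 0 ≤ (Bc F)) (hM₀N : ∀ F : T4Family, nbrM₀BY (stage3OfFamily F).d₆ (stage3OfFamily F).ℓ₆ (stage3OfFamily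 F).hd' (stage3OfFamily F).hL' (stage3OfFamily F).b₀ (stage3OfFamily F).b₁ 1 ≤ (Mstar F)) (hB₀ge : ∀ F : T4Family, (nbrCountBY (stage3OfFamily F).d₆ (stage3OfFamily F).ℓ₆ (stage3OfFamily F).hd' (stage3OfFamily F).hL' (stage3OfFamily F).b₀ (stage3OfFamily F).b₁ 1 : ℝ) * Real.exp (2 * (p F).δ₀) * (cR39 (trBasis 2) * (Bc F)) ≤ (p F).B₀) (O : ∀ F : T4Family, ∀ x : MemberY (stage3OfFamily F).d₆ (stage3OfFamily F).ℓ₆ (stage3OfFamily F).hd' (stage3OfFamily F).hL' (stage3OfFamily F).b₀ (stage3OfFamily F).b₁ (Mstar F), ↥(cubes x.toKIdx.D.toDomains) → SiteOpY (Matrix (Fin 2) (Fin 2) ℂ) x.toKIdx) (near : ∀ F : T4Family, ∀ x : MemberY (stage3OfFamily F).d₆ (stage3OfFamily F).ℓ₆ (stage3OfFamily F).hd' (stage3OfFamily F).hL' (stage3OfFamily F).b₀ (stage3OfFamily F).b₁ (Mstar F), ↥(cubes x.toKIdx.D.toDomains) → Finset (SiteY x.toKIdx)) (hnear : ∀ F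 : T4Family, ∀ (x : MemberY (stage3OfFamily F).d₆ (stage3OfFamily F).ℓ₆ (stage3OfFamily F).hd' (stage3OfFamily F).hL' (stage3OfFamily F).b₀ (stage3OfFamily F).b₁ (Mstar F)) (c' : ↥(cubes x.toKIdx.D.toDomains)), nearDomY x c' ⊆ (near F) x c') (hOagr : ∀ F : T4Family, ∀ (x : MemberY (stage3OfFamily F).d₆ (stage3OfFamily F).ℓ₆ (stage3OfFamily F).hd' (stage3OfFamily F).hL' (stage3OfFamily F).b₀ (stage3OfFamily F).b₁ (Mstar F)) (c' : ↥(cubes x.toKIdx.D.toDomains)) (U U' : (bg9YR (Matrix (Fin 2) (Fin 2) ℂ) (specialUnitaryUnits (Fin 2)) (R₁ F) (R₂ F) x).Cfg), agreeWalkYO x (bg9YR (Matrix (Fin 2) (Fin 2) ℂ) (specialUnitaryUnits (Fin 2)) (R₁ F) (R₂ F) x) (fun U => U) (parKnitY x.toKIdx) ((near F) x) c' U U' → (O F) x c' U = (O F) x c' U') (hOsym : ∀ F : T4Family, ∀ (x : MemberY (stage3OfFamily F).d₆ (stage3OfFamily F).ℓ₆ (stage3OfFamily F).hd' (stage3OfFamily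 F).hL' (stage3OfFamily F).b₀ (stage3OfFamily F).b₁ (Mstar F)) (α₀ : ℝ) (U : (bg9YR (Matrix (Fin 2) (Fin 2) ℂ) (specialUnitaryUnits (Fin 2)) (R₁ F) (R₂ F) x).Cfg), (bg9YR (Matrix (Fin 2) (Fin 2) ℂ) (specialUnitaryUnits (Fin 2)) (R₁ F) (R₂ F) x).Reg335 (c F) α₀ U → ∀ c' : ↥(cubes x.toKIdx.D.toDomains), IsSymmTr (fun _ => (1 : ℝ)) ((O F) x c' U)) (hOloc : ∀ F : T4Family, ∀ x, (p F).M₁ ≤ (geo9Y x).M → ∀ α₀ : ℝ, 0 < α₀ → (c F) * (geo9Y x).M * α₀ ≤ (p F).a₁ → ∀ U : (bg9YR (Matrix (Fin 2) (Fin 2) ℂ) (specialUnitaryUnits (Fin 2)) (R₁ F) (R₂ F) x).Cfg, (bg9YR (Matrix (Fin 2) (Fin 2) ℂ) (specialUnitaryUnits (Fin 2)) (R₁ F) (R₂ F) x).Reg335 (c F) α₀ U → ∀ c' : ↥(cubes x.toKIdx.D.toDomains), cutMulY (hTY x.toKIdx c') * deltaPrimeAY x.toKIdx (parKnitY x.toKIdx)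 U * (O F) x c' U * cutMulY (hTY x.toKIdx c') = cutMulY (hTY x.toKIdx c') * cutMulY (hTY x.toKIdx c'))
    (hOlocT : ∀ F : T4Family, ∀ x, (p F).M₁ ≤ (geo9Y x).M → ∀ α₀ : ℝ, 0 < α₀ → (c F) * (geo9Y x).M * α₀ ≤ (p F).a₁ → ∀ U : (bg9YR (Matrix (Fin 2) (Fin 2) ℂ) (specialUnitaryUnits (Fin 2)) (R₁ F) (R₂ F) x).Cfg, (bg9YR (Matrix (Fin 2) (Fin 2) ℂ) (specialUnitaryUnits (Fin 2)) (R₁ F) (R₂ F) x).Reg335 (c F) α₀ U → ∀ c' : ↥(cubes x.toKIdx.D.toDomains), cutMulY (hTY x.toKIdx c') * (O F) x c' U * deltaPrimeAY x.toKIdx (parKnitY x.toKIdx) U * cutMulY (hTY x.toKIdx c') = cutMulY (hTY x.toKIdx c') * cutMulY (hTY x.toKIdx c')) (δM : ∀ F : T4Family, ℝ) (hδM : ∀ F : T4Family, 0 < (δM F)) (hM1L : ∀ F : T4Family, MLeg (stage3OfFamily F).d₆ (stage3OfFamily F).ℓ₆ (stage3OfFamily F).hd' (stage3OfFamily F).hL'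 (stage3OfFamily F).b₀ (stage3OfFamily F).b₁ (Mstar F) (hδM F) ≤ (p F).M₁) (hδ1L : ∀ F : T4Family, (p F).δ₀ ≤ (δM F) / 2) (hθ1L : ∀ F : T4Family, (p F).θ₀ * Real.exp ((3 / 4 + (p F).δ₀) * (p F).ρ) * (BLeg (stage3OfFamily F).d₆ (stage3OfFamily F).ℓ₆ (stage3OfFamily F).hd' (stage3OfFamily F).hL' (stage3OfFamily F).b₀ (stage3OfFamily F).b₁ (Mstar F) (hδM F) * (pM F).BM) ≤ (pM F).θM) (hMixO : ∀ F : T4Family, ∀ x, (p F).M₁ ≤ (geo9Y x).M → ∀ α₀ : ℝ, 0 < α₀ → (c F) * (geo9Y x).M * α₀ ≤ (p F).a₁ → ∀ U : (bg9YR (Matrix (Fin 2) (Fin 2) ℂ) (specialUnitaryUnits (Fin 2)) (R₁ F) (R₂ F) x).Cfg, (bg9YR (Matrix (Fin 2) (Fin 2) ℂ) (specialUnitaryUnits (Fin 2)) (R₁ F) (R₂ F) x).Reg335 (c F) α₀ U → ∀ (q' : ↥(cubes x.toKIdx.D.toDomains)) (ν μ : Fin ((stage3OfFamily F).d₆ +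 1)), B9SectDL2Decay.BlockBd (g := toB6 (geo9Y x) 1 ((H F) x)) (opsWalkYO x (trBasis 2) (bg9YR (Matrix (Fin 2) (Fin 2) ℂ) (specialUnitaryUnits (Fin 2)) (R₁ F) (R₂ F) x) (fun U => U) (parKnitY x.toKIdx) ((bI F) x) ((O F) x)).blk (opsWalkYO x (trBasis 2) (bg9YR (Matrix (Fin 2) (Fin 2) ℂ) (specialUnitaryUnits (Fin 2)) (R₁ F) (R₂ F) x) (fun U => U) (parKnitY x.toKIdx) ((bI F) x) ((O F) x)).blk ((dirOpsWalkYO x (trBasis 2) (bg9YR (Matrix (Fin 2) (Fin 2) ℂ) (specialUnitaryUnits (Fin 2)) (R₁ F) (R₂ F) x) (fun U => U) (parKnitY x.toKIdx) ((bI F) x) ((O F) x)).Dd U ν ∘ₗ (((opsWalkYO x (trBasis 2) (bg9YR (Matrix (Fin 2) (Fin 2) ℂ) (specialUnitaryUnits (Fin 2)) (R₁ F) (R₂ F) x) (fun U => U) (parKnitY x.toKIdx) ((bI F) x) ((O F) x)).Gsq U q' * B9Thm37Sum.mulOp ((opsWalkYO x (trBasis 2) (bg9YR (Matrix (Fin 2)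 (Fin 2) ℂ) (specialUnitaryUnits (Fin 2)) (R₁ F) (R₂ F) x) (fun U => U) (parKnitY x.toKIdx) ((bI F) x) ((O F) x)).h q')) ∘ₗ (dirOpsWalkYO x (trBasis 2) (bg9YR (Matrix (Fin 2) (Fin 2) ℂ) (specialUnitaryUnits (Fin 2)) (R₁ F) (R₂ F) x) (fun U => U) (parKnitY x.toKIdx) ((bI F) x) ((O F) x)).Dsd U μ)) (fun (y y' : (geo9Y x).Site) => (pM F).BM * Real.exp (-((δM F) * (geo9Y x).dist y y'))))
    (hOneO : ∀ F : T4Family, ∀ x, (p F).M₁ ≤ (geo9Y x).M → ∀ α₀ : ℝ, 0 < α₀ → (c F) * (geo9Y x).M * α₀ ≤ (p F).a₁ → ∀ U : (bg9YR (Matrix (Fin 2) (Fin 2) ℂ) (specialUnitaryUnits (Fin 2)) (R₁ F) (R₂ F) x).Cfg, (bg9YR (Matrix (Fin 2) (Fin 2) ℂ) (specialUnitaryUnits (Fin 2)) (R₁ F) (R₂ F) x).Reg335 (c F) α₀ U → ∀ (q' : ↥(cubes x.toKIdx.D.toDomains)) (μ : Fin ((stage3OfFamily F).d₆ + 1)),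 B9SectDL2Decay.BlockBd (g := toB6 (geo9Y x) 1 ((H F) x)) (opsWalkYO x (trBasis 2) (bg9YR (Matrix (Fin 2) (Fin 2) ℂ) (specialUnitaryUnits (Fin 2)) (R₁ F) (R₂ F) x) (fun U => U) (parKnitY x.toKIdx) ((bI F) x) ((O F) x)).blk (opsWalkYO x (trBasis 2) (bg9YR (Matrix (Fin 2) (Fin 2) ℂ) (specialUnitaryUnits (Fin 2)) (R₁ F) (R₂ F) x) (fun U => U) (parKnitY x.toKIdx) ((bI F) x) ((O F) x)).blk (((opsWalkYO x (trBasis 2) (bg9YR (Matrix (Fin 2) (Fin 2) ℂ) (specialUnitaryUnits (Fin 2)) (R₁ F) (R₂ F) x) (fun U => U) (parKnitY x.toKIdx) ((bI F) x) ((O F) x)).Gsq U q' * B9Thm37Sum.mulOp ((opsWalkYO x (trBasis 2) (bg9YR (Matrix (Fin 2) (Fin 2) ℂ) (specialUnitaryUnits (Fin 2)) (R₁ F) (R₂ F) x) (fun U => U) (parKnitY x.toKIdx) ((bI F) x) ((O F) x)).h q')) ∘ₗ (dirOpsWalkYO x (trBasis 2) (bg9YR (Matrix (Fin 2) (Fin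 2) ℂ) (specialUnitaryUnits (Fin 2)) (R₁ F) (R₂ F) x) (fun U => U) (parKnitY x.toKIdx) ((bI F) x) ((O F) x)).Dsd U μ) (fun (y y' : (geo9Y x).Site) => (pM F).BM * (geo9Y x).len y ^ (1 : ℝ) * Real.exp (-((δM F) * (geo9Y x).dist y y')))) (hmixO : ∀ F : T4Family, ∀ x, (p F).M₁ ≤ (geo9Y x).M → ∀ α₀ : ℝ, 0 < α₀ → (c F) * (geo9Y x).M * α₀ ≤ (p F).a₁ → ∀ U : (bg9YR (Matrix (Fin 2) (Fin 2) ℂ) (specialUnitaryUnits (Fin 2)) (R₁ F) (R₂ F) x).Cfg, (bg9YR (Matrix (Fin 2) (Fin 2) ℂ) (specialUnitaryUnits (Fin 2)) (R₁ F) (R₂ F) x).Reg335 (c F) α₀ U → L2MixedLegs37 (opsWalkYO x (trBasis 2) (bg9YR (Matrix (Fin 2) (Fin 2) ℂ) (specialUnitaryUnits (Fin 2)) (R₁ F) (R₂ F) x) (fun U => U) (parKnitY x.toKIdx) ((bI F) x) ((O F) x)) (dirOpsWalkYO x (trBasis 2) (bg9YR (Matrix (Fin 2) (Fin 2) ℂ)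 (specialUnitaryUnits (Fin 2)) (R₁ F) (R₂ F) x) (fun U => U) (parKnitY x.toKIdx) ((bI F) x) ((O F) x)) 1 ((H F) x) (SblkY x ((bI F) x)) (pM F).BM (p F).δ₀ U)
    (h36b : ∀ F : T4Family, ∀ x, (p F).M₁ ≤ (geo9Y x).M → ∀ α₀ : ℝ, 0 < α₀ → (c F) * (geo9Y x).M * α₀ ≤ (p F).a₁ → ∀ U : (bg9YR (Matrix (Fin 2) (Fin 2) ℂ) (specialUnitaryUnits (Fin 2)) (R₁ F) (R₂ F) x).Cfg, (bg9YR (Matrix (Fin 2) (Fin 2) ℂ) (specialUnitaryUnits (Fin 2)) (R₁ F) (R₂ F) x).Reg335 (c F) α₀ U → (∀ c', HasMajorant (g := toB6 (geoBY x) 1 ((H F) x)) (fun p' : SiteY x.toKIdx × TrIdx 2 => blkOf x.toKIdx.D.toDomains p'.1) (conj (trBasis 2) ((etaS x.toKIdx ^ 2) • ((O F) x c' U).restrictScalars ℝ)) (fun s s' => (Bc F) * (geoBY x).len s ^ 2 * Real.exp (-((p F).δ₀ * (geoBY x).dist s s')))) ∧ (∀ c' (μ : Fin ((stage3OfFamily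 F).d₆ + 1)), HasMajorant (g := toB6 (geoBY x) 1 ((H F) x)) (fun p' : SiteY x.toKIdx × TrIdx 2 => blkOf x.toKIdx.D.toDomains p'.1) (conj (trBasis 2) (diffLetter (shiftY x.toKIdx) (UboxY x.toKIdx U) (((etaS x.toKIdx : ℂ))⁻¹) (Sum.inl μ)) * conj (trBasis 2) ((etaS x.toKIdx ^ 2) • ((O F) x c' U).restrictScalars ℝ)) (fun s s' => (Bc F) * (geoBY x).len s * Real.exp (-((p F).δ₀ * (geoBY x).dist s s')))) ∧ (∀ c' (μ : Fin ((stage3OfFamily F).d₆ + 1)), HasMajorant (g := toB6 (geoBY x) 1 ((H F) x)) (fun p' : SiteY x.toKIdx × TrIdx 2 => blkOf x.toKIdx.D.toDomains p'.1) (conj (trBasis 2) ((etaS x.toKIdx ^ 2) • ((O F) x c' U).restrictScalars ℝ) * conj (trBasis 2) (diffLetter (shiftY x.toKIdx) (UboxY x.toKIdx U) (((etaS x.toKIdx : ℂ))⁻¹) (Sum.inr μ))) (fun s s' => (Bc F) * (geoBY x).len s * Real.exp (-((p F).δ₀ * (geoBY x).dist s s')))) ∧ (∀ c', HasMajorant (g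 := toB6 (geoBY x) 1 ((H F) x)) (fun p' : SiteY x.toKIdx × TrIdx 2 => blkOf x.toKIdx.D.toDomains p'.1) (conj (trBasis 2) (((etaS x.toKIdx ^ 2)⁻¹) • (lapSL x.toKIdx U).restrictScalars ℝ) * conj (trBasis 2) ((etaS x.toKIdx ^ 2) • ((O F) x c' U).restrictScalars ℝ)) (fun s s' => (Bc F) * 1 * Real.exp (-((p F).δ₀ * (geoBY x).dist s s')))))
    (h36H : ∀ F : T4Family, ∀ x, (p F).M₁ ≤ (geo9Y x).M → ∀ α₀ : ℝ, 0 < α₀ → (c F) * (geo9Y x).M * α₀ ≤ (p F).a₁ → ∀ U : (bg9YR (Matrix (Fin 2) (Fin 2) ℂ) (specialUnitaryUnits (Fin 2)) (R₁ F) (R₂ F) x).Cfg, (bg9YR (Matrix (Fin 2) (Fin 2) ℂ) (specialUnitaryUnits (Fin 2)) (R₁ F) (R₂ F) x).Reg335 (c F) α₀ U → HolderLegs37 (opsWalkYO x (trBasis 2) (bg9YR (Matrix (Fin 2) (Fin 2) ℂ) (specialUnitaryUnits (Fin 2)) (R₁ F) (R₂ F) x) (fun U => U) (parKnitY x.toKIdx)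 ((bI F) x) ((O F) x)) ((𝔭 F) x) 1 ((H F) x) ((SH F) x) (p F).Bl (p F).δ₀ U ∧ HolderV37Dir (opsWalkYO x (trBasis 2) (bg9YR (Matrix (Fin 2) (Fin 2) ℂ) (specialUnitaryUnits (Fin 2)) (R₁ F) (R₂ F) x) (fun U => U) (parKnitY x.toKIdx) ((bI F) x) ((O F) x)) (dirOpsWalkYO x (trBasis 2) (bg9YR (Matrix (Fin 2) (Fin 2) ℂ) (specialUnitaryUnits (Fin 2)) (R₁ F) (R₂ F) x) (fun U => U) (parKnitY x.toKIdx) ((bI F) x) ((O F) x)) (dirLettersWalkYO x (trBasis 2) (bg9YR (Matrix (Fin 2) (Fin 2) ℂ) (specialUnitaryUnits (Fin 2)) (R₁ F) (R₂ F) x) (fun U => U) (parKnitY x.toKIdx) ((bI F) x) ((O F) x)) ((𝔭 F) x) 1 ((H F) x) (p F).Bt (p F).δ₀ U ∧ (L2SecondLegs37 (opsWalkYO x (trBasis 2) (bg9YR (Matrix (Fin 2) (Fin 2) ℂ) (specialUnitaryUnits (Fin 2)) (R₁ F) (R₂ F) x) (fun U => U) (parKnitY x.toKIdx) ((bI F)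 x) ((O F) x)) (dirOpsWalkYO x (trBasis 2) (bg9YR (Matrix (Fin 2) (Fin 2) ℂ) (specialUnitaryUnits (Fin 2)) (R₁ F) (R₂ F) x) (fun U => U) (parKnitY x.toKIdx) ((bI F) x) ((O F) x)) 1 ((H F) x) ((S3 F) x) (p3 F).B3 (p F).δ₀ U ∧ (∀ q' μ, IsTransposePair ((dirLettersWalkYO x (trBasis 2) (bg9YR (Matrix (Fin 2) (Fin 2) ℂ) (specialUnitaryUnits (Fin 2)) (R₁ F) (R₂ F) x) (fun U => U) (parKnitY x.toKIdx) ((bI F) x) ((O F) x)).Pt U q' μ) ((dirLettersWalkYO x (trBasis 2) (bg9YR (Matrix (Fin 2) (Fin 2) ℂ) (specialUnitaryUnits (Fin 2)) (R₁ F) (R₂ F) x) (fun U => U) (parKnitY x.toKIdx) ((bI F) x) ((O F) x)).P U q' μ)) ∧ (∀ q', IsTransposePair ((opsWalkYO x (trBasis 2) (bg9YR (Matrix (Fin 2) (Fin 2) ℂ) (specialUnitaryUnits (Fin 2)) (R₁ F) (R₂ F) x) (fun U => U) (parKnitY x.toKIdx) ((bI F) x) ((O F) x)).Ct U q') ((opsWalkYO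 x (trBasis 2) (bg9YR (Matrix (Fin 2) (Fin 2) ℂ) (specialUnitaryUnits (Fin 2)) (R₁ F) (R₂ F) x) (fun U => U) (parKnitY x.toKIdx) ((bI F) x) ((O F) x)).Cop U q'))) ∧ (InputLegsPair37 (opsWalkYO x (trBasis 2) (bg9YR (Matrix (Fin 2) (Fin 2) ℂ) (specialUnitaryUnits (Fin 2)) (R₁ F) (R₂ F) x) (fun U => U) (parKnitY x.toKIdx) ((bI F) x) ((O F) x)) (dirOpsWalkYO x (trBasis 2) (bg9YR (Matrix (Fin 2) (Fin 2) ℂ) (specialUnitaryUnits (Fin 2)) (R₁ F) (R₂ F) x) (fun U => U) (parKnitY x.toKIdx) ((bI F) x) ((O F) x)) ((𝔭 F) x) 1 ((H F) x) ((bHX F) x) ((SI F) x) (p F).BI (p F).BI2 (p F).δ₀ U ∧ FactorsInputPair37Dir (opsWalkYO x (trBasis 2) (bg9YR (Matrix (Fin 2) (Fin 2) ℂ) (specialUnitaryUnits (Fin 2)) (R₁ F) (R₂ F) x) (fun U => U) (parKnitY x.toKIdx) ((bI F) x) ((O F) x)) (dirOpsWalkYO x (trBasis 2) (bg9YR (Matrix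 (Fin 2) (Fin 2) ℂ) (specialUnitaryUnits (Fin 2)) (R₁ F) (R₂ F) x) (fun U => U) (parKnitY x.toKIdx) ((bI F) x) ((O F) x)) (dirLettersWalkYO x (trBasis 2) (bg9YR (Matrix (Fin 2) (Fin 2) ℂ) (specialUnitaryUnits (Fin 2)) (R₁ F) (R₂ F) x) (fun U => U) (parKnitY x.toKIdx) ((bI F) x) ((O F) x)) 1 ((H F) x) ((bHX F) x) (p F).θI (p F).δ₀ U)) (hcntH : ∀ F : T4Family, ∀ x (a : (geo9Y x).Site), (∑ cᵢ, if a ∈ (SH F) x cᵢ then (1 : ℝ) else 0) ≤ (p F).NH)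
    (hcnt3 : ∀ F : T4Family, ∀ x (a : (geo9Y x).Site), (∑ cᵢ, if a ∈ (S3 F) x cᵢ then (1 : ℝ) else 0) ≤ (p3 F).N3) (hcntI : ∀ F : T4Family, ∀ x (a : (geo9Y x).Site), (∑ cᵢ, if a ∈ (SI F) x cᵢ then (1 : ℝ) else 0) ≤ (p F).NI) (hMw : ∀ F : T4Family, ∀ x : MemberY (stage3OfFamily F).d₆ (stage3OfFamily F).ℓ₆ (stage3OfFamily F).hd' (stage3OfFamily F).hL' (stage3OfFamily F).b₀ (stage3OfFamily F).b₁ (Mstar F), walkCntM₀Y (stage3OfFamily F).d₆ (stage3OfFamily F).ℓ₆ (stage3OfFamily F).hd' (stage3OfFamily F).hL' (stage3OfFamily F).b₀ (stage3OfFamily F).b₁ (Mstar F) ≤ (geo9Y x).M) (hNMw : ∀ F : T4Family, walkCntY (stage3OfFamily F).d₆ (stage3OfFamily F).ℓ₆ (stage3OfFamily F).hd' (stage3OfFamily F).hL' (stage3OfFamily F).b₀ (stage3OfFamily F).b₁ (Mstar F) ≤ (pM F).NM) (hM3 : ∀ F : T4Family, nbrM₀Y (stage3OfFamily F).d₆ (stage3OfFamily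 F).ℓ₆ (stage3OfFamily F).hd' (stage3OfFamily F).hL' (stage3OfFamily F).b₀ (stage3OfFamily F).b₁ 3 ≤ (Mstar F)) (hρ3 : ∀ F : T4Family, 3 ≤ (p F).ρ) (hNc : ∀ F : T4Family, walkCntY (stage3OfFamily F).d₆ (stage3OfFamily F).ℓ₆ (stage3OfFamily F).hd' (stage3OfFamily F).hL' (stage3OfFamily F).b₀ (stage3OfFamily F).b₁ (Mstar F) ≤ (p F).Nc) (hN' : ∀ F : T4Family, walkCntY (stage3OfFamily F).d₆ (stage3OfFamily F).ℓ₆ (stage3OfFamily F).hd' (stage3OfFamily F).hL' (stage3OfFamily F).b₀ (stage3OfFamily F).b₁ (Mstar F) ≤ (p F).N') (hCℓ : ∀ F : T4Family, ((((stage3OfFamily F).ℓ₆ + 1 : ℕ) : ℝ)) ^ 2 ≤ (p F).Cℓ) (hKc : ∀ F : T4Family, KcWalkY (stage3OfFamily F).d₆ (stage3OfFamily F).ℓ₆ (stage3OfFamily F).hd' (stage3OfFamily F).hL' (stage3OfFamily F).b₀ (stage3OfFamily F).b₁ (trBasis 2) ≤ (p F).Kc) (hθ₀ : ∀ F : T4Family,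 thetaWalkY (stage3OfFamily F).d₆ (stage3OfFamily F).ℓ₆ (stage3OfFamily F).hd' (stage3OfFamily F).hL' (stage3OfFamily F).b₀ (stage3OfFamily F).b₁ (trBasis 2) (p F).Cℓ ≤ (p F).θ₀) (𝔬A : ∀ F : T4Family, ∀ x : MemberY (stage3OfFamily F).d₆ (stage3OfFamily F).ℓ₆ (stage3OfFamily F).hd' (stage3OfFamily F).hL' (stage3OfFamily F).b₀ (stage3OfFamily F).b₁ (Mstar F), Ops310 (geo9Y x) (bg9YR (Matrix (Fin 2) (Fin 2) ℂ) (specialUnitaryUnits (Fin 2)) (R₁ F) (R₂ F) x) (XBK (TrIdx 2) x.toKIdx) (XBK (TrIdx 2) x.toKIdx) ((ιA F) x) ((AA F) x)) (rdA : ∀ F : T4Family, ∀ x : MemberY (stage3OfFamily F).d₆ (stage3OfFamily F).ℓ₆ (stage3OfFamily F).hd' (stage3OfFamily F).hL' (stage3OfFamily F).b₀ (stage3OfFamily F).b₁ (Mstar F), WalkReading310 (geo9Y x) (bg9YR (Matrix (Fin 2) (Fin 2) ℂ) (specialUnitaryUnits (Fin 2)) (R₁ F) (R₂ F) x) (XBK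 (TrIdx 2) x.toKIdx) ((ιA F) x) ((AA F) x)) (𝔭A : ∀ F : T4Family, ∀ x : MemberY (stage3OfFamily F).d₆ (stage3OfFamily F).ℓ₆ (stage3OfFamily F).hd' (stage3OfFamily F).hL' (stage3OfFamily F).b₀ (stage3OfFamily F).b₁ (Mstar F), HolderProbes (geo9Y x) (bg9YR (Matrix (Fin 2) (Fin 2) ℂ) (specialUnitaryUnits (Fin 2)) (R₁ F) (R₂ F) x) (XBK (TrIdx 2) x.toKIdx) (XBK (TrIdx 2) x.toKIdx) (PK (FBondY x.toKIdx) (Fin ((stage3OfFamily F).d₆ + 1)) (TrIdx 2)) (PK (FBondY x.toKIdx) (Fin ((stage3OfFamily F).d₆ + 1)) (TrIdx 2))) (h𝔭A : ∀ F : T4Family, ∀ x : MemberY (stage3OfFamily F).d₆ (stage3OfFamily F).ℓ₆ (stage3OfFamily F).hd' (stage3OfFamily F).hL' (stage3OfFamily F).b₀ (stage3OfFamily F).b₁ (Mstar F), (𝔭A F) x = holderProbesKA x.toKIdx (trBasis 2) (bg9YR (Matrix (Fin 2) (Fin 2) ℂ) (specialUnitaryUnits (Fin 2)) (R₁ F)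 (R₂ F) x) (fun U => U) ((lettersYOfRecordV11K 2 (stage3OfFamily F) (Mstar F) (𝔯 F)) x).parB ((bI F) x))
    (𝔡A : ∀ F : T4Family, ∀ x : MemberY (stage3OfFamily F).d₆ (stage3OfFamily F).ℓ₆ (stage3OfFamily F).hd' (stage3OfFamily F).hL' (stage3OfFamily F).b₀ (stage3OfFamily F).b₁ (Mstar F), DirOps310 ((𝔬A F) x) (Fin ((stage3OfFamily F).d₆ + 1))) (𝔩A : ∀ F : T4Family, ∀ x : MemberY (stage3OfFamily F).d₆ (stage3OfFamily F).ℓ₆ (stage3OfFamily F).hd' (stage3OfFamily F).hL' (stage3OfFamily F).b₀ (stage3OfFamily F).b₁ (Mstar F), DirLetters310 ((𝔬A F) x) (Fin ((stage3OfFamily F).d₆ + 1))) (bHXA : ∀ F : T4Family, ∀ x : MemberY (stage3OfFamily F).d₆ (stage3OfFamily F).ℓ₆ (stage3OfFamily F).hd' (stage3OfFamily F).hL' (stage3OfFamily F).b₀ (stage3OfFamily F).b₁ (Mstar F), ℝ → BlockNorm (toB6 (geo9Y x) 1 ((H F) x)) ((XBK (TrIdx 2) x.toKIdx) → ℝ))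 (κA : ∀ F : T4Family, MemberY (stage3OfFamily F).d₆ (stage3OfFamily F).ℓ₆ (stage3OfFamily F).hd' (stage3OfFamily F).hL' (stage3OfFamily F).b₀ (stage3OfFamily F).b₁ (Mstar F) → Sizes310) (SHA S3A SIA SMA : ∀ F : T4Family, ∀ x : MemberY (stage3OfFamily F).d₆ (stage3OfFamily F).ℓ₆ (stage3OfFamily F).hd' (stage3OfFamily F).hL' (stage3OfFamily F).b₀ (stage3OfFamily F).b₁ (Mstar F), (ιA F) x → Finset (geo9Y x).Site) (hbHXA : ∀ F : T4Family, ∀ x : MemberY (stage3OfFamily F).d₆ (stage3OfFamily F).ℓ₆ (stage3OfFamily F).hd' (stage3OfFamily F).hL' (stage3OfFamily F).b₀ (stage3OfFamily F).b₁ (Mstar F), (bHXA F) x = fun ε => letI : Fintype (B9GeoNormsKLevelV1.geo9K x.toKIdx).Site := (inferInstance : Fintype (geo9Y x).Site); bHK x.toKIdx ((bI F) x) ε) (hstA : ∀ F : T4Family, ∀ x, StaticOK310 ((𝔬A F) x) (q F).ρ (q F).Nc (q F).N' (q F).NF (q F).Cℓ ((κA F) x)) (hκA : ∀ F : T4Family,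 ∀ x, ((κA F) x).Bounded (q F).Kc) (hrdA : ∀ F : T4Family, ∀ x, ((rdA F) x).OKRel ((𝔬A F) x).blk (RelB x.toKIdx)) (hlocA : ∀ F : T4Family, ∀ x, Locality310 ((𝔬A F) x) ((rdA F) x)) (h36A' : ∀ F : T4Family, ∀ x, (q F).M₁ ≤ (geo9Y x).M → ∀ α₀ : ℝ, 0 < α₀ → (c F) * (geo9Y x).M * α₀ ≤ (q F).a₁ → ∀ U : (bg9YR (Matrix (Fin 2) (Fin 2) ℂ) (specialUnitaryUnits (Fin 2)) (R₁ F) (R₂ F) x).Cfg, (bg9YR (Matrix (Fin 2) (Fin 2) ℂ) (specialUnitaryUnits (Fin 2)) (R₁ F) (R₂ F) x).Reg335 (c F) α₀ U → B9Thm310Whole.Factors389 ((𝔬A F) x) 1 ((H F) x) (q F).θ₀ (q F).δ₀ U ∧ Identities310₂ ((𝔬A F) x) ((𝔡A F) x) ((𝔩A F) x) 1 ((H F) x) U) (h36HA : ∀ F : T4Family, ∀ x, (q F).M₁ ≤ (geo9Y x).M → ∀ α₀ : ℝ, 0 < α₀ → (c F) * (geo9Y x).M * α₀ ≤ (q F).a₁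 → ∀ U : (bg9YR (Matrix (Fin 2) (Fin 2) ℂ) (specialUnitaryUnits (Fin 2)) (R₁ F) (R₂ F) x).Cfg, (bg9YR (Matrix (Fin 2) (Fin 2) ℂ) (specialUnitaryUnits (Fin 2)) (R₁ F) (R₂ F) x).Reg335 (c F) α₀ U → HolderLegs310 ((𝔬A F) x) ((𝔭A F) x) 1 ((H F) x) ((SHA F) x) (q F).Bl (q F).δ₀ U ∧ FactorsHolder310 ((𝔬A F) x) ((𝔭A F) x) 1 ((H F) x) (q F).Bt (q F).δ₀ U ∧ (L2SecondLegs310 ((𝔬A F) x) ((𝔡A F) x) 1 ((H F) x) ((S3A F) x) (q3 F).B3 (q F).δ₀ U ∧ ∀ a, IsTransposePair (((𝔬A F) x).Rt U a) (((𝔬A F) x).Rf U a)) ∧ (InputLegsPair310 ((𝔬A F) x) ((𝔡A F) x) ((𝔭A F) x) 1 ((H F) x) ((bHXA F) x) ((SIA F) x) (q F).BI (q F).BI2 (q F).δ₀ U ∧ FactorsInputPair310 ((𝔬A F) x) ((𝔡A F) x) 1 ((H F) x) ((bHXA F) x) (q F).θI (q F).δ₀ U) ∧ (L2MixedLegs310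 ((𝔬A F) x) ((𝔡A F) x) 1 ((H F) x) ((SMA F) x) (qM F).BM (q F).δ₀ U ∧ FactorsL2Mixed310 ((𝔬A F) x) ((𝔡A F) x) 1 ((H F) x) (qM F).θM (q F).δ₀ U)) (hcntHA : ∀ F : T4Family, ∀ x (a : (geo9Y x).Site), (∑ cᵢ, if a ∈ (SHA F) x cᵢ then (1 : ℝ) else 0) ≤ (q F).NH)
    (hcnt3A : ∀ F : T4Family, ∀ x (a : (geo9Y x).Site), (∑ cᵢ, if a ∈ (S3A F) x cᵢ then (1 : ℝ) else 0) ≤ (q3 F).N3) (hcntIA : ∀ F : T4Family, ∀ x (a : (geo9Y x).Site), (∑ cᵢ, if a ∈ (SIA F) x cᵢ then (1 : ℝ) else 0) ≤ (q F).NI) (hcntMA : ∀ F : T4Family, ∀ x (a : (geo9Y x).Site), (∑ cᵢ, if a ∈ (SMA F) x cᵢ then (1 : ℝ) else 0) ≤ (qM F).NM) (hblkA : ∀ F : T4Family, ∀ x : MemberY (stage3OfFamily F).d₆ (stage3OfFamily F).ℓ₆ (stage3OfFamily F).hd' (stage3OfFamily F).hL' (stage3OfFamily F).b₀ (stage3OfFamily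 F).b₁ (Mstar F), ((𝔬A F) x).blk = blkBK x.toKIdx ((bI F) x)) (hblkYA : ∀ F : T4Family, ∀ x : MemberY (stage3OfFamily F).d₆ (stage3OfFamily F).ℓ₆ (stage3OfFamily F).hd' (stage3OfFamily F).hL' (stage3OfFamily F).b₀ (stage3OfFamily F).b₁ (Mstar F), ((𝔬A F) x).blkY = blkBK x.toKIdx ((bI F) x)) (hGcoA : ∀ F : T4Family, ∀ (x : MemberY (stage3OfFamily F).d₆ (stage3OfFamily F).ℓ₆ (stage3OfFamily F).hd' (stage3OfFamily F).hL' (stage3OfFamily F).b₀ (stage3OfFamily F).b₁ (Mstar F)) (U : (bg9YR (Matrix (Fin 2) (Fin 2) ℂ) (specialUnitaryUnits (Fin 2)) (R₁ F) (R₂ F) x).Cfg), ((𝔬A F) x).G U = GcoK x.toKIdx (trBasis 2) (bg9YR (Matrix (Fin 2) (Fin 2) ℂ) (specialUnitaryUnits (Fin 2)) (R₁ F) (R₂ F) x) (fun U => U) ((lettersYOfRecordV11K 2 (stage3OfFamily F) (Mstar F) (𝔯 F)) x).GA U) (hDcoA : ∀ F : T4Family, ∀ (x : MemberY (stage3OfFamily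 F).d₆ (stage3OfFamily F).ℓ₆ (stage3OfFamily F).hd' (stage3OfFamily F).hL' (stage3OfFamily F).b₀ (stage3OfFamily F).b₁ (Mstar F)) (U : (bg9YR (Matrix (Fin 2) (Fin 2) ℂ) (specialUnitaryUnits (Fin 2)) (R₁ F) (R₂ F) x).Cfg), ((𝔬A F) x).D U = DcoK x.toKIdx (trBasis 2) (bg9YR (Matrix (Fin 2) (Fin 2) ℂ) (specialUnitaryUnits (Fin 2)) (R₁ F) (R₂ F) x) (fun U => U) U) (hDscoA : ∀ F : T4Family, ∀ (x : MemberY (stage3OfFamily F).d₆ (stage3OfFamily F).ℓ₆ (stage3OfFamily F).hd' (stage3OfFamily F).hL' (stage3OfFamily F).b₀ (stage3OfFamily F).b₁ (Mstar F)) (U : (bg9YR (Matrix (Fin 2) (Fin 2) ℂ) (specialUnitaryUnits (Fin 2)) (R₁ F) (R₂ F) x).Cfg), ((𝔬A F) x).Dstar U = DscoK x.toKIdx (trBasis 2) (bg9YR (Matrix (Fin 2) (Fin 2) ℂ) (specialUnitaryUnits (Fin 2)) (R₁ F) (R₂ F) x) (fun U => U) U) (hLcoA : ∀ F : T4Family,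 ∀ (x : MemberY (stage3OfFamily F).d₆ (stage3OfFamily F).ℓ₆ (stage3OfFamily F).hd' (stage3OfFamily F).hL' (stage3OfFamily F).b₀ (stage3OfFamily F).b₁ (Mstar F)) (U : (bg9YR (Matrix (Fin 2) (Fin 2) ℂ) (specialUnitaryUnits (Fin 2)) (R₁ F) (R₂ F) x).Cfg), ((𝔬A F) x).Lap U = LcoK x.toKIdx (trBasis 2) (bg9YR (Matrix (Fin 2) (Fin 2) ℂ) (specialUnitaryUnits (Fin 2)) (R₁ F) (R₂ F) x) (fun U => U) U) (h𝔡Ad : ∀ F : T4Family, ∀ (x : MemberY (stage3OfFamily F).d₆ (stage3OfFamily F).ℓ₆ (stage3OfFamily F).hd' (stage3OfFamily F).hL' (stage3OfFamily F).b₀ (stage3OfFamily F).b₁ (Mstar F)) (U : (bg9YR (Matrix (Fin 2) (Fin 2) ℂ) (specialUnitaryUnits (Fin 2)) (R₁ F) (R₂ F) x).Cfg), ((𝔡A F) x).Dd U = fun μ => coordOpK (trBasis 2) (fun _ : Fin ((stage3OfFamily F).d₆ + 1) => cdBₗ x.toKIdx U μ)) (h𝔡As : ∀ F : T4Family, ∀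 (x : MemberY (stage3OfFamily F).d₆ (stage3OfFamily F).ℓ₆ (stage3OfFamily F).hd' (stage3OfFamily F).hL' (stage3OfFamily F).b₀ (stage3OfFamily F).b₁ (Mstar F)) (U : (bg9YR (Matrix (Fin 2) (Fin 2) ℂ) (specialUnitaryUnits (Fin 2)) (R₁ F) (R₂ F) x).Cfg), ((𝔡A F) x).Dsd U = fun μ => coordOpK (trBasis 2) (fun _ : Fin ((stage3OfFamily F).d₆ + 1) => cdsBₗ x.toKIdx U μ))
    (OcA : ∀ F : T4Family, ∀ x : MemberY (stage3OfFamily F).d₆ (stage3OfFamily F).ℓ₆ (stage3OfFamily F).hd' (stage3OfFamily F).hL' (stage3OfFamily F).b₀ (stage3OfFamily F).b₁ (Mstar F), (ιA F) x → BondOpY (Matrix (Fin 2) (Fin 2) ℂ) x.toKIdx) (hGsqOA : ∀ F : T4Family, ∀ (x : MemberY (stage3OfFamily F).d₆ (stage3OfFamily F).ℓ₆ (stage3OfFamily F).hd' (stage3OfFamily F).hL' (stage3OfFamily F).b₀ (stage3OfFamily F).b₁ (Mstar F)) (U : (bg9YR (Matrix (Fin 2) (Fin 2) ℂ) (specialUnitaryUnits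 (Fin 2)) (R₁ F) (R₂ F) x).Cfg) (j : (ιA F) x), ((𝔬A F) x).Gsq U j = GcoK x.toKIdx (trBasis 2) (bg9YR (Matrix (Fin 2) (Fin 2) ℂ) (specialUnitaryUnits (Fin 2)) (R₁ F) (R₂ F) x) (fun U => U) ((OcA F) x j) U) (BcA : ∀ F : T4Family, ℝ) (hBcA : ∀ F : T4Family, 0 ≤ (BcA F)) (hB₀geA : ∀ F : T4Family, (nbrCountBY (stage3OfFamily F).d₆ (stage3OfFamily F).ℓ₆ (stage3OfFamily F).hd' (stage3OfFamily F).hL' (stage3OfFamily F).b₀ (stage3OfFamily F).b₁ 1 : ℝ) * Real.exp (2 * (q F).δ₀) * (cR39 (trBasis 2) * (BcA F)) ≤ (q F).B₀) (h36Ab : ∀ F : T4Family, ∀ x, (q F).M₁ ≤ (geo9Y x).M → ∀ α₀ : ℝ, 0 < α₀ → (c F) * (geo9Y x).M * α₀ ≤ (q F).a₁ → ∀ U : (bg9YR (Matrix (Fin 2) (Fin 2) ℂ) (specialUnitaryUnits (Fin 2)) (R₁ F) (R₂ F) x).Cfg, (bg9YR (Matrix (Fin 2) (Fin 2) ℂ)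 (specialUnitaryUnits (Fin 2)) (R₁ F) (R₂ F) x).Reg335 (c F) α₀ U → (∀ j, HasMajorant (g := toB6 (geoBY x) 1 ((H F) x)) (fun p' : FBondY x.toKIdx × TrIdx 2 => blkV1 x.toKIdx.hN x.toKIdx.D p'.1) (conj (trBasis 2) (((OcA F) x j U).restrictScalars ℝ)) (fun s s' => (BcA F) * (geoBY x).len s ^ 2 * Real.exp (-((q F).δ₀ * (geoBY x).dist s s')))) ∧ (∀ j (ν : Fin ((stage3OfFamily F).d₆ + 1)), HasMajorant (g := toB6 (geoBY x) 1 ((H F) x)) (fun p' : FBondY x.toKIdx × TrIdx 2 => blkV1 x.toKIdx.hN x.toKIdx.D p'.1) (conj (trBasis 2) (B9CoReadingCoords.cdBₗ x.toKIdx U ν) * conj (trBasis 2) (((OcA F) x j U).restrictScalars ℝ)) (fun s s' => (BcA F) * (geoBY x).len s * Real.exp (-((q F).δ₀ * (geoBY x).dist s s')))) ∧ (∀ j (ν : Fin ((stage3OfFamily F).d₆ + 1)), HasMajorant (g := toB6 (geoBY x) 1 ((H F) x)) (fun p' : FBondY x.toKIdx × TrIdx 2 => blkV1 x.toKIdx.hN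 x.toKIdx.D p'.1) (conj (trBasis 2) (((OcA F) x j U).restrictScalars ℝ) * conj (trBasis 2) (B9CoReadingCoords.cdsBₗ x.toKIdx U ν)) (fun s s' => (BcA F) * (geoBY x).len s * Real.exp (-((q F).δ₀ * (geoBY x).dist s s')))) ∧ (∀ j, HasMajorant (g := toB6 (geoBY x) 1 ((H F) x)) (fun p' : FBondY x.toKIdx × TrIdx 2 => blkV1 x.toKIdx.hN x.toKIdx.D p'.1) (conj (trBasis 2) (B9CoReadingCoords.lapBₗ x.toKIdx U) * conj (trBasis 2) (((OcA F) x j U).restrictScalars ℝ)) (fun s s' => (BcA F) * 1 * Real.exp (-((q F).δ₀ * (geoBY x).dist s s'))))) (𝔬12 : ∀ F : T4Family, ∀ x : MemberY (stage3OfFamily F).d₆ (stage3OfFamily F).ℓ₆ (stage3OfFamily F).hd' (stage3OfFamily F).hL' (stage3OfFamily F).b₀ (stage3OfFamily F).b₁ (Mstar F), B9Thm312Whole.Ops (geo9Y x) (bg9YR (Matrix (Fin 2) (Fin 2) ℂ) (specialUnitaryUnits (Fin 2)) (R₁ F) (R₂ F) x) (XBK (TrIdx 2) x.toKIdx) (XBK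 (TrIdx 2) x.toKIdx) (XHK (TrIdx 2) x.toKIdx) (XSK (TrIdx 2) x.toKIdx))
    (h𝔈 : ∀ F : T4Family, (𝔈 F) = expsYOfRecordV3Par 2 (stage3OfFamily F) (Mstar F) (lettersYOfRecordV11K 2 (stage3OfFamily F) (Mstar F) (𝔯 F)) (𝔈₀ F) (R₁ F) (R₂ F) (bI F) (fun x : MemberY (stage3OfFamily F).d₆ (stage3OfFamily F).ℓ₆ (stage3OfFamily F).hd' (stage3OfFamily F).hL' (stage3OfFamily F).b₀ (stage3OfFamily F).b₁ (Mstar F) => parKnitY x.toKIdx) (fun x : MemberY (stage3OfFamily F).d₆ (stage3OfFamily F).ℓ₆ (stage3OfFamily F).hd' (stage3OfFamily F).hL' (stage3OfFamily F).b₀ (stage3OfFamily F).b₁ (Mstar F) => parSymY x.toKIdx) (fun x : MemberY (stage3OfFamily F).d₆ (stage3OfFamily F).ℓ₆ (stage3OfFamily F).hd' (stage3OfFamily F).hL' (stage3OfFamily F).b₀ (stage3OfFamily F).b₁ (Mstar F) => qKnitOfRecord 2 (stage3OfFamily F) x.toKIdx) (fun x : MemberY (stage3OfFamily F).d₆ (stage3OfFamily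 F).ℓ₆ (stage3OfFamily F).hd' (stage3OfFamily F).hL' (stage3OfFamily F).b₀ (stage3OfFamily F).b₁ (Mstar F) => qsKnitOfRecord 2 (stage3OfFamily F) x.toKIdx) (α' F) (r39 F) (B39 F) (p F) (q F) (p3 F) (q3 F) (pM F) (qM F) (H F) (O F) (near F) (𝔬A F) (rdA F) (𝔬12 F)) (E14₁ E14₂ : ∀ F : T4Family, ∀ x : MemberY (stage3OfFamily F).d₆ (stage3OfFamily F).ℓ₆ (stage3OfFamily F).hd' (stage3OfFamily F).hL' (stage3OfFamily F).b₀ (stage3OfFamily F).b₁ (Mstar F), B9.RWExpansion (geo9Y x) (bg9YR (Matrix (Fin 2) (Fin 2) ℂ) (specialUnitaryUnits (Fin 2)) (R₁ F) (R₂ F) x)) (T14₁ : ∀ F : T4Family, ∀ x : MemberY (stage3OfFamily F).d₆ (stage3OfFamily F).ℓ₆ (stage3OfFamily F).hd' (stage3OfFamily F).hL' (stage3OfFamily F).b₀ (stage3OfFamily F).b₁ (Mstar F), ((E14₁ F) x).Walk → BondOpY (Matrix (Fin 2) (Fin 2) ℂ) x.toKIdx) (T14₂ : ∀ F : T4Family,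 ∀ x : MemberY (stage3OfFamily F).d₆ (stage3OfFamily F).ℓ₆ (stage3OfFamily F).hd' (stage3OfFamily F).hL' (stage3OfFamily F).b₀ (stage3OfFamily F).b₁ (Mstar F), ((E14₂ F) x).Walk → BondOpY (Matrix (Fin 2) (Fin 2) ℂ) x.toKIdx) (X14₁ : ∀ F : T4Family, ∀ x : MemberY (stage3OfFamily F).d₆ (stage3OfFamily F).ℓ₆ (stage3OfFamily F).hd' (stage3OfFamily F).hL' (stage3OfFamily F).b₀ (stage3OfFamily F).b₁ (Mstar F), ((E14₁ F) x).Walk → ℕ → (geo9Y x).Site → Prop) (M14₁ : ∀ F : T4Family, ∀ x : MemberY (stage3OfFamily F).d₆ (stage3OfFamily F).ℓ₆ (stage3OfFamily F).hd' (stage3OfFamily F).hL' (stage3OfFamily F).b₀ (stage3OfFamily F).b₁ (Mstar F), ((E14₁ F) x).Walk → ℕ → Prop) (X14₂ : ∀ F : T4Family, ∀ x : MemberY (stage3OfFamily F).d₆ (stage3OfFamily F).ℓ₆ (stage3OfFamily F).hd' (stage3OfFamily F).hL' (stage3OfFamily F).b₀ (stage3OfFamily F).b₁ (Mstar F), ((E14₂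 F) x).Walk → ℕ → (geo9Y x).Site → Prop) (M14₂ : ∀ F : T4Family, ∀ x : MemberY (stage3OfFamily F).d₆ (stage3OfFamily F).ℓ₆ (stage3OfFamily F).hd' (stage3OfFamily F).hL' (stage3OfFamily F).b₀ (stage3OfFamily F).b₁ (Mstar F), ((E14₂ F) x).Walk → ℕ → Prop) (diam14 : ∀ F : T4Family, MemberY (stage3OfFamily F).d₆ (stage3OfFamily F).ℓ₆ (stage3OfFamily F).hd' (stage3OfFamily F).hL' (stage3OfFamily F).b₀ (stage3OfFamily F).b₁ (Mstar F) → ℝ) (r14 : ∀ F : T4Family, ℝ) (hr14 : ∀ F : T4Family, ∀ x, (diam14 F) x ≤ (r14 F)) (near14₁ : ∀ F : T4Family, ∀ (x : MemberY (stage3OfFamily F).d₆ (stage3OfFamily F).ℓ₆ (stage3OfFamily F).hd' (stage3OfFamily F).hL' (stage3OfFamily F).b₀ (stage3OfFamily F).b₁ (Mstar F)) ω m pᵢ, (M14₁ F) x ω m → (X14₁ F) x ω m pᵢ → ∃ qᵢ, qᵢ ∈ OmegaC x.D x.D' ∧ tdistK (ℓ := (stage3OfFamily F).ℓ₆) (Mh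 := x.Mh) (k := x.k) (P := x.P') (kLab x pᵢ) qᵢ ≤ (diam14 F) x)
    (first14₁ : ∀ F : T4Family, ∀ (x : MemberY (stage3OfFamily F).d₆ (stage3OfFamily F).ℓ₆ (stage3OfFamily F).hd' (stage3OfFamily F).hL' (stage3OfFamily F).b₀ (stage3OfFamily F).b₁ (Mstar F)) ω y, ((E14₁ F) x).first ω y → (X14₁ F) x ω 0 y) (chain14₁ : ∀ F : T4Family, ∀ (x : MemberY (stage3OfFamily F).d₆ (stage3OfFamily F).ℓ₆ (stage3OfFamily F).hd' (stage3OfFamily F).hL' (stage3OfFamily F).b₀ (stage3OfFamily F).b₁ (Mstar F)) ω y y', ((E14₁ F) x).first ω y → ((E14₁ F) x).last ω y' → ∃ l : List (geo9Y x).Site, l.length = ((E14₁ F) x).wlen ω ∧ (∀ (m : ℕ) (hm : m < l.length), (X14₁ F) x ω (m + 1) (l[m])) ∧ B9Thm314.chainSum (geo9Y x).dist y l y' ≤ ((E14₁ F) x).wdist ω y y') (near14₂ : ∀ F : T4Family, ∀ (x : MemberY (stage3OfFamily F).d₆ (stage3OfFamily F).ℓ₆ (stage3OfFamily F).hd' (stage3OfFamily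 F).hL' (stage3OfFamily F).b₀ (stage3OfFamily F).b₁ (Mstar F)) ω m pᵢ, (M14₂ F) x ω m → (X14₂ F) x ω m pᵢ → ∃ qᵢ, qᵢ ∈ OmegaC x.D x.D' ∧ tdistK (ℓ := (stage3OfFamily F).ℓ₆) (Mh := x.Mh) (k := x.k) (P := x.P') (kLab x pᵢ) qᵢ ≤ (diam14 F) x) (first14₂ : ∀ F : T4Family, ∀ (x : MemberY (stage3OfFamily F).d₆ (stage3OfFamily F).ℓ₆ (stage3OfFamily F).hd' (stage3OfFamily F).hL' (stage3OfFamily F).b₀ (stage3OfFamily F).b₁ (Mstar F)) ω y, ((E14₂ F) x).first ω y → (X14₂ F) x ω 0 y) (chain14₂ : ∀ F : T4Family, ∀ (x : MemberY (stage3OfFamily F).d₆ (stage3OfFamily F).ℓ₆ (stage3OfFamily F).hd' (stage3OfFamily F).hL' (stage3OfFamily F).b₀ (stage3OfFamily F).b₁ (Mstar F)) ω y y', ((E14₂ F) x).first ω y → ((E14₂ F) x).last ω y' → ∃ l : List (geo9Y x).Site, l.length = ((E14₂ F) x).wlen ω ∧ (∀ (m : ℕ) (hm : m < l.length), (X14₂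 F) x ω (m + 1) (l[m])) ∧ B9Thm314.chainSum (geo9Y x).dist y l y' ≤ ((E14₂ F) x).wdist ω y y') (h14₁ : ∀ F : T4Family, Thm310AllNormsPrinted (c F) geo9Y (bg9YR (Matrix (Fin 2) (Fin 2) ℂ) (specialUnitaryUnits (Fin 2)) (R₁ F) (R₂ F)) (E14₁ F) (fun x ω => kernelFamilyB x.toKIdx (bg9YR (Matrix (Fin 2) (Fin 2) ℂ) (specialUnitaryUnits (Fin 2)) (R₁ F) (R₂ F) x) (fun U => U) ((T14₁ F) x ω) ((lettersYOfRecordV11K 2 (stage3OfFamily F) (Mstar F) (𝔯 F)) x).parB)) (h14₂ : ∀ F : T4Family, Thm310AllNormsPrinted (c F) geo9Y (bg9YR (Matrix (Fin 2) (Fin 2) ℂ) (specialUnitaryUnits (Fin 2)) (R₁ F) (R₂ F)) (E14₂ F) (fun x ω => kernelFamilyB x.toKIdx (bg9YR (Matrix (Fin 2) (Fin 2) ℂ) (specialUnitaryUnits (Fin 2)) (R₁ F) (R₂ F) x) (fun U => U) ((T14₂ F) x ω) ((lettersYOfRecordV11K 2 (stage3OfFamily F) (Mstar F) (𝔯 F))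 x).parB)) (W14₁ : ∀ F : T4Family, ∀ x : MemberY (stage3OfFamily F).d₆ (stage3OfFamily F).ℓ₆ (stage3OfFamily F).hd' (stage3OfFamily F).hL' (stage3OfFamily F).b₀ (stage3OfFamily F).b₁ (Mstar F), ℕ → (geo9Y x).Site → (geo9Y x).Site → Finset ((E14₁ F) x).Walk) (W14₂ : ∀ F : T4Family, ∀ x : MemberY (stage3OfFamily F).d₆ (stage3OfFamily F).ℓ₆ (stage3OfFamily F).hd' (stage3OfFamily F).hL' (stage3OfFamily F).b₀ (stage3OfFamily F).b₁ (Mstar F), ℕ → (geo9Y x).Site → (geo9Y x).Site → Finset ((E14₂ F) x).Walk) (hW14₁ : ∀ F : T4Family, ∀ x, WalkSetsSpec ((E14₁ F) x) ((W14₁ F) x)) (hW14₂ : ∀ F : T4Family, ∀ x, WalkSetsSpec ((E14₂ F) x) ((W14₂ F) x)) (hcnt14₁ : ∀ F : T4Family, WalkWeightsSummable geo9Y (bg9YR (Matrix (Fin 2) (Fin 2) ℂ) (specialUnitaryUnits (Fin 2)) (R₁ F) (R₂ F)) (E14₁ F) (W14₁ F)) (hcnt14₂ : ∀ F : T4Family,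 WalkWeightsSummable geo9Y (bg9YR (Matrix (Fin 2) (Fin 2) ℂ) (specialUnitaryUnits (Fin 2)) (R₁ F) (R₂ F)) (E14₂ F) (W14₂ F))
    (hexp14 : ∀ F : T4Family, ∀ (x : MemberY (stage3OfFamily F).d₆ (stage3OfFamily F).ℓ₆ (stage3OfFamily F).hd' (stage3OfFamily F).hL' (stage3OfFamily F).b₀ (stage3OfFamily F).b₁ (Mstar F)) (U : (bg9YR (Matrix (Fin 2) (Fin 2) ℂ) (specialUnitaryUnits (Fin 2)) (R₁ F) (R₂ F) x).Cfg), ((E14₁ F) x).Converges U ∧ ((E14₂ F) x).Converges U → ExpansionReads x.toKIdx (B := bg9YR (Matrix (Fin 2) (Fin 2) ℂ) (specialUnitaryUnits (Fin 2)) (R₁ F) (R₂ F) x) (fun U => U) ((lettersYOfRecordV11K 2 (stage3OfFamily F) (Mstar F) (𝔯 F)) x).Kdiff (pairOp (locDataY x ((E14₁ F) x) ((X14₁ F) x) ((M14₁ F) x) ((diam14 F) x)).Touches (locData₂ (locDataY x ((E14₁ F) x) ((X14₁ F) x) ((M14₁ F) x) ((diam14 F) x)) ((X14₂ F) x) ((M14₂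 F) x)).Touches ((T14₁ F) x) ((T14₂ F) x)) (pairWalkSets ((W14₁ F) x) ((W14₂ F) x) (locDataY x ((E14₁ F) x) ((X14₁ F) x) ((M14₁ F) x) ((diam14 F) x)).Touches (locData₂ (locDataY x ((E14₁ F) x) ((X14₁ F) x) ((M14₁ F) x) ((diam14 F) x)) ((X14₂ F) x) ((M14₂ F) x)).Touches) U) (a₀E δ₁E B₁E : ∀ F : T4Family, ℝ) (ha₀E : ∀ F : T4Family, 0 < (a₀E F)) (hδ₁E : ∀ F : T4Family, 0 < (δ₁E F)) (hB₁E : ∀ F : T4Family, 0 < (B₁E F)) (hE : ∀ F : T4Family, ∀ (x : MemberY (stage3OfFamily F).d₆ (stage3OfFamily F).ℓ₆ (stage3OfFamily F).hd' (stage3OfFamily F).hL' (stage3OfFamily F).b₀ (stage3OfFamily F).b₁ (Mstar F)), ((Mstar F) : ℝ) ≤ (geo9Y x).M → ∀ (α₀ : ℝ), 0 < α₀ → (geo9Y x).M * α₀ ≤ (a₀E F) → ∀ U : (bg9YR (Matrix (Fin 2) (Fin 2) ℂ) (specialUnitaryUnits (Fin 2)) (R₁ F) (R₂ F) x).Cfg,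 (bg9YR (Matrix (Fin 2) (Fin 2) ℂ) (specialUnitaryUnits (Fin 2)) (R₁ F) (R₂ F) x).Reg335 (c F) α₀ U → (bg9YR (Matrix (Fin 2) (Fin 2) ℂ) (specialUnitaryUnits (Fin 2)) (R₁ F) (R₂ F) x).Reg336 (c F) α₀ U → givenBy3185stY x ((lettersYOfRecordV11K 2 (stage3OfFamily F) (Mstar F) (𝔯 F)) x) (sectEStYOfRecordV7 2 (stage3OfFamily F) (Mstar F) (𝔢₀ F) x) U ∧ hasRWExpCY ((𝔴 F) x) U (δ₁E F) ∧ DecayMidOnStY x ((lettersYOfRecordV11K 2 (stage3OfFamily F) (Mstar F) (𝔯 F)) x) (sectEStYOfRecordV7 2 (stage3OfFamily F) (Mstar F) (𝔢₀ F) x) (B₁E F) U (δ₁E F)) (ιR : ∀ F : T4Family, Type) (instN06_7 : ∀ F : T4Family, Fintype (ιR F)) (instN06_8 : ∀ F : T4Family, DecidableEq (ιR F)) (bR : ∀ F : T4Family, Module.Basis (ιR F) ℝ (Matrix (Fin 2) (Fin 2) ℂ)) (C38 : ∀ F : T4Family, ∀ j : (SCMemberY (stage3OfFamily F).d₆ (stage3OfFamily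 F).ℓ₆ (stage3OfFamily F).hd' (stage3OfFamily F).hL' (stage3OfFamily F).b₀ (stage3OfFamily F).b₁ (Mstar F)), ℝ → CfgY (Matrix (Fin 2) (Fin 2) ℂ) j.val.toKIdx → AfldY (Matrix (Fin 2) (Fin 2) ℂ) j.val.toKIdx → Prop) (MR : ∀ F : T4Family, ℝ) (hMR : ∀ F : T4Family, 0 < (MR F))
    (hΔAK : ∀ F : T4Family, ∀ x : MemberY (stage3OfFamily F).d₆ (stage3OfFamily F).ℓ₆ (stage3OfFamily F).hd' (stage3OfFamily F).hL' (stage3OfFamily F).b₀ (stage3OfFamily F).b₁ (Mstar F), (MR F) ≤ (geo9Y x).M → ∀ α₀ : ℝ, 0 < α₀ → (geo9Y x).M * α₀ ≤ (q F).a₁ / (c F) → ∀ U : (bg9YR (Matrix (Fin 2) (Fin 2) ℂ) (specialUnitaryUnits (Fin 2)) (R₁ F) (R₂ F) x).Cfg, (bg9YR (Matrix (Fin 2) (Fin 2) ℂ) (specialUnitaryUnits (Fin 2)) (R₁ F) (R₂ F) x).Reg335 (c F) α₀ U → IsSymmTr (fun _ => (1 : ℝ)) (deltaAQY x.toKIdx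 (qKnitOfRecord 2 (stage3OfFamily F) x.toKIdx) (qsKnitOfRecord 2 (stage3OfFamily F) x.toKIdx) (parKnitY x.toKIdx) (GpY x.toKIdx (parKnitY x.toKIdx)) U) ∧ PosDefTr (fun _ => (1 : ℝ)) (deltaAQY x.toKIdx (qKnitOfRecord 2 (stage3OfFamily F) x.toKIdx) (qsKnitOfRecord 2 (stage3OfFamily F) x.toKIdx) (parKnitY x.toKIdx) (GpY x.toKIdx (parKnitY x.toKIdx)) U)) (s349K : ∀ F : T4Family, B9.Stmt349Printed ((stage3OfFamily F).d₆ + 1) (c F) geo9Y (bg9YR (Matrix (Fin 2) (Fin 2) ℂ) (specialUnitaryUnits (Fin 2)) (R₁ F) (R₂ F)) (fun x => fineKernelR (R₁ F) (R₂ F) ((opsYSectESt 2 (stage3OfFamily F) (Mstar F) (opsYS349NuOfLettersH 2 (stage3OfFamily F) (Mstar F) (lettersYOfRecordV11K 2 (stage3OfFamily F) (Mstar F) (𝔯 F)) (fun x => parSymY x.toKIdx) (𝔈 F)) (lettersYOfRecordV11K 2 (stage3OfFamily F) (Mstar F) (𝔯 F)) (sectEStYOfRecordV7 2 (stage3OfFamily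 F) (Mstar F) (𝔢₀ F)) (𝔴 F)) x).P349)) (s3132K : ∀ F : T4Family, B9.Stmt3132Printed ((stage3OfFamily F).d₆ + 1) (c F) geo9Y (bg9YR (Matrix (Fin 2) (Fin 2) ℂ) (specialUnitaryUnits (Fin 2)) (R₁ F) (R₂ F)) (fun x => siteKernelR (R₁ F) (R₂ F) ((opsYSectESt 2 (stage3OfFamily F) (Mstar F) (opsYS349NuOfLettersH 2 (stage3OfFamily F) (Mstar F) (lettersYOfRecordV11K 2 (stage3OfFamily F) (Mstar F) (𝔯 F)) (fun x => parSymY x.toKIdx) (𝔈 F)) (lettersYOfRecordV11K 2 (stage3OfFamily F) (Mstar F) (𝔯 F)) (sectEStYOfRecordV7 2 (stage3OfFamily F) (Mstar F) (𝔢₀ F)) (𝔴 F)) x).QGQinv) (fun x => siteKernelR (R₁ F) (R₂ F) ((opsYSectESt 2 (stage3OfFamily F) (Mstar F) (opsYS349NuOfLettersH 2 (stage3OfFamily F) (Mstar F) (lettersYOfRecordV11K 2 (stage3OfFamily F) (Mstar F) (𝔯 F)) (fun x => parSymY x.toKIdx) (𝔈 F)) (lettersYOfRecordV11K 2 (stage3OfFamily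 F) (Mstar F) (𝔯 F)) (sectEStYOfRecordV7 2 (stage3OfFamily F) (Mstar F) (𝔢₀ F)) (𝔴 F)) x).QG1Qinv))
    (hBK : ∀ F : T4Family, B9.Thm32Printed ((stage3OfFamily F).d₆ + 1) c35Y (fun (j : SCMemberY (stage3OfFamily F).d₆ (stage3OfFamily F).ℓ₆ (stage3OfFamily F).hd' (stage3OfFamily F).hL' (stage3OfFamily F).b₀ (stage3OfFamily F).b₁ (Mstar F)) => geo9Y j.val) (fun (j : SCMemberY (stage3OfFamily F).d₆ (stage3OfFamily F).ℓ₆ (stage3OfFamily F).hd' (stage3OfFamily F).hL' (stage3OfFamily F).b₀ (stage3OfFamily F).b₁ (Mstar F)) => bg9YC (Matrix (Fin 2) (Fin 2) ℂ) (specialUnitaryUnits (Fin 2)) (extraYPb (Matrix (Fin 2) (Fin 2) ℂ) (specialUnitaryUnits (Fin 2))) j.val) (CinvY (extraYPb (Matrix (Fin 2) (Fin 2) ℂ) (specialUnitaryUnits (Fin 2))) SCMemberY.val (specialUnitaryUnits (Fin 2)) (fun (j : SCMemberY (stage3OfFamily F).d₆ (stage3OfFamily F).ℓ₆ (stage3OfFamily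 F).hd' (stage3OfFamily F).hL' (stage3OfFamily F).b₀ (stage3OfFamily F).b₁ (Mstar F)) => parKnitY j.val.toKIdx)) → B9.Thm33Printed c35Y (fun (j : SCMemberY (stage3OfFamily F).d₆ (stage3OfFamily F).ℓ₆ (stage3OfFamily F).hd' (stage3OfFamily F).hL' (stage3OfFamily F).b₀ (stage3OfFamily F).b₁ (Mstar F)) => geo9Y j.val) (fun (j : SCMemberY (stage3OfFamily F).d₆ (stage3OfFamily F).ℓ₆ (stage3OfFamily F).hd' (stage3OfFamily F).hL' (stage3OfFamily F).b₀ (stage3OfFamily F).b₁ (Mstar F)) => bg9YC (Matrix (Fin 2) (Fin 2) ℂ) (specialUnitaryUnits (Fin 2)) (extraYPb (Matrix (Fin 2) (Fin 2) ℂ) (specialUnitaryUnits (Fin 2))) j.val) (fun (j : SCMemberY (stage3OfFamily F).d₆ (stage3OfFamily F).ℓ₆ (stage3OfFamily F).hd' (stage3OfFamily F).hL' (stage3OfFamily F).b₀ (stage3OfFamily F).b₁ (Mstar F)) => kernelFamilyS j.val.toKIdx (bg9YC (Matrix (Fin 2) (Fin 2) ℂ) (specialUnitaryUnits (Fin 2))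 (extraYPb (Matrix (Fin 2) (Fin 2) ℂ) (specialUnitaryUnits (Fin 2))) j.val) (fun U => U) (GpY j.val.toKIdx (parKnitY j.val.toKIdx)) (parSymY j.val.toKIdx)) (fun (j : SCMemberY (stage3OfFamily F).d₆ (stage3OfFamily F).ℓ₆ (stage3OfFamily F).hd' (stage3OfFamily F).hL' (stage3OfFamily F).b₀ (stage3OfFamily F).b₁ (Mstar F)) => kernelFamilyB j.val.toKIdx (bg9YC (Matrix (Fin 2) (Fin 2) ℂ) (specialUnitaryUnits (Fin 2)) (extraYPb (Matrix (Fin 2) (Fin 2) ℂ) (specialUnitaryUnits (Fin 2))) j.val) (fun U => U) (GAQY j.val.toKIdx (qKnitOfRecord 2 (stage3OfFamily F) j.val.toKIdx) (qsKnitOfRecord 2 (stage3OfFamily F) j.val.toKIdx) (parKnitY j.val.toKIdx) (GpY j.val.toKIdx (parKnitY j.val.toKIdx))) (parBY j.val.toKIdx)) → SectBStepUPar (extraYPb (Matrix (Fin 2) (Fin 2) ℂ) (specialUnitaryUnits (Fin 2))) SCMemberY.val ((stage3OfFamily F).d₆ + 1) c35Y (specialUnitaryUnits (Fin 2)) (bR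 F) (fun (j : SCMemberY (stage3OfFamily F).d₆ (stage3OfFamily F).ℓ₆ (stage3OfFamily F).hd' (stage3OfFamily F).hL' (stage3OfFamily F).b₀ (stage3OfFamily F).b₁ (Mstar F)) => parKnitY j.val.toKIdx) (fun (j : SCMemberY (stage3OfFamily F).d₆ (stage3OfFamily F).ℓ₆ (stage3OfFamily F).hd' (stage3OfFamily F).hL' (stage3OfFamily F).b₀ (stage3OfFamily F).b₁ (Mstar F)) => parSymY j.val.toKIdx) (fun (j : SCMemberY (stage3OfFamily F).d₆ (stage3OfFamily F).ℓ₆ (stage3OfFamily F).hd' (stage3OfFamily F).hL' (stage3OfFamily F).b₀ (stage3OfFamily F).b₁ (Mstar F)) => GAQY j.val.toKIdx (qKnitOfRecord 2 (stage3OfFamily F) j.val.toKIdx) (qsKnitOfRecord 2 (stage3OfFamily F) j.val.toKIdx) (parKnitY j.val.toKIdx) (GpY j.val.toKIdx (parKnitY j.val.toKIdx))) (fun (j : SCMemberY (stage3OfFamily F).d₆ (stage3OfFamily F).ℓ₆ (stage3OfFamily F).hd' (stage3OfFamily F).hL' (stage3OfFamily F).b₀ (stage3OfFamily F).b₁ (Mstar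 F)) => parBY j.val.toKIdx) (fun (j : SCMemberY (stage3OfFamily F).d₆ (stage3OfFamily F).ℓ₆ (stage3OfFamily F).hd' (stage3OfFamily F).hL' (stage3OfFamily F).b₀ (stage3OfFamily F).b₁ (Mstar F)) => C37GY (specialUnitaryUnits (Fin 2)) j.val (SCMemberY.ιBsc j) (cqY (stage3OfFamily F).d₆)) (C38 F) (CinvY (extraYPb (Matrix (Fin 2) (Fin 2) ℂ) (specialUnitaryUnits (Fin 2))) SCMemberY.val (specialUnitaryUnits (Fin 2)) (fun (j : SCMemberY (stage3OfFamily F).d₆ (stage3OfFamily F).ℓ₆ (stage3OfFamily F).hd' (stage3OfFamily F).hL' (stage3OfFamily F).b₀ (stage3OfFamily F).b₁ (Mstar F)) => parKnitY j.val.toKIdx)))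
    (hRP2 : ∀ F : T4Family, ∀ (x : MemberY (stage3OfFamily F).d₆ (stage3OfFamily F).ℓ₆ (stage3OfFamily F).hd' (stage3OfFamily F).hL' (stage3OfFamily F).b₀ (stage3OfFamily F).b₁ (Mstar F)) (α₀ : ℝ) (U : (bg9YR (Matrix (Fin 2) (Fin 2) ℂ) (specialUnitaryUnits (Fin 2)) (R₁ F) (R₂ F) x).Cfg), (bg9YR (Matrix (Fin 2) (Fin 2) ℂ) (specialUnitaryUnits (Fin 2)) (R₁ F) (R₂ F) x).Reg336 (c F) α₀ U → 0 ≤ α₀ ∧ (bg9YP (Matrix (Fin 2) (Fin 2) ℂ) (specialUnitaryUnits (Fin 2)) x).Reg336 c35Y α₀ U) (M46K a46K B46K δ46K : ∀ F : T4Family, ℝ) (hM46K : ∀ F : T4Family, 0 < (M46K F)) (ha46K : ∀ F : T4Family, 0 < (a46K F)) (hB46K : ∀ F : T4Family, 0 < (B46K F)) (hα3 : ∀ F : T4Family, 3 * (p F).α ≤ (1 - (p F).αF) * (1 - 2 * (p F).α)) (bHXT : ∀ F : T4Family, ∀ x : MemberY (stage3OfFamily F).d₆ (stage3OfFamily F).ℓ₆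 (stage3OfFamily F).hd' (stage3OfFamily F).hL' (stage3OfFamily F).b₀ (stage3OfFamily F).b₁ (Mstar F), (bg9YR (Matrix (Fin 2) (Fin 2) ℂ) (specialUnitaryUnits (Fin 2)) (R₁ F) (R₂ F) x).Cfg → ℝ → BlockNorm (toB6 (geo9Y x) 1 ((H F) x)) ((XSK (TrIdx 2) x.toKIdx) → ℝ)) (hbHXT : ∀ F : T4Family, ∀ (x : MemberY (stage3OfFamily F).d₆ (stage3OfFamily F).ℓ₆ (stage3OfFamily F).hd' (stage3OfFamily F).hL' (stage3OfFamily F).b₀ (stage3OfFamily F).b₁ (Mstar F)) (U : (bg9YR (Matrix (Fin 2) (Fin 2) ℂ) (specialUnitaryUnits (Fin 2)) (R₁ F) (R₂ F) x).Cfg), (bHXT F) x U = fun ε => letI : Fintype (B9GeoNormsKLevelV1.geo9K x.toKIdx).Site := (inferInstance : Fintype (geo9Y x).Site); bHZPIfam (κ := TrIdx 2) x.toKIdx (trBasis 2) (taxiS x.toKIdx (bg9YR (Matrix (Fin 2) (Fin 2) ℂ) (specialUnitaryUnits (Fin 2)) (R₁ F) (R₂ F) x) (fun U => U) U) (R :=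 (1 : ℝ)) (H := (H F) x) ε) (hopI : ∀ F : T4Family, ∀ x, (p F).M₁ ≤ (geo9Y x).M → ∀ α₀ : ℝ, 0 < α₀ → (c F) * (geo9Y x).M * α₀ ≤ (p F).a₁ → ∀ U : (bg9YR (Matrix (Fin 2) (Fin 2) ℂ) (specialUnitaryUnits (Fin 2)) (R₁ F) (R₂ F) x).Cfg, (bg9YR (Matrix (Fin 2) (Fin 2) ℂ) (specialUnitaryUnits (Fin 2)) (R₁ F) (R₂ F) x).Reg335 (c F) α₀ U → InputLegsPair37 (opsWalkYO x (trBasis 2) (bg9YR (Matrix (Fin 2) (Fin 2) ℂ) (specialUnitaryUnits (Fin 2)) (R₁ F) (R₂ F) x) (fun U => U) (parKnitY x.toKIdx) ((bI F) x) ((O F) x)) (dirOpsWalkYO x (trBasis 2) (bg9YR (Matrix (Fin 2) (Fin 2) ℂ) (specialUnitaryUnits (Fin 2)) (R₁ F) (R₂ F) x) (fun U => U) (parKnitY x.toKIdx) ((bI F) x) ((O F) x)) ((𝔭 F) x) 1 ((H F) x) ((bHXT F) x U) ((SI F) x) (p F).BI (p F).BI2 (p F).δ₀ U ∧ FactorsInputPair37Dir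 (opsWalkYO x (trBasis 2) (bg9YR (Matrix (Fin 2) (Fin 2) ℂ) (specialUnitaryUnits (Fin 2)) (R₁ F) (R₂ F) x) (fun U => U) (parKnitY x.toKIdx) ((bI F) x) ((O F) x)) (dirOpsWalkYO x (trBasis 2) (bg9YR (Matrix (Fin 2) (Fin 2) ℂ) (specialUnitaryUnits (Fin 2)) (R₁ F) (R₂ F) x) (fun U => U) (parKnitY x.toKIdx) ((bI F) x) ((O F) x)) (dirLettersWalkYO x (trBasis 2) (bg9YR (Matrix (Fin 2) (Fin 2) ℂ) (specialUnitaryUnits (Fin 2)) (R₁ F) (R₂ F) x) (fun U => U) (parKnitY x.toKIdx) ((bI F) x) ((O F) x)) 1 ((H F) x) ((bHXT F) x U) (p F).θI (p F).δ₀ U) (S2A : ∀ F : T4Family, ∀ x : MemberY (stage3OfFamily F).d₆ (stage3OfFamily F).ℓ₆ (stage3OfFamily F).hd' (stage3OfFamily F).hL' (stage3OfFamily F).b₀ (stage3OfFamily F).b₁ (Mstar F), (ιA F) x → Finset (geo9Y x).Site)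
    (bHXTA : ∀ F : T4Family, ∀ x : MemberY (stage3OfFamily F).d₆ (stage3OfFamily F).ℓ₆ (stage3OfFamily F).hd' (stage3OfFamily F).hL' (stage3OfFamily F).b₀ (stage3OfFamily F).b₁ (Mstar F), (bg9YR (Matrix (Fin 2) (Fin 2) ℂ) (specialUnitaryUnits (Fin 2)) (R₁ F) (R₂ F) x).Cfg → ℝ → BlockNorm (toB6 (geo9Y x) 1 ((H F) x)) ((XBK (TrIdx 2) x.toKIdx) → ℝ)) (hbHXTA : ∀ F : T4Family, ∀ (x : MemberY (stage3OfFamily F).d₆ (stage3OfFamily F).ℓ₆ (stage3OfFamily F).hd' (stage3OfFamily F).hL' (stage3OfFamily F).b₀ (stage3OfFamily F).b₁ (Mstar F)) (U : (bg9YR (Matrix (Fin 2) (Fin 2) ℂ) (specialUnitaryUnits (Fin 2)) (R₁ F) (R₂ F) x).Cfg), (bHXTA F) x U = fun ε => letI : Fintype (B9GeoNormsKLevelV1.geo9K x.toKIdx).Site := (inferInstance : Fintype (geo9Y x).Site); bHZKPIfam (κ := TrIdx 2) x.toKIdx (trBasis 2) (taxiB x.toKIdx (bg9YR (Matrix (Fin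 2) (Fin 2) ℂ) (specialUnitaryUnits (Fin 2)) (R₁ F) (R₂ F) x) (fun U => U) U) (R := (1 : ℝ)) (H := (H F) x) ε) (hopIA : ∀ F : T4Family, ∀ x, (q F).M₁ ≤ (geo9Y x).M → ∀ α₀ : ℝ, 0 < α₀ → (c F) * (geo9Y x).M * α₀ ≤ (q F).a₁ → ∀ U : (bg9YR (Matrix (Fin 2) (Fin 2) ℂ) (specialUnitaryUnits (Fin 2)) (R₁ F) (R₂ F) x).Cfg, (bg9YR (Matrix (Fin 2) (Fin 2) ℂ) (specialUnitaryUnits (Fin 2)) (R₁ F) (R₂ F) x).Reg335 (c F) α₀ U → InputLegsPair310 ((𝔬A F) x) ((𝔡A F) x) ((𝔭A F) x) 1 ((H F) x) ((bHXTA F) x U) ((SIA F) x) (q F).BI (q F).BI2 (q F).δ₀ U ∧ FactorsInputPair310 ((𝔬A F) x) ((𝔡A F) x) 1 ((H F) x) ((bHXTA F) x U) (q F).θI (q F).δ₀ U) (h36A2 : ∀ F : T4Family, ∀ x, (q F).M₁ ≤ (geo9Y x).M → ∀ α₀ : ℝ, 0 < α₀ → (c F) * (geo9Y x).M * α₀ ≤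 (q F).a₁ → ∀ U : (bg9YR (Matrix (Fin 2) (Fin 2) ℂ) (specialUnitaryUnits (Fin 2)) (R₁ F) (R₂ F) x).Cfg, (bg9YR (Matrix (Fin 2) (Fin 2) ℂ) (specialUnitaryUnits (Fin 2)) (R₁ F) (R₂ F) x).Reg335 (c F) α₀ U → L2TwoLegs310 ((𝔬A F) x) 1 ((H F) x) ((S2A F) x) (q F).B2 (q F).δ₀ U ∧ FactorsL2_310 ((𝔬A F) x) 1 ((H F) x) (q F).θ2 (q F).δ₀ U) (hcnt2A : ∀ F : T4Family, ∀ x (a : (geo9Y x).Site), (∑ cᵢ, if a ∈ (S2A F) x cᵢ then (1 : ℝ) else 0) ≤ (q F).N2) (hblk12 : ∀ F : T4Family, ∀ x : MemberY (stage3OfFamily F).d₆ (stage3OfFamily F).ℓ₆ (stage3OfFamily F).hd' (stage3OfFamily F).hL' (stage3OfFamily F).b₀ (stage3OfFamily F).b₁ (Mstar F), ((𝔬12 F) x).blk = blkBK x.toKIdx ((bI F) x)) (hblkW12 : ∀ F : T4Family, ∀ x : MemberY (stage3OfFamily F).d₆ (stage3OfFamily F).ℓ₆ (stage3OfFamily F).hd'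 (stage3OfFamily F).hL' (stage3OfFamily F).b₀ (stage3OfFamily F).b₁ (Mstar F), ((𝔬12 F) x).blkW = blkSK x.toKIdx (sIK x.toKIdx ((bI F) x))) (hblkY12 : ∀ F : T4Family, ∀ x : MemberY (stage3OfFamily F).d₆ (stage3OfFamily F).ℓ₆ (stage3OfFamily F).hd' (stage3OfFamily F).hL' (stage3OfFamily F).b₀ (stage3OfFamily F).b₁ (Mstar F), ((𝔬12 F) x).blkY = blkBK x.toKIdx ((bI F) x)) (hG0co12 : ∀ F : T4Family, ∀ (x : MemberY (stage3OfFamily F).d₆ (stage3OfFamily F).ℓ₆ (stage3OfFamily F).hd' (stage3OfFamily F).hL' (stage3OfFamily F).b₀ (stage3OfFamily F).b₁ (Mstar F)) (U : (bg9YR (Matrix (Fin 2) (Fin 2) ℂ) (specialUnitaryUnits (Fin 2)) (R₁ F) (R₂ F) x).Cfg), ((𝔬12 F) x).G0 U = GcoK x.toKIdx (trBasis 2) (bg9YR (Matrix (Fin 2) (Fin 2) ℂ) (specialUnitaryUnits (Fin 2)) (R₁ F) (R₂ F) x) (fun U => U) ((lettersYOfRecordV11K 2 (stage3OfFamily F)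 (Mstar F) (𝔯 F)) x).GA U)
    (hGco12 : ∀ F : T4Family, ∀ (x : MemberY (stage3OfFamily F).d₆ (stage3OfFamily F).ℓ₆ (stage3OfFamily F).hd' (stage3OfFamily F).hL' (stage3OfFamily F).b₀ (stage3OfFamily F).b₁ (Mstar F)) (U : (bg9YR (Matrix (Fin 2) (Fin 2) ℂ) (specialUnitaryUnits (Fin 2)) (R₁ F) (R₂ F) x).Cfg), ((𝔬12 F) x).G U = GcoK x.toKIdx (trBasis 2) (bg9YR (Matrix (Fin 2) (Fin 2) ℂ) (specialUnitaryUnits (Fin 2)) (R₁ F) (R₂ F) x) (fun U => U) ((lettersYOfRecordV11K 2 (stage3OfFamily F) (Mstar F) (𝔯 F)) x).GD U) (hG1co12 : ∀ F : T4Family, ∀ (x : MemberY (stage3OfFamily F).d₆ (stage3OfFamily F).ℓ₆ (stage3OfFamily F).hd' (stage3OfFamily F).hL' (stage3OfFamily F).b₀ (stage3OfFamily F).b₁ (Mstar F)) (U : (bg9YR (Matrix (Fin 2) (Fin 2) ℂ) (specialUnitaryUnits (Fin 2)) (R₁ F) (R₂ F) x).Cfg), ((𝔬12 F) x).G1 U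 = GcoK x.toKIdx (trBasis 2) (bg9YR (Matrix (Fin 2) (Fin 2) ℂ) (specialUnitaryUnits (Fin 2)) (R₁ F) (R₂ F) x) (fun U => U) ((lettersYOfRecordV11K 2 (stage3OfFamily F) (Mstar F) (𝔯 F)) x).G₁ U) (hGGco12 : ∀ F : T4Family, ∀ (x : MemberY (stage3OfFamily F).d₆ (stage3OfFamily F).ℓ₆ (stage3OfFamily F).hd' (stage3OfFamily F).hL' (stage3OfFamily F).b₀ (stage3OfFamily F).b₁ (Mstar F)) (U : (bg9YR (Matrix (Fin 2) (Fin 2) ℂ) (specialUnitaryUnits (Fin 2)) (R₁ F) (R₂ F) x).Cfg), ((𝔬12 F) x).GG U = GcoK x.toKIdx (trBasis 2) (bg9YR (Matrix (Fin 2) (Fin 2) ℂ) (specialUnitaryUnits (Fin 2)) (R₁ F) (R₂ F) x) (fun U => U) ((lettersYOfRecordV11K 2 (stage3OfFamily F) (Mstar F) (𝔯 F)) x).GG U) (hDco12 : ∀ F : T4Family, ∀ (x : MemberY (stage3OfFamily F).d₆ (stage3OfFamily F).ℓ₆ (stage3OfFamily F).hd' (stage3OfFamily F).hL' (stage3OfFamily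 F).b₀ (stage3OfFamily F).b₁ (Mstar F)) (U : (bg9YR (Matrix (Fin 2) (Fin 2) ℂ) (specialUnitaryUnits (Fin 2)) (R₁ F) (R₂ F) x).Cfg), ((𝔬12 F) x).D U = DcoK x.toKIdx (trBasis 2) (bg9YR (Matrix (Fin 2) (Fin 2) ℂ) (specialUnitaryUnits (Fin 2)) (R₁ F) (R₂ F) x) (fun U => U) U) (hDsco12 : ∀ F : T4Family, ∀ (x : MemberY (stage3OfFamily F).d₆ (stage3OfFamily F).ℓ₆ (stage3OfFamily F).hd' (stage3OfFamily F).hL' (stage3OfFamily F).b₀ (stage3OfFamily F).b₁ (Mstar F)) (U : (bg9YR (Matrix (Fin 2) (Fin 2) ℂ) (specialUnitaryUnits (Fin 2)) (R₁ F) (R₂ F) x).Cfg), ((𝔬12 F) x).Dstar U = DscoK x.toKIdx (trBasis 2) (bg9YR (Matrix (Fin 2) (Fin 2) ℂ) (specialUnitaryUnits (Fin 2)) (R₁ F) (R₂ F) x) (fun U => U) U) (hblkZ12 : ∀ F : T4Family, ∀ x : MemberY (stage3OfFamily F).d₆ (stage3OfFamily F).ℓ₆ (stage3OfFamily F).hd'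 (stage3OfFamily F).hL' (stage3OfFamily F).b₀ (stage3OfFamily F).b₁ (Mstar F), ((𝔬12 F) x).blkZ = blkHK x.toKIdx) (hHm12 : ∀ F : T4Family, ∀ (x : MemberY (stage3OfFamily F).d₆ (stage3OfFamily F).ℓ₆ (stage3OfFamily F).hd' (stage3OfFamily F).hL' (stage3OfFamily F).b₀ (stage3OfFamily F).b₁ (Mstar F)) (U : (bg9YR (Matrix (Fin 2) (Fin 2) ℂ) (specialUnitaryUnits (Fin 2)) (R₁ F) (R₂ F) x).Cfg), ((𝔬12 F) x).Hm U = HcoK x.toKIdx (trBasis 2) (bg9YR (Matrix (Fin 2) (Fin 2) ℂ) (specialUnitaryUnits (Fin 2)) (R₁ F) (R₂ F) x) (fun U => U) ((lettersYOfRecordV11K 2 (stage3OfFamily F) (Mstar F) (𝔯 F)) x).H U)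
    (hH1m12 : ∀ F : T4Family, ∀ (x : MemberY (stage3OfFamily F).d₆ (stage3OfFamily F).ℓ₆ (stage3OfFamily F).hd' (stage3OfFamily F).hL' (stage3OfFamily F).b₀ (stage3OfFamily F).b₁ (Mstar F)) (U : (bg9YR (Matrix (Fin 2) (Fin 2) ℂ) (specialUnitaryUnits (Fin 2)) (R₁ F) (R₂ F) x).Cfg), ((𝔬12 F) x).H1m U = HcoK x.toKIdx (trBasis 2) (bg9YR (Matrix (Fin 2) (Fin 2) ℂ) (specialUnitaryUnits (Fin 2)) (R₁ F) (R₂ F) x) (fun U => U) ((lettersYOfRecordV11K 2 (stage3OfFamily F) (Mstar F) (𝔯 F)) x).H₁ U) (hS0co12 : ∀ F : T4Family, ∀ (x : MemberY (stage3OfFamily F).d₆ (stage3OfFamily F).ℓ₆ (stage3OfFamily F).hd' (stage3OfFamily F).hL' (stage3OfFamily F).b₀ (stage3OfFamily F).b₁ (Mstar F)) (U : (bg9YR (Matrix (Fin 2) (Fin 2) ℂ) (specialUnitaryUnits (Fin 2)) (R₁ F) (R₂ F) x).Cfg), ((𝔬12 F) x).S0 U = S0coKq x.toKIdx (trBasis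 2) (bg9YR (Matrix (Fin 2) (Fin 2) ℂ) (specialUnitaryUnits (Fin 2)) (R₁ F) (R₂ F) x) (fun U => U) (qKnitOfRecord 2 (stage3OfFamily F) x.toKIdx) (qsKnitOfRecord 2 (stage3OfFamily F) x.toKIdx) (parKnitY x.toKIdx) (GpPhysY x.toKIdx (parKnitY x.toKIdx)) U) (hTpico12 : ∀ F : T4Family, ∀ (x : MemberY (stage3OfFamily F).d₆ (stage3OfFamily F).ℓ₆ (stage3OfFamily F).hd' (stage3OfFamily F).hL' (stage3OfFamily F).b₀ (stage3OfFamily F).b₁ (Mstar F)) (U : (bg9YR (Matrix (Fin 2) (Fin 2) ℂ) (specialUnitaryUnits (Fin 2)) (R₁ F) (R₂ F) x).Cfg), ((𝔬12 F) x).Tpi U = TpicoK x.toKIdx (trBasis 2) (bg9YR (Matrix (Fin 2) (Fin 2) ℂ) (specialUnitaryUnits (Fin 2)) (R₁ F) (R₂ F) x) (fun U => U) (parKnitY x.toKIdx) (GpPhysY x.toKIdx (parKnitY x.toKIdx)) U) (hT2co12 : ∀ F : T4Family, ∀ (x : MemberY (stage3OfFamily F).d₆ (stage3OfFamily F).ℓ₆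 (stage3OfFamily F).hd' (stage3OfFamily F).hL' (stage3OfFamily F).b₀ (stage3OfFamily F).b₁ (Mstar F)) (U : (bg9YR (Matrix (Fin 2) (Fin 2) ℂ) (specialUnitaryUnits (Fin 2)) (R₁ F) (R₂ F) x).Cfg), ((𝔬12 F) x).T2 U = T2coK x.toKIdx (trBasis 2) (bg9YR (Matrix (Fin 2) (Fin 2) ℂ) (specialUnitaryUnits (Fin 2)) (R₁ F) (R₂ F) x) (fun U => U) (parKnitY x.toKIdx) (GpPhysY x.toKIdx (parKnitY x.toKIdx)) ((𝔯 F) x).Δ2 U) (hQco12 : ∀ F : T4Family, ∀ (x : MemberY (stage3OfFamily F).d₆ (stage3OfFamily F).ℓ₆ (stage3OfFamily F).hd' (stage3OfFamily F).hL' (stage3OfFamily F).b₀ (stage3OfFamily F).b₁ (Mstar F)) (U : (bg9YR (Matrix (Fin 2) (Fin 2) ℂ) (specialUnitaryUnits (Fin 2)) (R₁ F) (R₂ F) x).Cfg), ((𝔬12 F) x).Q U = QcoKHq x.toKIdx (trBasis 2) (bg9YR (Matrix (Fin 2) (Fin 2) ℂ) (specialUnitaryUnits (Fin 2)) (R₁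 F) (R₂ F) x) (fun U => U) (qKnitOfRecord 2 (stage3OfFamily F) x.toKIdx) U) (hQsco12 : ∀ F : T4Family, ∀ (x : MemberY (stage3OfFamily F).d₆ (stage3OfFamily F).ℓ₆ (stage3OfFamily F).hd' (stage3OfFamily F).hL' (stage3OfFamily F).b₀ (stage3OfFamily F).b₁ (Mstar F)) (U : (bg9YR (Matrix (Fin 2) (Fin 2) ℂ) (specialUnitaryUnits (Fin 2)) (R₁ F) (R₂ F) x).Cfg), ((𝔬12 F) x).Qstar U = QscoKHq x.toKIdx (trBasis 2) (bg9YR (Matrix (Fin 2) (Fin 2) ℂ) (specialUnitaryUnits (Fin 2)) (R₁ F) (R₂ F) x) (fun U => U) (qsKnitOfRecord 2 (stage3OfFamily F) x.toKIdx) U)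
    (hCco12 : ∀ F : T4Family, ∀ (x : MemberY (stage3OfFamily F).d₆ (stage3OfFamily F).ℓ₆ (stage3OfFamily F).hd' (stage3OfFamily F).hL' (stage3OfFamily F).b₀ (stage3OfFamily F).b₁ (Mstar F)) (U : (bg9YR (Matrix (Fin 2) (Fin 2) ℂ) (specialUnitaryUnits (Fin 2)) (R₁ F) (R₂ F) x).Cfg), ((𝔬12 F) x).C U = CcoKq x.toKIdx (trBasis 2) (bg9YR (Matrix (Fin 2) (Fin 2) ℂ) (specialUnitaryUnits (Fin 2)) (R₁ F) (R₂ F) x) (fun U => U) (qKnitOfRecord 2 (stage3OfFamily F) x.toKIdx) (qsKnitOfRecord 2 (stage3OfFamily F) x.toKIdx) (parKnitY x.toKIdx) (GpPhysY x.toKIdx (parKnitY x.toKIdx)) U) (hC1co12 : ∀ F : T4Family, ∀ (x : MemberY (stage3OfFamily F).d₆ (stage3OfFamily F).ℓ₆ (stage3OfFamily F).hd' (stage3OfFamily F).hL' (stage3OfFamily F).b₀ (stage3OfFamily F).b₁ (Mstar F)) (U : (bg9YR (Matrix (Fin 2) (Fin 2) ℂ) (specialUnitaryUnits (Fin 2))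 (R₁ F) (R₂ F) x).Cfg), ((𝔬12 F) x).C1 U = C1coKq x.toKIdx (trBasis 2) (bg9YR (Matrix (Fin 2) (Fin 2) ℂ) (specialUnitaryUnits (Fin 2)) (R₁ F) (R₂ F) x) (fun U => U) (qKnitOfRecord 2 (stage3OfFamily F) x.toKIdx) (qsKnitOfRecord 2 (stage3OfFamily F) x.toKIdx) (parKnitY x.toKIdx) (GpPhysY x.toKIdx (parKnitY x.toKIdx)) ((𝔯 F) x).Δ2 U) (hDvco12 : ∀ F : T4Family, ∀ (x : MemberY (stage3OfFamily F).d₆ (stage3OfFamily F).ℓ₆ (stage3OfFamily F).hd' (stage3OfFamily F).hL' (stage3OfFamily F).b₀ (stage3OfFamily F).b₁ (Mstar F)) (U : (bg9YR (Matrix (Fin 2) (Fin 2) ℂ) (specialUnitaryUnits (Fin 2)) (R₁ F) (R₂ F) x).Cfg), ((𝔬12 F) x).Dv U = DvcoKH x.toKIdx (trBasis 2) (bg9YR (Matrix (Fin 2) (Fin 2) ℂ) (specialUnitaryUnits (Fin 2)) (R₁ F) (R₂ F) x) (fun U => U) U) (hDvsco12 : ∀ F : T4Family, ∀ (x : MemberY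 (stage3OfFamily F).d₆ (stage3OfFamily F).ℓ₆ (stage3OfFamily F).hd' (stage3OfFamily F).hL' (stage3OfFamily F).b₀ (stage3OfFamily F).b₁ (Mstar F)) (U : (bg9YR (Matrix (Fin 2) (Fin 2) ℂ) (specialUnitaryUnits (Fin 2)) (R₁ F) (R₂ F) x).Cfg), ((𝔬12 F) x).Dvstar U = DvscoKH x.toKIdx (trBasis 2) (bg9YR (Matrix (Fin 2) (Fin 2) ℂ) (specialUnitaryUnits (Fin 2)) (R₁ F) (R₂ F) x) (fun U => U) U) (hRco12 : ∀ F : T4Family, ∀ (x : MemberY (stage3OfFamily F).d₆ (stage3OfFamily F).ℓ₆ (stage3OfFamily F).hd' (stage3OfFamily F).hL' (stage3OfFamily F).b₀ (stage3OfFamily F).b₁ (Mstar F)) (U : (bg9YR (Matrix (Fin 2) (Fin 2) ℂ) (specialUnitaryUnits (Fin 2)) (R₁ F) (R₂ F) x).Cfg), ((𝔬12 F) x).R U = RcoK x.toKIdx (trBasis 2) (bg9YR (Matrix (Fin 2) (Fin 2) ℂ) (specialUnitaryUnits (Fin 2)) (R₁ F) (R₂ F) x) (fun U => U) (parKnitY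 x.toKIdx) (GpPhysY x.toKIdx (parKnitY x.toKIdx)) U) (bH13 : ∀ F : T4Family, ∀ x : MemberY (stage3OfFamily F).d₆ (stage3OfFamily F).ℓ₆ (stage3OfFamily F).hd' (stage3OfFamily F).hL' (stage3OfFamily F).b₀ (stage3OfFamily F).b₁ (Mstar F), (bg9YR (Matrix (Fin 2) (Fin 2) ℂ) (specialUnitaryUnits (Fin 2)) (R₁ F) (R₂ F) x).Cfg → BlockNorm (toB6 (geo9Y x) 1 ((H F) x)) (XSK (TrIdx 2) x.toKIdx → ℝ)) (δ12₀ δK12 σ12 ρ12 a12 M12 B12₃ δ12₃ ρ13 α12 : ∀ F : T4Family, ℝ) (ρf12 : ∀ F : T4Family, ℝ) (hρf12 : ∀ F : T4Family, 0 < (ρf12 F)) (hρf1 : ∀ F : T4Family, (ρf12 F) + (σ12 F) ≤ (1 - (α12 F)) * (ρ12 F)) (hρf2 : ∀ F : T4Family, (ρf12 F) + 2 * (σ12 F) + (α12 F) * (ρ12 F) ≤ (ρ12 F)) (hB12₃ : ∀ F : T4Family, 0 ≤ (B12₃ F)) (hσ12 : ∀ F : T4Family, 0 < (σ12 F)) (hρ12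 : ∀ F : T4Family, 0 < (ρ12 F)) (hρS12 : ∀ F : T4Family, (ρ12 F) ≤ (δ12₀ F)) (hρδ12 : ∀ F : T4Family, (ρ12 F) + 2 * (σ12 F) ≤ (δK12 F)) (hρ₃12 : ∀ F : T4Family, (ρ12 F) + (σ12 F) ≤ (δ12₃ F))
    (ha12 : ∀ F : T4Family, 0 < (a12 F)) (hM12 : ∀ F : T4Family, 0 < (M12 F)) (hα12 : ∀ F : T4Family, 0 < (α12 F)) (hα12' : ∀ F : T4Family, (α12 F) ≤ 1 / 2) (hδ₃₀ : ∀ F : T4Family, (δ12₃ F) < (δ12₀ F)) (hδ12₀ : ∀ F : T4Family, (δ12₀ F) ≤ (1 - 3 * (q F).αF) * ((1 - 2 * (q F).α) * (q F).δ₀)) (t12 δT12 ρS σS : ∀ F : T4Family, ℝ) (ht12 : ∀ F : T4Family, 0 ≤ (t12 F)) (hσS : ∀ F : T4Family, 0 < (σS F)) (hρST : ∀ F : T4Family, (ρS F) ≤ (δT12 F)) (hρS₀ : ∀ F : T4Family, (ρS F) + (σS F) ≤ (δ12₀ F)) (hδKS : ∀ F : T4Family, (δK12 F) + (q F).αF *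 ((1 - 2 * (q F).α) * (q F).δ₀) ≤ (ρS F)) (hσSK : ∀ F : T4Family, (σS F) ≤ (δK12 F)) (bXH : ∀ F : T4Family, ∀ x : MemberY (stage3OfFamily F).d₆ (stage3OfFamily F).ℓ₆ (stage3OfFamily F).hd' (stage3OfFamily F).hL' (stage3OfFamily F).b₀ (stage3OfFamily F).b₁ (Mstar F), (bg9YR (Matrix (Fin 2) (Fin 2) ℂ) (specialUnitaryUnits (Fin 2)) (R₁ F) (R₂ F) x).Cfg → BlockNorm (toB6 (geo9Y x) 1 ((H F) x)) (XBK (TrIdx 2) x.toKIdx → ℝ)) (w13 wX : ∀ F : T4Family, ℝ → ℝ) (hw13₀ : ∀ F : T4Family, ∀ s, 0 ≤ (w13 F) s) (hw13₁ : ∀ F : T4Family, ∀ s, (w13 F) s ≤ 1) (hwX₀ : ∀ F : T4Family, ∀ s, 0 ≤ (wX F) s) (hwX₁ : ∀ F : T4Family, ∀ s, (wX F) s ≤ 1) (hbH13 : ∀ F : T4Family, ∀ (x : MemberY (stage3OfFamily F).d₆ (stage3OfFamily F).ℓ₆ (stage3OfFamily F).hd' (stage3OfFamily F).hL' (stage3OfFamily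 F).b₀ (stage3OfFamily F).b₁ (Mstar F)) (U : (bg9YR (Matrix (Fin 2) (Fin 2) ℂ) (specialUnitaryUnits (Fin 2)) (R₁ F) (R₂ F) x).Cfg), (bH13 F) x U = letI : Fintype (B9GeoNormsKLevelV1.geo9K x.toKIdx).Site := (inferInstance : Fintype (geo9Y x).Site); bHZPG (κ := TrIdx 2) x.toKIdx (trBasis 2) (taxiS x.toKIdx (bg9YR (Matrix (Fin 2) (Fin 2) ℂ) (specialUnitaryUnits (Fin 2)) (R₁ F) (R₂ F) x) (fun U => U) U) (R := (1 : ℝ)) (H := (H F) x) (w13 F) (hw13₀ F) (hw13₁ F)) (hbXH : ∀ F : T4Family, ∀ (x : MemberY (stage3OfFamily F).d₆ (stage3OfFamily F).ℓ₆ (stage3OfFamily F).hd' (stage3OfFamily F).hL' (stage3OfFamily F).b₀ (stage3OfFamily F).b₁ (Mstar F)) (U : (bg9YR (Matrix (Fin 2) (Fin 2) ℂ) (specialUnitaryUnits (Fin 2)) (R₁ F) (R₂ F) x).Cfg), (bXH F) x U = letI : Fintype (B9GeoNormsKLevelV1.geo9K x.toKIdx).Site := (inferInstance : Fintype (geo9Y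 x).Site); bHZKPG (κ := TrIdx 2) x.toKIdx (trBasis 2) (taxiB x.toKIdx (bg9YR (Matrix (Fin 2) (Fin 2) ℂ) (specialUnitaryUnits (Fin 2)) (R₁ F) (R₂ F) x) (fun U => U) U) (R := (1 : ℝ)) (H := (H F) x) (wX F) (hwX₀ F) (hwX₁ F)) (hρ13 : ∀ F : T4Family, 0 < (ρ13 F)) (hρ13ρ : ∀ F : T4Family, (ρ13 F) + 5 * (σ12 F) ≤ (ρ12 F)) (hσρ13 : ∀ F : T4Family, 3 * (σ12 F) < (1 - (α12 F)) * (ρ13 F)) (B13₄ : ∀ F : T4Family, ℝ) (Bx13 : ∀ F : T4Family, ℝ → ℝ) (hB13₄ : ∀ F : T4Family, 0 ≤ (B13₄ F)) (hBx13 : ∀ F : T4Family, ∀ β, 0 ≤ β → β < 1 → 0 ≤ (Bx13 F) β) (tJ δB rT : ∀ F : T4Family, ℝ) (ha1J : ∀ F : T4Family, 10 * (((stage3OfFamily F).ℓ₆ + 1 : ℕ) : ℝ) ^ 7 * (a12 F) ≤ 1) (htJ : ∀ F : T4Family, 2 * (((stage3OfFamily F).d₆ : ℝ) + 1) * ((((stage3OfFamily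 F).ℓ₆ + 1 : ℕ) : ℝ)) ^ 3 * (2 : ℝ) * (10 ^ 4 * (((stage3OfFamily F).d₆ : ℝ) + 1) * (10 * (((stage3OfFamily F).ℓ₆ + 1 : ℕ) : ℝ) ^ 7)) * Real.exp (3 * (δB F)) ≤ (tJ F)) (hrTP : ∀ F : T4Family, (rT F) ≤ min ((1 - 2 * (p F).α) * (p F).δ₀) (δ39 F) / 8) (hrTB : ∀ F : T4Family, (rT F) ≤ (δB F)) (hδT12 : ∀ F : T4Family, 0 ≤ (δT12 F)) (hδTr : ∀ F : T4Family, (δT12 F) + 3 * (σS F) + 3 * ((q F).αF * ((1 - 2 * (q F).α) * (q F).δ₀)) ≤ (rT F)) (ϑF : ∀ F : T4Family, ℝ)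
    (hϑF : ∀ F : T4Family, 2 * (10 * ((((stage3OfFamily F).ℓ₆ + 1 : ℕ) : ℝ)) * (a12 F)) * (1 + 10 * ((((stage3OfFamily F).ℓ₆ + 1 : ℕ) : ℝ)) * (a12 F)) * Real.exp (4 * (10 * ((((stage3OfFamily F).ℓ₆ + 1 : ℕ) : ℝ)) * (a12 F))) * ((((stage3OfFamily F).ℓ₆ + 1 : ℕ) : ℝ)) ≤ (ϑF F)) (sch : ∀ F : T4Family, ℝ → ℝ) (hsch0 : ∀ F : T4Family, ∀ β', 0 ≤ β' → β' < 1 → 0 < (sch F) β') (hsch1 : ∀ F : T4Family, ∀ β', 0 ≤ β' → β' < 1 → (sch F) β' < 1) (hschβ : ∀ F : T4Family, ∀ β', 0 ≤ β' → β' < 1 → β' < (sch F) β') (hwsch : ∀ F : T4Family, ∀ β', 0 ≤ β' → β' < 1 → 0 < (w13 F) ((sch F) β')) (δ45 : ∀ F : T4Family, ℝ) (hδ45 : ∀ F : T4Family, (δ12₃ F) < (δ45 F)) (BZ : ∀ F : T4Family, ℝ → ℝ) (hBZ : ∀ F : T4Family, ∀ β', 0 ≤ β' → β' < 1 → 0 ≤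 (BZ F) β') (hBZge : ∀ F : T4Family, ∀ β', 0 ≤ β' → β' < 1 → ((((stage3OfFamily F).ℓ₆ + 1 : ℕ) : ℝ)) * inputConst45 (exp261 (@geo9Y (stage3OfFamily F).d₆ (stage3OfFamily F).ℓ₆ (stage3OfFamily F).hd' (stage3OfFamily F).hL' (stage3OfFamily F).b₀ (stage3OfFamily F).b₁ (Mstar F)) (q F).δ₀ (q F).α) (q F).δ₀ (q F).α (q F).NI (q F).NF ((((stage3OfFamily F).ℓ₆ + 1 : ℕ) : ℝ)) (holderConst (exp261 (@geo9Y (stage3OfFamily F).d₆ (stage3OfFamily F).ℓ₆ (stage3OfFamily F).hd' (stage3OfFamily F).hL' (stage3OfFamily F).b₀ (stage3OfFamily F).b₁ (Mstar F)) (q F).δ₀ (q F).α) (q F).δ₀ (q F).α (q F).NH (q F).NF (const37 (exp261 (@geo9Y (stage3OfFamily F).d₆ (stage3OfFamily F).ℓ₆ (stage3OfFamily F).hd' (stage3OfFamily F).hL' (stage3OfFamily F).b₀ (stage3OfFamily F).b₁ (Mstar F)) (q F).δ₀ (q F).α) (q F).δ₀ (q F).α (q F).ρ (q F).B₀ (q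 F).Nc (q F).N' (q F).Cℓ (q F).Kc) ((q F).Bl β') ((q F).Bt β')) ((q F).BI2 ((sch F) β' - β') β') ((q F).θI ((sch F) β')) ≤ (BZ F) β') (hδ45le : ∀ F : T4Family, (δ45 F) ≤ ((1 - (q F).αF) * ((1 - 2 * (q F).α) * (q F).δ₀) - (q F).α * (q F).δ₀)) (δ₂ : ∀ F : T4Family, ℝ) (hrT4 : ∀ F : T4Family, (rT F) ≤ (δ46K F)) (hrT2 : ∀ F : T4Family, (rT F) ≤ (δ₂ F)) (hδ₃T : ∀ F : T4Family, (δ12₃ F) ≤ (1 - 2 * (q F).αF) * (rT F) - (σS F)) (hδ12₃F : ∀ F : T4Family, (δ12₃ F) ≤ (1 - 2 * (p F).αF) * ((1 - 2 * (p F).α) * (p F).δ₀)) (δ45Y : ∀ F : T4Family, ℝ) (hδ45Y : ∀ F : T4Family, (δ12₃ F) < (δ45Y F)) (BiY : ∀ F : T4Family, ℝ → ℝ) (hBiY : ∀ F : T4Family, ∀ β', 0 ≤ β' → β' < 1 → 0 ≤ (BiY F) β') (αW σW δFW : ∀ F : T4Family, ℝ) (hαW0 : ∀ F : T4Family, 0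 < (αW F)) (hαW1 : ∀ F : T4Family, (αW F) < 1) (hσW : ∀ F : T4Family, 0 < (σW F)) (hδFW : ∀ F : T4Family, 0 < (δFW F)) (hδFP : ∀ F : T4Family, (δFW F) ≤ min ((1 - 2 * (p F).α) * (p F).δ₀) (δ39 F) / 8) (hbudW : ∀ F : T4Family, 0 ≤ (δFW F) - (αW F) * (δFW F) - 2 * (σW F)) (hδ3W : ∀ F : T4Family, (δ12₃ F) ≤ (δFW F) - (αW F) * (δFW F) - 2 * (σW F)) (hwschX : ∀ F : T4Family, ∀ β', 0 ≤ β' → β' < 1 → 0 < (wX F) ((sch F) β')) (δ45W : ∀ F : T4Family, ℝ) (hδ45W : ∀ F : T4Family, (δFW F) - (αW F) * (δFW F) - 2 * (σW F) ≤ (δ45W F)) (B45W : ∀ F : T4Family, ℝ → ℝ) (hB45W : ∀ F : T4Family, ∀ β', 0 ≤ β' → β' < 1 → 0 ≤ (B45W F) β') (δhW : ∀ F : T4Family, ℝ) (hδhW : ∀ F : T4Family, (δFW F) - (αW F) * (δFW F) - (σW F) ≤ (δhW F)) (BhW : ∀ F : T4Family, ℝ → ℝ) (hBhW : ∀ F :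 T4Family, ∀ β', 0 ≤ β' → β' < 1 → 0 ≤ (BhW F) β')
    (hB45Wge : ∀ F : T4Family, ∀ β', 0 ≤ β' → β' < 1 → let Cσ : ℝ := (((((stage3OfFamily F).ℓ₆ + 1 : ℕ) : ℝ)) * (((((stage3OfFamily F).ℓ₆ + 1 : ℕ) : ℝ)) ^ 3 * (2 + 2 * coordBound39 (trBasis 2) * basisBound39 (trBasis 2) * ((((stage3OfFamily F).ℓ₆ + 1 : ℕ) : ℝ)) ^ 2)) * Real.exp ((1 - (p F).αF) * ((1 - 2 * (p F).α) * (p F).δ₀) * (2 * (rNear (stage3OfFamily F).d₆ (stage3OfFamily F).ℓ₆ + 1) + ((((stage3OfFamily F).d₆ : ℝ) + 1) * ((((stage3OfFamily F).ℓ₆ : ℝ) + 1) + 1) + 2)))); let X44 : ℝ := (((((stage3OfFamily F).ℓ₆ + 1 : ℕ) : ℝ)) * ((1 + CLip (stage3OfFamily F).d₆ (stage3OfFamily F).ℓ₆) * inputConst44 (exp261 (@geo9Y (stage3OfFamily F).d₆ (stage3OfFamily F).ℓ₆ (stage3OfFamily F).hd' (stage3OfFamily F).hL' (stage3OfFamily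 F).b₀ (stage3OfFamily F).b₁ (Mstar F)) (p F).δ₀ (p F).α) (p F).δ₀ (p F).α (p F).NI (p F).N' ((p F).C (exp261 (@geo9Y (stage3OfFamily F).d₆ (stage3OfFamily F).ℓ₆ (stage3OfFamily F).hd' (stage3OfFamily F).hL' (stage3OfFamily F).b₀ (stage3OfFamily F).b₁ (Mstar F)) (p F).δ₀ (p F).α)) ((((stage3OfFamily F).ℓ₆ + 1 : ℕ) : ℝ)) ((p F).BI ((sch F) β')) ((p F).θI ((sch F) β')) * Cσ * B6.c1 (exp261 (@geo9Y (stage3OfFamily F).d₆ (stage3OfFamily F).ℓ₆ (stage3OfFamily F).hd' (stage3OfFamily F).hL' (stage3OfFamily F).b₀ (stage3OfFamily F).b₁ (Mstar F)) (p F).δ₀ (p F).α) (p F).δ₀ (p F).α)); ((((stage3OfFamily F).d₆ + 1 : ℕ) : ℝ)) * (((((((stage3OfFamily F).ℓ₆ + 1 : ℕ) : ℝ)) * ((1 + CLip (stage3OfFamily F).d₆ (stage3OfFamily F).ℓ₆) * inputConst45 (exp261 (@geo9Y (stage3OfFamily F).d₆ (stage3OfFamily F).ℓ₆ (stage3OfFamily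 F).hd' (stage3OfFamily F).hL' (stage3OfFamily F).b₀ (stage3OfFamily F).b₁ (Mstar F)) (p F).δ₀ (p F).α) (p F).δ₀ (p F).α (p F).NI (p F).N' ((((stage3OfFamily F).ℓ₆ + 1 : ℕ) : ℝ)) (holderConst (exp261 (@geo9Y (stage3OfFamily F).d₆ (stage3OfFamily F).ℓ₆ (stage3OfFamily F).hd' (stage3OfFamily F).hL' (stage3OfFamily F).b₀ (stage3OfFamily F).b₁ (Mstar F)) (p F).δ₀ (p F).α) (p F).δ₀ (p F).α (p F).NH (p F).N' ((p F).C (exp261 (@geo9Y (stage3OfFamily F).d₆ (stage3OfFamily F).ℓ₆ (stage3OfFamily F).hd' (stage3OfFamily F).hL' (stage3OfFamily F).b₀ (stage3OfFamily F).b₁ (Mstar F)) (p F).δ₀ (p F).α)) ((p F).Bl β') ((p F).Bt β')) ((p F).BI2 ((sch F) β' - β') β') ((p F).θI ((sch F) β')) * Cσ * B6.c1 (exp261 (@geo9Y (stage3OfFamily F).d₆ (stage3OfFamily F).ℓ₆ (stage3OfFamily F).hd' (stage3OfFamily F).hL' (stage3OfFamily F).b₀ (stage3OfFamily F).b₁ (Mstar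 F)) (p F).δ₀ (p F).α) (p F).δ₀ (p F).α)) + 2 * coordBound39 (trBasis 2) * basisBound39 (trBasis 2) * (((stage3OfFamily F).ℓ₆ : ℝ) + 1) * Real.exp (((1 - (p F).αF) * ((1 - 2 * (p F).α) * (p F).δ₀) - 3 * ((p F).α * (p F).δ₀)) * ((((stage3OfFamily F).d₆ : ℝ) + 1) * ((((stage3OfFamily F).ℓ₆ : ℝ) + 1) + 1) + 2)) * (((((stage3OfFamily F).d₆ + 1 : ℕ) : ℝ)) ^ 2 * (2 * (10 * ((((stage3OfFamily F).ℓ₆ + 1 : ℕ) : ℝ)) * ((p F).a₁ / (c F))) * (1 + 10 * ((((stage3OfFamily F).ℓ₆ + 1 : ℕ) : ℝ)) * ((p F).a₁ / (c F))) * Real.exp (4 * (10 * ((((stage3OfFamily F).ℓ₆ + 1 : ℕ) : ℝ)) * ((p F).a₁ / (c F))))) * ((((stage3OfFamily F).ℓ₆ + 1 : ℕ) : ℝ)) ^ 6) * X44 + coordBound39 (trBasis 2) * basisBound39 (trBasis 2) * X44 + X44) + X44 + coordBound39 (trBasis 2) * basisBound39 (trBasis 2) * X44) ≤ (B45W F)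 β') (hδ45Wle : ∀ F : T4Family, (δ45W F) ≤ ((1 - (p F).αF) * ((1 - 2 * (p F).α) * (p F).δ₀) - 3 * ((p F).α * (p F).δ₀)))
    (hBhWge : ∀ F : T4Family, ∀ β', 0 ≤ β' → β' < 1 → ((B9RWSums343Holder.holderConst (B9RWSums347DefiniteFaces.exp261 (@geo9Y (stage3OfFamily F).d₆ (stage3OfFamily F).ℓ₆ (stage3OfFamily F).hd' (stage3OfFamily F).hL' (stage3OfFamily F).b₀ (stage3OfFamily F).b₁ (Mstar F)) (p F).δ₀ (p F).α) (p F).δ₀ (p F).α (p F).NH (p F).N' ((p F).C (B9RWSums347DefiniteFaces.exp261 (@geo9Y (stage3OfFamily F).d₆ (stage3OfFamily F).ℓ₆ (stage3OfFamily F).hd' (stage3OfFamily F).hL' (stage3OfFamily F).b₀ (stage3OfFamily F).b₁ (Mstar F)) (p F).δ₀ (p F).α)) ((p F).Bl β') ((p F).Bt β') + 2 * B9Thm39ReadingCoords.coordBound39 (trBasis 2) * B9Thm39ReadingCoords.basisBound39 (trBasis 2) * (((stage3OfFamily F).ℓ₆ : ℝ) + 1) * Real.exp (((1 - 2 * (p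 F).α) * (p F).δ₀) * ((((stage3OfFamily F).d₆ : ℝ) + 1) * ((((stage3OfFamily F).ℓ₆ : ℝ) + 1) + 1) + 2)) * (((((stage3OfFamily F).d₆ + 1 : ℕ) : ℝ)) ^ 2 * (2 * (10 * (((stage3OfFamily F).ℓ₆ + 1 : ℕ) : ℝ) * ((p F).a₁ / (c F))) * (1 + 10 * (((stage3OfFamily F).ℓ₆ + 1 : ℕ) : ℝ) * ((p F).a₁ / (c F))) * Real.exp (4 * (10 * (((stage3OfFamily F).ℓ₆ + 1 : ℕ) : ℝ) * ((p F).a₁ / (c F))))) * (((stage3OfFamily F).ℓ₆ + 1 : ℕ) : ℝ) ^ 6) * ((p F).C (B9RWSums347DefiniteFaces.exp261 (@geo9Y (stage3OfFamily F).d₆ (stage3OfFamily F).ℓ₆ (stage3OfFamily F).hd' (stage3OfFamily F).hL' (stage3OfFamily F).b₀ (stage3OfFamily F).b₁ (Mstar F)) (p F).δ₀ (p F).α)) + B9Thm39ReadingCoords.coordBound39 (trBasis 2) * B9Thm39ReadingCoords.basisBound39 (trBasis 2) * ((p F).C (B9RWSums347DefiniteFaces.exp261 (@geo9Y (stage3OfFamily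 F).d₆ (stage3OfFamily F).ℓ₆ (stage3OfFamily F).hd' (stage3OfFamily F).hL' (stage3OfFamily F).b₀ (stage3OfFamily F).b₁ (Mstar F)) (p F).δ₀ (p F).α)) + ((p F).C (B9RWSums347DefiniteFaces.exp261 (@geo9Y (stage3OfFamily F).d₆ (stage3OfFamily F).ℓ₆ (stage3OfFamily F).hd' (stage3OfFamily F).hL' (stage3OfFamily F).b₀ (stage3OfFamily F).b₁ (Mstar F)) (p F).δ₀ (p F).α))) + ((p F).C (B9RWSums347DefiniteFaces.exp261 (@geo9Y (stage3OfFamily F).d₆ (stage3OfFamily F).ℓ₆ (stage3OfFamily F).hd' (stage3OfFamily F).hL' (stage3OfFamily F).b₀ (stage3OfFamily F).b₁ (Mstar F)) (p F).δ₀ (p F).α)) + B9Thm39ReadingCoords.coordBound39 (trBasis 2) * B9Thm39ReadingCoords.basisBound39 (trBasis 2) * ((p F).C (B9RWSums347DefiniteFaces.exp261 (@geo9Y (stage3OfFamily F).d₆ (stage3OfFamily F).ℓ₆ (stage3OfFamily F).hd' (stage3OfFamily F).hL' (stage3OfFamily F).b₀ (stage3OfFamily F).b₁ (Mstar F)) (p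 F).δ₀ (p F).α))) ≤ (BhW F) β') (hδhWle : ∀ F : T4Family, (δhW F) ≤ ((1 - 2 * (p F).α) * (p F).δ₀)) (CP : ∀ F : T4Family, ℝ)
    (hCPge : ∀ F : T4Family, (((stage3OfFamily F).d₆ + 1 : ℕ) : ℝ) * (coordBound39 (trBasis 2) * basisBound39 (trBasis 2) * nearBlkCntY (stage3OfFamily F).d₆ (stage3OfFamily F).ℓ₆ (stage3OfFamily F).hd' (stage3OfFamily F).hL' (stage3OfFamily F).b₀ (stage3OfFamily F).b₁ (Mstar F) * ((max 1 (2 : ℝ) * ((nbrCountY (stage3OfFamily F).d₆ (stage3OfFamily F).ℓ₆ (stage3OfFamily F).hd' (stage3OfFamily F).hL' (stage3OfFamily F).b₀ (stage3OfFamily F).b₁ 2 : ℝ) * (p F).C (B9RWSums347DefiniteFaces.exp261 (@geo9Y (stage3OfFamily F).d₆ (stage3OfFamily F).ℓ₆ (stage3OfFamily F).hd' (stage3OfFamily F).hL' (stage3OfFamily F).b₀ (stage3OfFamily F).b₁ (Mstar F)) (p F).δ₀ (p F).α) * Real.exp (2 * ((1 - 2 * (p F).α) * (p F).δ₀)))) *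 (cR39 (basis39 (Matrix (Fin 2) (Fin 2) ℂ)) * Fintype.card (κ39 (Matrix (Fin 2) (Fin 2) ℂ)) * (B39 F) * Real.exp (2 * (δ39 F))) * (max 1 (2 : ℝ) * ((nbrCountY (stage3OfFamily F).d₆ (stage3OfFamily F).ℓ₆ (stage3OfFamily F).hd' (stage3OfFamily F).hL' (stage3OfFamily F).b₀ (stage3OfFamily F).b₁ 2 : ℝ) * (p F).C (B9RWSums347DefiniteFaces.exp261 (@geo9Y (stage3OfFamily F).d₆ (stage3OfFamily F).ℓ₆ (stage3OfFamily F).hd' (stage3OfFamily F).hL' (stage3OfFamily F).b₀ (stage3OfFamily F).b₁ (Mstar F)) (p F).δ₀ (p F).α) * Real.exp (2 * ((1 - 2 * (p F).α) * (p F).δ₀)))) * cg349 (stage3OfFamily F).d₆ (stage3OfFamily F).ℓ₆ (stage3OfFamily F).hd' (stage3OfFamily F).hL' (stage3OfFamily F).b₀ (stage3OfFamily F).b₁ ((1 - 2 * (p F).α) * (p F).δ₀) (δ39 F)) * Real.exp (2 * (min ((1 - 2 * (p F).α) * (p F).δ₀) (δ39 F) / 8))) ≤ (CP F)) (hBxW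 : ∀ F : T4Family, ∀ β', 0 ≤ β' → β' < 1 → (cR39 (trBasis 2))⁻¹ * (((wX F) ((sch F) β'))⁻¹ * (B45W F) β' + (BhW F) β' * ((CP F) * ((((stage3OfFamily F).ℓ₆ + 1 : ℕ) : ℝ))) * (((wX F) ((sch F) β'))⁻¹ * (((((stage3OfFamily F).ℓ₆ + 1 : ℕ) : ℝ)) * Real.exp (((δFW F) - (αW F) * (δFW F) - (σW F)) * (rNear (stage3OfFamily F).d₆ (stage3OfFamily F).ℓ₆ + 1)))) * rowConst261 (@geo9Y (stage3OfFamily F).d₆ (stage3OfFamily F).ℓ₆ (stage3OfFamily F).hd' (stage3OfFamily F).hL' (stage3OfFamily F).b₀ (stage3OfFamily F).b₁ (Mstar F)) (σW F) * rowConst261 (@geo9Y (stage3OfFamily F).d₆ (stage3OfFamily F).ℓ₆ (stage3OfFamily F).hd' (stage3OfFamily F).hL' (stage3OfFamily F).b₀ (stage3OfFamily F).b₁ (Mstar F)) (σW F)) ≤ (Bx13 F) β') (hBiYge : ∀ F : T4Family, ∀ β', 0 ≤ β' → β' < 1 → ((((stage3OfFamily F).ℓ₆ + 1 : ℕ) :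 ℝ)) * inputConst45 (exp261 (@geo9Y (stage3OfFamily F).d₆ (stage3OfFamily F).ℓ₆ (stage3OfFamily F).hd' (stage3OfFamily F).hL' (stage3OfFamily F).b₀ (stage3OfFamily F).b₁ (Mstar F)) (q F).δ₀ (q F).α) (q F).δ₀ (q F).α (q F).NI (q F).NF ((((stage3OfFamily F).ℓ₆ + 1 : ℕ) : ℝ)) (holderConst (exp261 (@geo9Y (stage3OfFamily F).d₆ (stage3OfFamily F).ℓ₆ (stage3OfFamily F).hd' (stage3OfFamily F).hL' (stage3OfFamily F).b₀ (stage3OfFamily F).b₁ (Mstar F)) (q F).δ₀ (q F).α) (q F).δ₀ (q F).α (q F).NH (q F).NF (const37 (exp261 (@geo9Y (stage3OfFamily F).d₆ (stage3OfFamily F).ℓ₆ (stage3OfFamily F).hd' (stage3OfFamily F).hL' (stage3OfFamily F).b₀ (stage3OfFamily F).b₁ (Mstar F)) (q F).δ₀ (q F).α) (q F).δ₀ (q F).α (q F).ρ (q F).B₀ (q F).Nc (q F).N' (q F).Cℓ (q F).Kc) ((q F).Bl β') ((q F).Bt β')) ((q F).BI2 ((sch F) β' - β') β') ((q F).θI ((sch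 F) β')) ≤ (BiY F) β') (hδ45Yle : ∀ F : T4Family, (δ45Y F) ≤ ((1 - (q F).αF) * ((1 - 2 * (q F).α) * (q F).δ₀) - (q F).α * (q F).δ₀)) (s44 : ∀ F : T4Family, ℝ) (hs440 : ∀ F : T4Family, 0 < (s44 F))
    (hs441 : ∀ F : T4Family, (s44 F) < 1) (hws44 : ∀ F : T4Family, 0 < (w13 F) (s44 F)) (δ44 : ∀ F : T4Family, ℝ) (hδ44 : ∀ F : T4Family, (δ12₃ F) < (δ44 F)) (Bi44 : ∀ F : T4Family, ℝ) (hBi44 : ∀ F : T4Family, 0 ≤ (Bi44 F)) (hB12₃d : ∀ F : T4Family, (((stage3OfFamily F).d₆ : ℝ) + 1) * ((1 + CLip (stage3OfFamily F).d₆ (stage3OfFamily F).ℓ₆) * (Bi44 F) * (CJG (stage3OfFamily F).d₆ (stage3OfFamily F).ℓ₆ (trBasis 2) (s44 F) (thetaL (stage3OfFamily F).d₆ (stage3OfFamily F).ℓ₆ (ϑF F)) ((w13 F) (s44 F)) ((δ12₃ F) + 1 + 1 / 2 * ((δ44 F) - (δ12₃ F))) * ((((stage3OfFamily F).ℓ₆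 + 1 : ℕ) : ℝ))) * rowConst261 (@geo9Y (stage3OfFamily F).d₆ (stage3OfFamily F).ℓ₆ (stage3OfFamily F).hd' (stage3OfFamily F).hL' (stage3OfFamily F).b₀ (stage3OfFamily F).b₁ (Mstar F)) 1) ≤ (B12₃ F)) (hB12₃p : ∀ F : T4Family, (((stage3OfFamily F).d₆ : ℝ) + 1) * (1 * ((((stage3OfFamily F).d₆ : ℝ) + 1) * ((1 + CLip (stage3OfFamily F).d₆ (stage3OfFamily F).ℓ₆) * (Bi44 F) * (CJG (stage3OfFamily F).d₆ (stage3OfFamily F).ℓ₆ (trBasis 2) (s44 F) (thetaL (stage3OfFamily F).d₆ (stage3OfFamily F).ℓ₆ (ϑF F)) ((w13 F) (s44 F)) ((δ12₃ F) + 1 + 1 / 2 * ((δ44 F) - (δ12₃ F))) * ((((stage3OfFamily F).ℓ₆ + 1 : ℕ) : ℝ))) * rowConst261 (@geo9Y (stage3OfFamily F).d₆ (stage3OfFamily F).ℓ₆ (stage3OfFamily F).hd' (stage3OfFamily F).hL' (stage3OfFamily F).b₀ (stage3OfFamily F).b₁ (Mstar F)) 1)) * rowConst261 (@geo9Y (stage3OfFamily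 F).d₆ (stage3OfFamily F).ℓ₆ (stage3OfFamily F).hd' (stage3OfFamily F).hL' (stage3OfFamily F).b₀ (stage3OfFamily F).b₁ (Mstar F)) 1) ≤ (B12₃ F)) (hBi44ge : ∀ F : T4Family, ((((stage3OfFamily F).ℓ₆ + 1 : ℕ) : ℝ)) * inputConst44 (exp261 (@geo9Y (stage3OfFamily F).d₆ (stage3OfFamily F).ℓ₆ (stage3OfFamily F).hd' (stage3OfFamily F).hL' (stage3OfFamily F).b₀ (stage3OfFamily F).b₁ (Mstar F)) (q F).δ₀ (q F).α) (q F).δ₀ (q F).α (q F).NI (q F).NF (const37 (exp261 (@geo9Y (stage3OfFamily F).d₆ (stage3OfFamily F).ℓ₆ (stage3OfFamily F).hd' (stage3OfFamily F).hL' (stage3OfFamily F).b₀ (stage3OfFamily F).b₁ (Mstar F)) (q F).δ₀ (q F).α) (q F).δ₀ (q F).α (q F).ρ (q F).B₀ (q F).Nc (q F).N' (q F).Cℓ (q F).Kc) ((((stage3OfFamily F).ℓ₆ + 1 : ℕ) : ℝ)) ((q F).BI (s44 F)) ((q F).θI (s44 F)) ≤ (Bi44 F)) (hδ44le : ∀ F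 : T4Family, (δ44 F) ≤ ((1 - (q F).αF) * ((1 - 2 * (q F).α) * (q F).δ₀) - (q F).α * (q F).δ₀)) (hwX44 : ∀ F : T4Family, 0 < (wX F) (s44 F)) (B44G δ44G : ∀ F : T4Family, ℝ) (hB44G : ∀ F : T4Family, 0 ≤ (B44G F)) (hδ44G : ∀ F : T4Family, (δFW F) - (αW F) * (δFW F) - 2 * (σW F) ≤ (δ44G F))
    (hB44Gge : ∀ F : T4Family, let Cσ : ℝ := (((((stage3OfFamily F).ℓ₆ + 1 : ℕ) : ℝ)) * (((((stage3OfFamily F).ℓ₆ + 1 : ℕ) : ℝ)) ^ 3 * (2 + 2 * coordBound39 (trBasis 2) * basisBound39 (trBasis 2) * ((((stage3OfFamily F).ℓ₆ + 1 : ℕ) : ℝ)) ^ 2)) * Real.exp ((1 - (p F).αF) * ((1 - 2 * (p F).α) * (p F).δ₀) * (2 * (rNear (stage3OfFamily F).d₆ (stage3OfFamily F).ℓ₆ + 1) + ((((stage3OfFamily F).d₆ : ℝ) + 1) * ((((stage3OfFamily F).ℓ₆ : ℝ) + 1) + 1) + 2)))); ((((stage3OfFamily F).ℓ₆ + 1 :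 ℕ) : ℝ)) * (((((stage3OfFamily F).d₆ + 1 : ℕ) : ℝ)) * ((1 + CLip (stage3OfFamily F).d₆ (stage3OfFamily F).ℓ₆) * inputConst44 (exp261 (@geo9Y (stage3OfFamily F).d₆ (stage3OfFamily F).ℓ₆ (stage3OfFamily F).hd' (stage3OfFamily F).hL' (stage3OfFamily F).b₀ (stage3OfFamily F).b₁ (Mstar F)) (p F).δ₀ (p F).α) (p F).δ₀ (p F).α (p F).NI (p F).N' ((p F).C (exp261 (@geo9Y (stage3OfFamily F).d₆ (stage3OfFamily F).ℓ₆ (stage3OfFamily F).hd' (stage3OfFamily F).hL' (stage3OfFamily F).b₀ (stage3OfFamily F).b₁ (Mstar F)) (p F).δ₀ (p F).α)) ((((stage3OfFamily F).ℓ₆ + 1 : ℕ) : ℝ)) ((p F).BI (s44 F)) ((p F).θI (s44 F)) * Cσ * B6.c1 (exp261 (@geo9Y (stage3OfFamily F).d₆ (stage3OfFamily F).ℓ₆ (stage3OfFamily F).hd' (stage3OfFamily F).hL' (stage3OfFamily F).b₀ (stage3OfFamily F).b₁ (Mstar F)) (p F).δ₀ (p F).α) (p F).δ₀ (p F).α))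 ≤ (B44G F)) (hδ44Gle : ∀ F : T4Family, (δ44G F) ≤ ((1 - (p F).αF) * ((1 - 2 * (p F).α) * (p F).δ₀) - 3 * ((p F).α * (p F).δ₀))) (hB₃wG : ∀ F : T4Family, (cR39 (trBasis 2))⁻¹ * (((wX F) (s44 F))⁻¹ * (B44G F) + ((((stage3OfFamily F).d₆ + 1 : ℕ) : ℝ) * (p F).C (B9RWSums347DefiniteFaces.exp261 (@geo9Y (stage3OfFamily F).d₆ (stage3OfFamily F).ℓ₆ (stage3OfFamily F).hd' (stage3OfFamily F).hL' (stage3OfFamily F).b₀ (stage3OfFamily F).b₁ (Mstar F)) (p F).δ₀ (p F).α)) * ((CP F) * ((((stage3OfFamily F).ℓ₆ + 1 : ℕ) : ℝ))) * (((wX F) (s44 F))⁻¹ * (((((stage3OfFamily F).ℓ₆ + 1 : ℕ) : ℝ)) * Real.exp (((δFW F) - (αW F) * (δFW F) - (σW F)) * (rNear (stage3OfFamily F).d₆ (stage3OfFamily F).ℓ₆ + 1)))) * rowConst261 (@geo9Y (stage3OfFamily F).d₆ (stage3OfFamily F).ℓ₆ (stage3OfFamily F).hd' (stage3OfFamily F).hL'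 (stage3OfFamily F).b₀ (stage3OfFamily F).b₁ (Mstar F)) (σW F) * rowConst261 (@geo9Y (stage3OfFamily F).d₆ (stage3OfFamily F).ℓ₆ (stage3OfFamily F).hd' (stage3OfFamily F).hL' (stage3OfFamily F).b₀ (stage3OfFamily F).b₁ (Mstar F)) (σW F)) ≤ (B12₃ F)) (BHG : ∀ F : T4Family, ℝ) (hBHG : ∀ F : T4Family, 0 ≤ (BHG F)) (hwBhG : ∀ F : T4Family, ∀ s, 0 < s → s < 1 → (wX F) s * holderConst (exp261 (@geo9Y (stage3OfFamily F).d₆ (stage3OfFamily F).ℓ₆ (stage3OfFamily F).hd' (stage3OfFamily F).hL' (stage3OfFamily F).b₀ (stage3OfFamily F).b₁ (Mstar F)) (q F).δ₀ (q F).α) (q F).δ₀ (q F).α (q F).NH (q F).NF (const37 (exp261 (@geo9Y (stage3OfFamily F).d₆ (stage3OfFamily F).ℓ₆ (stage3OfFamily F).hd' (stage3OfFamily F).hL' (stage3OfFamily F).b₀ (stage3OfFamily F).b₁ (Mstar F)) (q F).δ₀ (q F).α) (q F).δ₀ (q F).α (q F).ρ (q F).B₀ (q F).Nc (q F).N' (q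 F).Cℓ (q F).Kc) ((q F).Bl s) ((q F).Bt s) ≤ (BHG F)) (B43 δ43 : ∀ F : T4Family, ℝ) (hB43 : ∀ F : T4Family, 0 ≤ (B43 F)) (B₀D : ∀ F : T4Family, ℝ) (hB₀D : ∀ F : T4Family, 0 ≤ (B₀D F))
    (hbudD : ∀ F : T4Family, ∀ s : ℝ, 0 < s → s < 1 → (w13 F) s * (((((stage3OfFamily F).d₆ + 1 : ℕ) : ℝ)) * (B9RWSums343Holder.holderConst (B9RWSums347DefiniteFaces.exp261 (@geo9Y (stage3OfFamily F).d₆ (stage3OfFamily F).ℓ₆ (stage3OfFamily F).hd' (stage3OfFamily F).hL' (stage3OfFamily F).b₀ (stage3OfFamily F).b₁ (Mstar F)) (p F).δ₀ (p F).α) (p F).δ₀ (p F).α (p F).NH (p F).N' ((p F).C (B9RWSums347DefiniteFaces.exp261 (@geo9Y (stage3OfFamily F).d₆ (stage3OfFamily F).ℓ₆ (stage3OfFamily F).hd' (stage3OfFamily F).hL' (stage3OfFamily F).b₀ (stage3OfFamily F).b₁ (Mstar F)) (p F).δ₀ (p F).α)) ((p F).Bl s) ((p F).Bt s) + 2 *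 B9Thm39ReadingCoords.coordBound39 (trBasis 2) * B9Thm39ReadingCoords.basisBound39 (trBasis 2) * (((stage3OfFamily F).ℓ₆ : ℝ) + 1) * Real.exp (((1 - 2 * (p F).α) * (p F).δ₀) * ((((stage3OfFamily F).d₆ : ℝ) + 1) * ((((stage3OfFamily F).ℓ₆ : ℝ) + 1) + 1) + 2)) * (((((stage3OfFamily F).d₆ + 1 : ℕ) : ℝ)) ^ 2 * (2 * (10 * (((stage3OfFamily F).ℓ₆ + 1 : ℕ) : ℝ) * ((p F).a₁ / (c F))) * (1 + 10 * (((stage3OfFamily F).ℓ₆ + 1 : ℕ) : ℝ) * ((p F).a₁ / (c F))) * Real.exp (4 * (10 * (((stage3OfFamily F).ℓ₆ + 1 : ℕ) : ℝ) * ((p F).a₁ / (c F))))) * (((stage3OfFamily F).ℓ₆ + 1 : ℕ) : ℝ) ^ 6) * ((p F).C (B9RWSums347DefiniteFaces.exp261 (@geo9Y (stage3OfFamily F).d₆ (stage3OfFamily F).ℓ₆ (stage3OfFamily F).hd' (stage3OfFamily F).hL' (stage3OfFamily F).b₀ (stage3OfFamily F).b₁ (Mstar F)) (p F).δ₀ (p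 F).α)) + B9Thm39ReadingCoords.coordBound39 (trBasis 2) * B9Thm39ReadingCoords.basisBound39 (trBasis 2) * ((p F).C (B9RWSums347DefiniteFaces.exp261 (@geo9Y (stage3OfFamily F).d₆ (stage3OfFamily F).ℓ₆ (stage3OfFamily F).hd' (stage3OfFamily F).hL' (stage3OfFamily F).b₀ (stage3OfFamily F).b₁ (Mstar F)) (p F).δ₀ (p F).α)) + ((p F).C (B9RWSums347DefiniteFaces.exp261 (@geo9Y (stage3OfFamily F).d₆ (stage3OfFamily F).ℓ₆ (stage3OfFamily F).hd' (stage3OfFamily F).hL' (stage3OfFamily F).b₀ (stage3OfFamily F).b₁ (Mstar F)) (p F).δ₀ (p F).α)))) ≤ (B₀D F)) (hB43ge : ∀ F : T4Family, ((((stage3OfFamily F).ℓ₆ + 1 : ℕ) : ℝ)) * (((((stage3OfFamily F).d₆ + 1 : ℕ) : ℝ)) * ((p F).C (B9RWSums347DefiniteFaces.exp261 (@geo9Y (stage3OfFamily F).d₆ (stage3OfFamily F).ℓ₆ (stage3OfFamily F).hd' (stage3OfFamily F).hL' (stage3OfFamily F).b₀ (stage3OfFamily F).b₁ (Mstar F))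 (p F).δ₀ (p F).α)) + (B₀D F)) * Real.exp (((1 - 2 * (p F).α) * (p F).δ₀) * (rNear (stage3OfFamily F).d₆ (stage3OfFamily F).ℓ₆ + 1)) ≤ (B43 F)) (hδ43le : ∀ F : T4Family, (δ43 F) ≤ ((1 - 2 * (p F).α) * (p F).δ₀)) (ρrg : ∀ F : T4Family, ℝ) (hρrg0 : ∀ F : T4Family, 0 ≤ (ρrg F)) (hbudrg : ∀ F : T4Family, (ρrg F) + (σW F) + (αW F) * (δFW F) ≤ (δFW F)) (hbud43 : ∀ F : T4Family, (ρrg F) + (σW F) ≤ (δ43 F)) (hδ₃rg : ∀ F : T4Family, (δ12₃ F) ≤ (ρrg F))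
    (hB₃rg : ∀ F : T4Family, (B43 F) * (cR39 (trBasis 2))⁻¹ * rowConst261 (@geo9Y (stage3OfFamily F).d₆ (stage3OfFamily F).ℓ₆ (stage3OfFamily F).hd' (stage3OfFamily F).hL' (stage3OfFamily F).b₀ (stage3OfFamily F).b₁ (Mstar F)) (σW F) + CTel (stage3OfFamily F).d₆ (stage3OfFamily F).ℓ₆ (trBasis 2) (ρrg F) ((CP F) * ((((stage3OfFamily F).ℓ₆ + 1 : ℕ) : ℝ)) * (((((stage3OfFamily F).d₆ + 1 : ℕ) : ℝ) * (p F).C (B9RWSums347DefiniteFaces.exp261 (@geo9Y (stage3OfFamily F).d₆ (stage3OfFamily F).ℓ₆ (stage3OfFamily F).hd' (stage3OfFamily F).hL' (stage3OfFamily F).b₀ (stage3OfFamily F).b₁ (Mstar F)) (p F).δ₀ (p F).α)) * (cR39 (trBasis 2))⁻¹ * rowConst261 (@geo9Y (stage3OfFamily F).d₆ (stage3OfFamily F).ℓ₆ (stage3OfFamily F).hd' (stage3OfFamily F).hL' (stage3OfFamily F).b₀ (stage3OfFamily F).b₁ (Mstar F)) (σW F)) * rowConst261 (@geo9Y (stage3OfFamily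 F).d₆ (stage3OfFamily F).ℓ₆ (stage3OfFamily F).hd' (stage3OfFamily F).hL' (stage3OfFamily F).b₀ (stage3OfFamily F).b₁ (Mstar F)) (σW F)) ((CP F) * ((((stage3OfFamily F).ℓ₆ + 1 : ℕ) : ℝ)) * (((((stage3OfFamily F).d₆ + 1 : ℕ) : ℝ) * (p F).C (B9RWSums347DefiniteFaces.exp261 (@geo9Y (stage3OfFamily F).d₆ (stage3OfFamily F).ℓ₆ (stage3OfFamily F).hd' (stage3OfFamily F).hL' (stage3OfFamily F).b₀ (stage3OfFamily F).b₁ (Mstar F)) (p F).δ₀ (p F).α)) * (cR39 (trBasis 2))⁻¹ * rowConst261 (@geo9Y (stage3OfFamily F).d₆ (stage3OfFamily F).ℓ₆ (stage3OfFamily F).hd' (stage3OfFamily F).hL' (stage3OfFamily F).b₀ (stage3OfFamily F).b₁ (Mstar F)) (σW F)) * rowConst261 (@geo9Y (stage3OfFamily F).d₆ (stage3OfFamily F).ℓ₆ (stage3OfFamily F).hd' (stage3OfFamily F).hL' (stage3OfFamily F).b₀ (stage3OfFamily F).b₁ (Mstar F)) (σW F)) ≤ (B12₃ F)) (τS δP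 : ∀ F : T4Family, ℝ) (hτS : ∀ F : T4Family, 0 < (τS F)) (hρP12 : ∀ F : T4Family, (ρ12 F) + 2 * (σ12 F) ≤ (δP F)) (hU8a : ∀ F : T4Family, (δK12 F) + 3 * (σS F) + 4 * (τS F) ≤ (1 - 2 * (p F).α) * (p F).δ₀) (hU8b : ∀ F : T4Family, (δK12 F) + 3 * (σS F) + 4 * (τS F) ≤ min ((1 - 2 * (p F).α) * (p F).δ₀) (δ39 F) / 8) (hU8c : ∀ F : T4Family, (δK12 F) + 3 * (σS F) + 4 * (τS F) ≤ (δ₂ F)) (hU8d : ∀ F : T4Family, (δK12 F) + 3 * (σS F) + 5 * (τS F) ≤ (δ44G F)) (hU8e : ∀ F : T4Family, (δK12 F) + 3 * (σS F) + 4 * (τS F) ≤ (δB F)) (hU8f : ∀ F : T4Family, (δK12 F) + 2 * (σS F) + (τS F) ≤ (δ43 F)) (hU8g : ∀ F : T4Family, (δK12 F) + (τS F) + (σS F) ≤ (δT12 F)) (hU8h : ∀ F : T4Family, (δK12 F) + (τS F) + (σS F) ≤ (δ12₃ F)) (hU8i : ∀ F : T4Family, (δK12 F) + (τS F) + (σS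 F) ≤ (δP F)) (hU8j : ∀ F : T4Family, (δP F) + 2 * (τS F) ≤ (δ12₀ F)) (hU8k : ∀ F : T4Family, (δP F) + (σS F) + 2 * (τS F) ≤ (δ12₃ F)) (τR : ∀ F : T4Family, ℝ) (hτR : ∀ F : T4Family, 0 < (τR F)) (hR8a : ∀ F : T4Family, (δ12₃ F) + 5 * (τR F) + 3 * (σS F) + 4 * (τS F) ≤ (1 - 2 * (p F).α) * (p F).δ₀) (hR8b : ∀ F : T4Family, (δ12₃ F) + 5 * (τR F) + 3 * (σS F) + 4 * (τS F) ≤ min ((1 - 2 * (p F).α) * (p F).δ₀) (δ39 F) / 8) (hR8c : ∀ F : T4Family, (δ12₃ F) + 5 * (τR F) + 3 * (σS F) + 4 * (τS F) ≤ (δ₂ F)) (hR8d : ∀ F : T4Family, (δ12₃ F) + 5 * (τR F) + 3 * (σS F) + 5 * (τS F) ≤ (δ44G F)) (hR8e : ∀ F : T4Family, (δ12₃ F) + 5 * (τR F) + 3 * (σS F) + 4 * (τS F) ≤ (δB F)) (hR8f : ∀ F : T4Family, (δ12₃ F) + 5 * (τR F) + 2 * (σS F) + (τS F) ≤ (δ43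 F)) (hR8g : ∀ F : T4Family, (δ12₃ F) + 5 * (τR F) + (τS F) + (σS F) ≤ (δT12 F)) (hR8h : ∀ F : T4Family, (δ12₃ F) + 5 * (τR F) + 2 * (σS F) + 3 * (τS F) < (δ12₀ F))
    (hR8i : ∀ F : T4Family, (δ12₃ F) + 5 * (τR F) + 2 * (σS F) + 3 * (τS F) < (δ44 F)) (hR8j : ∀ F : T4Family, (δ12₃ F) + 5 * (τR F) + 2 * (σS F) + 3 * (τS F) < (δ45 F)) (hR8k : ∀ F : T4Family, (δ12₃ F) + 5 * (τR F) + 2 * (σS F) + 3 * (τS F) < (δ45Y F)) (hsymDK : ∀ F : T4Family, ∀ x : MemberY (stage3OfFamily F).d₆ (stage3OfFamily F).ℓ₆ (stage3OfFamily F).hd' (stage3OfFamily F).hL' (stage3OfFamily F).b₀ (stage3OfFamily F).b₁ (Mstar F), (M12 F) ≤ (geo9Y x).M → ∀ α₀ : ℝ, 0 < α₀ → (geo9Y x).M * α₀ ≤ (a12 F) → ∀ U : (bg9YR (Matrix (Fin 2) (Fin 2) ℂ) (specialUnitaryUnits (Fin 2)) (R₁ F) (R₂ F) x).Cfg, (bg9YR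 (Matrix (Fin 2) (Fin 2) ℂ) (specialUnitaryUnits (Fin 2)) (R₁ F) (R₂ F) x).Reg335 (c F) α₀ U → IsSymmTr (fun _ => (1 : ℝ)) (((lettersYOfRecordV11K 2 (stage3OfFamily F) (Mstar F) (𝔯 F)) x).GD U) ∧ IsSymmTr (fun _ => (1 : ℝ)) (((lettersYOfRecordV11K 2 (stage3OfFamily F) (Mstar F) (𝔯 F)) x).G₁ U) ∧ IsSymmTr (fun _ => (1 : ℝ)) (((lettersYOfRecordV11K 2 (stage3OfFamily F) (Mstar F) (𝔯 F)) x).GG U)) (hΔ2 : ∀ F : T4Family, ∀ x : MemberY (stage3OfFamily F).d₆ (stage3OfFamily F).ℓ₆ (stage3OfFamily F).hd' (stage3OfFamily F).hL' (stage3OfFamily F).b₀ (stage3OfFamily F).b₁ (Mstar F), (M12 F) ≤ (geo9Y x).M → ∀ α₀ : ℝ, 0 < α₀ → (geo9Y x).M * α₀ ≤ (a12 F) → ∀ U : (bg9YR (Matrix (Fin 2) (Fin 2) ℂ) (specialUnitaryUnits (Fin 2)) (R₁ F) (R₂ F) x).Cfg, (bg9YR (Matrix (Fin 2) (Fin 2)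 ℂ) (specialUnitaryUnits (Fin 2)) (R₁ F) (R₂ F) x).Reg335 (c F) α₀ U → IsSymmTr (fun _ => (1 : ℝ)) (((𝔯 F) x).Δ2 U)) (hsymT : ∀ F : T4Family, ∀ x : MemberY (stage3OfFamily F).d₆ (stage3OfFamily F).ℓ₆ (stage3OfFamily F).hd' (stage3OfFamily F).hL' (stage3OfFamily F).b₀ (stage3OfFamily F).b₁ (Mstar F), (M12 F) ≤ (geo9Y x).M → ∀ α₀ : ℝ, 0 < α₀ → (geo9Y x).M * α₀ ≤ (a12 F) → ∀ U : (bg9YR (Matrix (Fin 2) (Fin 2) ℂ) (specialUnitaryUnits (Fin 2)) (R₁ F) (R₂ F) x).Cfg, (bg9YR (Matrix (Fin 2) (Fin 2) ℂ) (specialUnitaryUnits (Fin 2)) (R₁ F) (R₂ F) x).Reg335 (c F) α₀ U → IsSymmTr (fun _ => (1 : ℝ)) (Node00.GpY x.toKIdx (parKnitY x.toKIdx) U)) (hsymRT : ∀ F : T4Family, ∀ x : MemberY (stage3OfFamily F).d₆ (stage3OfFamily F).ℓ₆ (stage3OfFamily F).hd' (stage3OfFamily F).hL' (stage3OfFamily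 F).b₀ (stage3OfFamily F).b₁ (Mstar F), (M12 F) ≤ (geo9Y x).M → ∀ α₀ : ℝ, 0 < α₀ → (geo9Y x).M * α₀ ≤ (a12 F) → ∀ U : (bg9YR (Matrix (Fin 2) (Fin 2) ℂ) (specialUnitaryUnits (Fin 2)) (R₁ F) (R₂ F) x).Cfg, (bg9YR (Matrix (Fin 2) (Fin 2) ℂ) (specialUnitaryUnits (Fin 2)) (R₁ F) (R₂ F) x).Reg335 (c F) α₀ U → IsSymmTr (fun _ => (1 : ℝ)) (Node00.RY x.toKIdx (parKnitY x.toKIdx) (Node00.GpY x.toKIdx (parKnitY x.toKIdx)) U))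
    (hUQG1K : ∀ F : T4Family, ∀ x : MemberY (stage3OfFamily F).d₆ (stage3OfFamily F).ℓ₆ (stage3OfFamily F).hd' (stage3OfFamily F).hL' (stage3OfFamily F).b₀ (stage3OfFamily F).b₁ (Mstar F), (M12 F) ≤ (geo9Y x).M → ∀ α₀ : ℝ, 0 < α₀ → (geo9Y x).M * α₀ ≤ (a12 F) → ∀ U : (bg9YR (Matrix (Fin 2) (Fin 2) ℂ) (specialUnitaryUnits (Fin 2)) (R₁ F) (R₂ F) x).Cfg, (bg9YR (Matrix (Fin 2) (Fin 2) ℂ) (specialUnitaryUnits (Fin 2)) (R₁ F) (R₂ F) x).Reg335 (c F) α₀ U → (bg9YR (Matrix (Fin 2) (Fin 2) ℂ) (specialUnitaryUnits (Fin 2)) (R₁ F) (R₂ F) x).Reg336 (c F) α₀ U → PosDefTr (fun _ => (1 : ℝ)) (deltaOneQY x.toKIdx (qKnitOfRecord 2 (stage3OfFamily F) x.toKIdx) (qsKnitOfRecord 2 (stage3OfFamily F) x.toKIdx) (parKnitY x.toKIdx) (GpPhysY x.toKIdx (parKnitY x.toKIdx)) (((𝔯 F) x).Δ2) U) → IsUnit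 (Node00.QGQOfQY x.toKIdx (qKnitOfRecord 2 (stage3OfFamily F) x.toKIdx) (qsKnitOfRecord 2 (stage3OfFamily F) x.toKIdx) (G1QY x.toKIdx (qKnitOfRecord 2 (stage3OfFamily F) x.toKIdx) (qsKnitOfRecord 2 (stage3OfFamily F) x.toKIdx) (parKnitY x.toKIdx) (GpPhysY x.toKIdx (parKnitY x.toKIdx)) (((𝔯 F) x).Δ2)) U)) (hidsK : ∀ F : T4Family, ∀ x : MemberY (stage3OfFamily F).d₆ (stage3OfFamily F).ℓ₆ (stage3OfFamily F).hd' (stage3OfFamily F).hL' (stage3OfFamily F).b₀ (stage3OfFamily F).b₁ (Mstar F), (M12 F) ≤ (geo9Y x).M → ∀ α₀ : ℝ, 0 < α₀ → (geo9Y x).M * α₀ ≤ (a12 F) → ∀ U : (bg9YR (Matrix (Fin 2) (Fin 2) ℂ) (specialUnitaryUnits (Fin 2)) (R₁ F) (R₂ F) x).Cfg, (bg9YR (Matrix (Fin 2) (Fin 2) ℂ) (specialUnitaryUnits (Fin 2)) (R₁ F) (R₂ F) x).Reg335 (c F) α₀ U → (bg9YR (Matrix (Fin 2) (Fin 2) ℂ)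 (specialUnitaryUnits (Fin 2)) (R₁ F) (R₂ F) x).Reg336 (c F) α₀ U → IsUnit (deltaOneQY x.toKIdx (qKnitOfRecord 2 (stage3OfFamily F) x.toKIdx) (qsKnitOfRecord 2 (stage3OfFamily F) x.toKIdx) (parKnitY x.toKIdx) (GpPhysY x.toKIdx (parKnitY x.toKIdx)) (((𝔯 F) x).Δ2) U) → Ids3124 ((𝔬12 F) x) U ∧ Ids3152 ((𝔬12 F) x) (fun U => GcoS x.toKIdx (trBasis 2) (bg9YR (Matrix (Fin 2) (Fin 2) ℂ) (specialUnitaryUnits (Fin 2)) (R₁ F) (R₂ F) x) (fun U => U) (GpY x.toKIdx (parKnitY x.toKIdx)) U) U) (BQs δQs : ∀ F : T4Family, ℝ) (hBQs : ∀ F : T4Family, 0 ≤ (BQs F)) (hδQs1 : ∀ F : T4Family, (δ12₀ F) + 1 ≤ (δQs F)) (hδQs2 : ∀ F : T4Family, (δ12₃ F) + (σ12 F) ≤ (δQs F)) (hδQs3 : ∀ F : T4Family, (δ12₃ F) + 1 ≤ (δQs F)) (hqsK : ∀ F : T4Family, ∀ x : MemberY (stage3OfFamily F).d₆ (stage3OfFamily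 F).ℓ₆ (stage3OfFamily F).hd' (stage3OfFamily F).hL' (stage3OfFamily F).b₀ (stage3OfFamily F).b₁ (Mstar F), (M12 F) ≤ (geo9Y x).M → ∀ α₀ : ℝ, 0 < α₀ → (geo9Y x).M * α₀ ≤ (a12 F) → ∀ U : (bg9YR (Matrix (Fin 2) (Fin 2) ℂ) (specialUnitaryUnits (Fin 2)) (R₁ F) (R₂ F) x).Cfg, (bg9YR (Matrix (Fin 2) (Fin 2) ℂ) (specialUnitaryUnits (Fin 2)) (R₁ F) (R₂ F) x).Reg335 (c F) α₀ U → HasMaj (weightNorm (BlockNorm.ofBlocks (toB6 (geo9Y x) 1 ((H F) x)) ((𝔬12 F) x).blkZ) (fun y => (((((stage3OfFamily F).ℓ₆ + 1 : ℕ) : ℝ) ^ ((stage3OfFamily F).d₆ + 1)) ^ lvl x.hN x.D x.hk y)⁻¹) (fun y => (plateau_pos x.toKIdx y).le)) (cNorm 1 ((H F) x) ((𝔬12 F) x).blk (fun y => (geo9Y_len_pos x y).le) 0) (((𝔬12 F) x).Qstar U) (fun a a' => (BQs F) * Real.exp (-((δQs F) * (geo9Y x).dist a a')))) (BQL : ∀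 F : T4Family, ℝ) (hBQL : ∀ F : T4Family, 0 ≤ (BQL F))
    (hqsL2K : ∀ F : T4Family, ∀ x : MemberY (stage3OfFamily F).d₆ (stage3OfFamily F).ℓ₆ (stage3OfFamily F).hd' (stage3OfFamily F).hL' (stage3OfFamily F).b₀ (stage3OfFamily F).b₁ (Mstar F), (M12 F) ≤ (geo9Y x).M → ∀ α₀ : ℝ, 0 < α₀ → (geo9Y x).M * α₀ ≤ (a12 F) → ∀ U : (bg9YR (Matrix (Fin 2) (Fin 2) ℂ) (specialUnitaryUnits (Fin 2)) (R₁ F) (R₂ F) x).Cfg, (bg9YR (Matrix (Fin 2) (Fin 2) ℂ) (specialUnitaryUnits (Fin 2)) (R₁ F) (R₂ F) x).Reg335 (c F) α₀ U → B9SectDL2Decay.BlockBd (g := toB6 (geo9Y x) 1 ((H F) x)) ((𝔬12 F) x).blkZ ((𝔬12 F) x).blk (((𝔬12 F) x).Qstar U) (fun (y y' : (geo9Y x).Site) => (BQL F) * ((geo9Y x).len y)⁻¹ * (Real.sqrt ((((((stage3OfFamily F).ℓ₆ + 1 : ℕ) : ℝ) ^ ((stage3OfFamily F).d₆ + 1))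 ^ lvl x.hN x.D x.hk y')⁻¹) * (geo9Y x).len y') * Real.exp (-((δQs F) * (geo9Y x).dist y y')))) (hqL2K : ∀ F : T4Family, ∀ x : MemberY (stage3OfFamily F).d₆ (stage3OfFamily F).ℓ₆ (stage3OfFamily F).hd' (stage3OfFamily F).hL' (stage3OfFamily F).b₀ (stage3OfFamily F).b₁ (Mstar F), (M12 F) ≤ (geo9Y x).M → ∀ α₀ : ℝ, 0 < α₀ → (geo9Y x).M * α₀ ≤ (a12 F) → ∀ U : (bg9YR (Matrix (Fin 2) (Fin 2) ℂ) (specialUnitaryUnits (Fin 2)) (R₁ F) (R₂ F) x).Cfg, (bg9YR (Matrix (Fin 2) (Fin 2) ℂ) (specialUnitaryUnits (Fin 2)) (R₁ F) (R₂ F) x).Reg335 (c F) α₀ U → B9SectDL2Decay.BlockBd (g := toB6 (geo9Y x) 1 ((H F) x)) ((𝔬12 F) x).blk ((𝔬12 F) x).blkZ (((𝔬12 F) x).Q U) (fun (y y' : (geo9Y x).Site) => (BQL F) * (Real.sqrt ((((((stage3OfFamily F).ℓ₆ + 1 : ℕ) : ℝ) ^ ((stage3OfFamily F).d₆ + 1))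 ^ lvl x.hN x.D x.hk y)⁻¹) * (geo9Y x).len y * ((geo9Y x).len y')⁻¹) * Real.exp (-((δQs F) * (geo9Y x).dist y y')))) (BQp : ∀ F : T4Family, ℝ) (hBQp : ∀ F : T4Family, 0 ≤ (BQp F)) (hqK : ∀ F : T4Family, ∀ x : MemberY (stage3OfFamily F).d₆ (stage3OfFamily F).ℓ₆ (stage3OfFamily F).hd' (stage3OfFamily F).hL' (stage3OfFamily F).b₀ (stage3OfFamily F).b₁ (Mstar F), (M12 F) ≤ (geo9Y x).M → ∀ α₀ : ℝ, 0 < α₀ → (geo9Y x).M * α₀ ≤ (a12 F) → ∀ U : (bg9YR (Matrix (Fin 2) (Fin 2) ℂ) (specialUnitaryUnits (Fin 2)) (R₁ F) (R₂ F) x).Cfg, (bg9YR (Matrix (Fin 2) (Fin 2) ℂ) (specialUnitaryUnits (Fin 2)) (R₁ F) (R₂ F) x).Reg335 (c F) α₀ U → ∀ p' : ℕ, p' ≤ 2 → HasMaj (cNorm 1 ((H F) x) ((𝔬12 F) x).blk (fun y => (geo9Y_len_pos x y).le) p') (cNorm 1 ((H F) x) ((𝔬12 F) x).blkZ (fun y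 => (geo9Y_len_pos x y).le) p') (((𝔬12 F) x).Q U) (fun a a' => (BQp F) * Real.exp (-((δ12₃ F) * (geo9Y x).dist a a')))) (hC1TK : ∀ F : T4Family, ∀ x : MemberY (stage3OfFamily F).d₆ (stage3OfFamily F).ℓ₆ (stage3OfFamily F).hd' (stage3OfFamily F).hL' (stage3OfFamily F).b₀ (stage3OfFamily F).b₁ (Mstar F), (M12 F) ≤ (geo9Y x).M → ∀ α₀ : ℝ, 0 < α₀ → (geo9Y x).M * α₀ ≤ (a12 F) → ∀ U : (bg9YR (Matrix (Fin 2) (Fin 2) ℂ) (specialUnitaryUnits (Fin 2)) (R₁ F) (R₂ F) x).Cfg, (bg9YR (Matrix (Fin 2) (Fin 2) ℂ) (specialUnitaryUnits (Fin 2)) (R₁ F) (R₂ F) x).Reg335 (c F) α₀ U → (bg9YR (Matrix (Fin 2) (Fin 2) ℂ) (specialUnitaryUnits (Fin 2)) (R₁ F) (R₂ F) x).Reg336 (c F) α₀ U → IsTransposePair (((𝔬12 F) x).C1 U) (((𝔬12 F) x).C1 U))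
    (h46K : ∀ F : T4Family, ∀ x : MemberY (stage3OfFamily F).d₆ (stage3OfFamily F).ℓ₆ (stage3OfFamily F).hd' (stage3OfFamily F).hL' (stage3OfFamily F).b₀ (stage3OfFamily F).b₁ (Mstar F), (M46K F) ≤ (geo9Y x).M → ∀ α₀ : ℝ, 0 < α₀ → (geo9Y x).M * α₀ ≤ (a46K F) → ∀ U : (bg9YR (Matrix (Fin 2) (Fin 2) ℂ) (specialUnitaryUnits (Fin 2)) (R₁ F) (R₂ F) x).Cfg, (bg9YR (Matrix (Fin 2) (Fin 2) ℂ) (specialUnitaryUnits (Fin 2)) (R₁ F) (R₂ F) x).Reg335 (c F) α₀ U → B9SectDL2Decay.BlockBd (g := toB6 (geo9Y x) 1 ((H F) x)) (blkBK x.toKIdx ((bI F) x)) (blkBK x.toKIdx ((bI F) x)) (DvcoKH x.toKIdx (trBasis 2) (bg9YR (Matrix (Fin 2) (Fin 2) ℂ) (specialUnitaryUnits (Fin 2)) (R₁ F) (R₂ F) x) (fun U => U) U ∘ₗ GcoS x.toKIdx (trBasis 2) (bg9YR (Matrix (Fin 2) (Fin 2) ℂ) (specialUnitaryUnits (Fin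 2)) (R₁ F) (R₂ F) x) (fun U => U) (GpY x.toKIdx (parKnitY x.toKIdx)) U ∘ₗ DvscoKH x.toKIdx (trBasis 2) (bg9YR (Matrix (Fin 2) (Fin 2) ℂ) (specialUnitaryUnits (Fin 2)) (R₁ F) (R₂ F) x) (fun U => U) U) (fun (y y' : (geo9Y x).Site) => (B46K F) * Real.exp (-((δ46K F) * (geo9Y x).dist y y')))) (MD2 aD₀ θ₂ : ∀ F : T4Family, ℝ) (haD00 : ∀ F : T4Family, 0 < (aD₀ F)) (hθ₂ : ∀ F : T4Family, 0 ≤ (θ₂ F)) (hD2P : ∀ F : T4Family, ∀ aD' : ℝ, aD' ≤ (aD₀ F) → ∀ x : MemberY (stage3OfFamily F).d₆ (stage3OfFamily F).ℓ₆ (stage3OfFamily F).hd' (stage3OfFamily F).hL' (stage3OfFamily F).b₀ (stage3OfFamily F).b₁ (Mstar F), (MD2 F) ≤ (geo9Y x).M → ∀ α₀ : ℝ, 0 < α₀ → (geo9Y x).M * α₀ ≤ aD' → ∀ U : (bg9YR (Matrix (Fin 2) (Fin 2) ℂ) (specialUnitaryUnits (Fin 2)) (R₁ F) (R₂ F) x).Cfg,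 (bg9YR (Matrix (Fin 2) (Fin 2) ℂ) (specialUnitaryUnits (Fin 2)) (R₁ F) (R₂ F) x).Reg335 (c F) α₀ U → (bg9YR (Matrix (Fin 2) (Fin 2) ℂ) (specialUnitaryUnits (Fin 2)) (R₁ F) (R₂ F) x).Reg336 (c F) α₀ U → HasMajorant (g := toB6 (geo9Y x) 1 ((H F) x)) ((𝔬12 F) x).blk (D2coK x.toKIdx (trBasis 2) (bg9YR (Matrix (Fin 2) (Fin 2) ℂ) (specialUnitaryUnits (Fin 2)) (R₁ F) (R₂ F) x) (fun U => U) (((𝔯 F) x).Δ2) U) (fun (a b : (geo9Y x).Site) => (θ₂ F) * ((geo9Y x).M * α₀) * ((geo9Y x).len a ^ 2)⁻¹ * Real.exp (-((δ₂ F) * (geo9Y x).dist a b)))) (h348F : ∀ F : T4Family, ∀ x : MemberY (stage3OfFamily F).d₆ (stage3OfFamily F).ℓ₆ (stage3OfFamily F).hd' (stage3OfFamily F).hL' (stage3OfFamily F).b₀ (stage3OfFamily F).b₁ (Mstar F), (M39 F) ≤ (geo9Y x).M → ∀ α₀ : ℝ, 0 < α₀ → (c F) * (geo9Y x).M * α₀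 ≤ (a39 F) → ∀ U : (bg9YR (Matrix (Fin 2) (Fin 2) ℂ) (specialUnitaryUnits (Fin 2)) (R₁ F) (R₂ F) x).Cfg, (bg9YR (Matrix (Fin 2) (Fin 2) ℂ) (specialUnitaryUnits (Fin 2)) (R₁ F) (R₂ F) x).Reg335 (c F) α₀ U → Conv348Blk (oneCubeOps39YF (stage3OfFamily F) (Mstar F) ((lettersYOfRecordV11K 2 (stage3OfFamily F) (Mstar F) (𝔯 F))) (bI F) x) (B39 F) (δ39 F) U)
    -- NODE N07's LEAF from NODE 00's `CarriersZSectE.b11Leaf_Z11OfRecord_withSectE_of_parts` at print's letters `L := F.L`, `η i := (F.P i.K).eta i.k`: the six remaining printed parts of [B11] + n16's dictionary inputs, displayed per F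
    (hN07 : ∀ F : T4Family, ∃ (β : ZIdx → Type) (_ : ∀ i, Fintype (β i)) (_ : Fact (0 < (F.L : ℝ))) (_ : ∀ i : ZIdx, Fact (0 < (F.P i.K).eta i.k))
      (ζ : ResidZ F 2) (E : SectEPres F 2 (F.L : ℝ) (fun i : ZIdx => (F.P i.K).eta i.k) β ζ)
      (βr : ∀ i, B11Prop7Assembly.Bridge ((Z11OfRecord F 2 (ζ.withSectE E)).famX i) ((Z11OfRecord F 2 (ζ.withSectE E)).famLG i)) (O₁ O₂ e₅ a : ℝ),
      0 < E.C₄ ∧ 0 < E.a₃ ∧ 0 < E.α ∧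
      (∀ i, (βr i).Laws ζ.C₁ ζ.B₃) ∧ (∀ i, B11Prop7Assembly.ExistenceLeavesCap (βr i) ζ.B₀ ζ.B₃ ζ.C₁ O₁ O₂ e₅) ∧
      (∀ i, ((Z11OfRecord F 2 (ζ.withSectE E)).famX i).Laws) ∧
      0 < ζ.B₀ ∧ 0 < ζ.B₁ ∧ 1 ≤ ζ.B₃ ∧ 1 ≤ ζ.C₁ ∧ ζ.B₀ ≤ 4 * ζ.B₁ ∧ 0 < ζ.c₁ ∧ 0 < O₁ ∧ 0 < O₂ ∧ 0 < e₅ ∧ 0 < a ∧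
      (∀ (i : ZIdx) (ε₁ : ℝ) (V : ((Z11OfRecord F 2 (ζ.withSectE E)).famX i).Bdry), 0 < ε₁ → ε₁ ≤ a →
        ((Z11OfRecord F 2 (ζ.withSectE E)).famX i).Reg7 ε₁ V →
          ∃ U₀ : ((Z11OfRecord F 2 (ζ.withSectE E)).famLG i).Cfg,
            ((Z11OfRecord F 2 (ζ.withSectE E)).famLG i).Sat14 (ζ.C₁ * ζ.B₃ * ε₁) (ζ.C₁ * ε₁) ((βr i).bdry V) U₀) ∧
      B11.Prop2Printed ζ.B₁ ζ.B₃ ζ.C₁ ζ.c₁ (Z11OfRecord F 2 (ζ.withSectE E)).famLG ∧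
      B11.Prop3Printed ζ.C₁ ζ.B₃ ζ.C₂ ζ.C₃ ζ.B₀ ζ.c1h ζ.c₄ ζ.δ₀ (Z11OfRecord F 2 (ζ.withSectE E)).famLG ∧
      B11.Prop5Printed ζ.B₁ ζ.B₃ ζ.C₁ (Z11OfRecord F 2 (ζ.withSectE E)).famLG ∧
      B11.Prop8Printed ζ.B₃ (Z11OfRecord F 2 (ζ.withSectE E)).famX ∧ B11.SectFPrinted ζ.B₃ (Z11OfRecord F 2 (ζ.withSectE E)).famX ∧
      B11.Prop9Printed ζ.B₅ ζ.C₁ ζ.β₀ ζ.δ₀ ζ.famAn)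
    -- NODE N08's SLOT from dag-n08-w4's `…N08AlphaEq324RowACReMassedZSlot.printedUV3V_at_slotOfRecord_of_coreLTAtAC_of_massBoundZAE_of_consts` at `N := 2, L := F.L`: N08's (α)-AC residual (R-AC-324⁷ reading), displayed per F
    (hN08 : ∀ F : T4Family, ∃ (𝔊 : Literature.MathematicalPhysics.QuantumFieldTheory.Balaban1985CMP102.Setting.GroupModel (SU 2)) (𝔠 : Summit.QuantumFields.Balaban3D.Proofs.Primitives.AlphaConsts F.L 𝔊.N) (εbg cm : ℝ)
      (X : ∀ S : Literature.MathematicalPhysics.QuantumFieldTheory.Balaban1985CMP102.Setting.Scales F.L, Summit.QuantumFields.Balaban3D.Proofs.StandardAC.ExternalInputsAC S (SU 2))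
      (𝔖 : ∀ (S : Literature.MathematicalPhysics.QuantumFieldTheory.Balaban1985CMP102.Setting.Scales F.L) (k : ℕ), Summit.QuantumFields.Balaban3D.Carriers.StepSeries S (SU 2) ↥(Summit.QuantumFields.Balaban3D.Proofs.GroupModelLieC.lieC 𝔊) (Summit.QuantumFields.Balaban3D.Carriers.nblkOf S 𝔠.lane.carrier k) k)
      (𝔄 : ∀ S : Literature.MathematicalPhysics.QuantumFieldTheory.Balaban1985CMP102.Setting.Scales F.L, Summit.QuantumFields.YangMills.Theorems.BalabanUVNodesN08AlphaEq324RowAC.AlphaDataLTAC 𝔊 𝔠 (X S) (𝔖 S))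
      (c : ∀ (S : Literature.MathematicalPhysics.QuantumFieldTheory.Balaban1985CMP102.Setting.Scales F.L) (k : ℕ), Summit.QuantumFields.Balaban3D.Carriers.Hist S.P (k + 1) → GaugeField S.P (k + 1) (SU 2) → ℕ → ℝ),
      (∀ S, (X S).av = B10RunsOfRecord.avOfPrint 2 S) ∧
      (∀ (S : Literature.MathematicalPhysics.QuantumFieldTheory.Balaban1985CMP102.Setting.Scales F.L) k (V : GaugeField S.P (k + 1) (SU 2)), (X S).Uk k V = B10RunsOfRecord.UkA 2 (fun S => (X S).av) S (k + 1) εbg V) ∧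
      𝔠.lane.F.b₀ * (𝔠.lane.F.p₀ ^ 𝔠.lane.F.p₀ * Real.exp (1 - 𝔠.lane.F.p₀)) ≤ εbg ∧
      (∀ S : Literature.MathematicalPhysics.QuantumFieldTheory.Balaban1985CMP102.Theorems.Family F.L (Summit.QuantumFields.Balaban3D.Proofs.Constants.eps0Of 𝔠.gamma0), Summit.QuantumFields.YangMills.Theorems.BalabanUVNodesN08AlphaEq324RowAC.RunAlphaEq324CoreLTAtAC 𝔊 𝔠 (X S.1) (𝔖 S.1) (𝔄 S.1) (c S.1)) ∧ 0 ≤ cm ∧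
      (∀ S : Literature.MathematicalPhysics.QuantumFieldTheory.Balaban1985CMP102.Theorems.Family F.L (Summit.QuantumFields.Balaban3D.Proofs.Constants.eps0Of 𝔠.gamma0), ∀ k, 1 ≤ k → k ≤ S.1.K → ∀ h : Summit.QuantumFields.Balaban3D.Carriers.Hist S.1.P k, ∀ᵐ U ∂(fieldMeasure S.1.P k (SU 2)),
        Summit.QuantumFields.Balaban3D.Proofs.MassesAC.massRecAC 𝔠.lane.carrier.M₁ (Summit.QuantumFields.Balaban3D.Carriers.rcolOf S.1 𝔠.lane.carrier) (Summit.QuantumFields.Balaban3D.Carriers.eps1Of S.1 𝔠.lane.carrier) (Summit.QuantumFields.Balaban3D.Carriers.epsSOf S.1 𝔠.lane.carrier) (X S.1).av k h U ≤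
          Real.exp (cm * S.1.sites k + 𝔠.lane.carrier.dg * 𝔠.lane.carrier.c₁ *
            ∑ j ∈ Finset.range k, (Summit.QuantumFields.Balaban3D.Carriers.ZVol 𝔠.lane.carrier.M₁ (Summit.QuantumFields.Balaban3D.Carriers.rcolOf S.1 𝔠.lane.carrier) k h j : ℝ))))
    (h09 : ∀ (F : T4Family) {j : ℕ} {γ ε₀ ε₂₉ B₃ B₃' a₀ a₁ : ℝ} (hγ₀ : 0 < γ) (hγh : γ ≤ 1 / 2) (hε : 0 < ε₀) (hε' : 0 < ε₂₉) (hB : 0 ≤ B₃) (hB' : 0 ≤ B₃') (ha₀ : 0 < a₀) (ha₁ : 0 < a₁) (ha₀ρ : a₀ ≤ 1 / (109824 * (F.L : ℝ) ^ 2)) (hε₀ρ : ε₀ = a₀) {bl β' : ℝ} (hbox : BetaLowerH bl γ (betaOfRecord₁₃ F 2 (theta13OfThm1CCMWZB F 2 j γ a₀ ε₀ ε₂₉ B₃ B₃' a₀ a₁ (Efl F j γ ε₀ ε₂₉ B₃ B₃' a₀ a₁) (fun p i => Real.log (B16ZLower.zNorm (SU 2) (gOfRecord₁₃ F 2 (theta13OfThm1CCMWZB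 F 2 j γ a₀ ε₀ ε₂₉ B₃ B₃' a₀ a₁ (fun _ _ => 0) (fun _ _ => 0)) p i ^ 2) ε))))) (hbox' : BetaUpperH β' γ (betaOfRecord₁₃ F 2 (theta13OfThm1CCMWZB F 2 j γ a₀ ε₀ ε₂₉ B₃ B₃' a₀ a₁ (Efl F j γ ε₀ ε₂₉ B₃ B₃' a₀ a₁) (fun p i => Real.log (B16ZLower.zNorm (SU 2) (gOfRecord₁₃ F 2 (theta13OfThm1CCMWZB F 2 j γ a₀ ε₀ ε₂₉ B₃ B₃' a₀ a₁ (fun _ _ => 0) (fun _ _ => 0)) p i ^ 2) ε))))) (hl : -bl * γ ^ 2 ≤ 3) (hβ' : β' * γ ^ 2 ≤ 3 / 4),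
      ∃ lam12 : ResidB12 F 2 (theta13OfThm1CCMWZB F 2 j γ a₀ ε₀ ε₂₉ B₃ B₃' a₀ a₁ (Efl F j γ ε₀ ε₂₉ B₃ B₃' a₀ a₁) (fun p i => Real.log (B16ZLower.zNorm (SU 2) (gOfRecord₁₃ F 2 (theta13OfThm1CCMWZB F 2 j γ a₀ ε₀ ε₂₉ B₃ B₃' a₀ a₁ (fun _ _ => 0) (fun _ _ => 0)) p i ^ 2) ε))).τ9.M,
      ∀ P : B12.RunParams, B12Sec2to5.Lemma4Printed (F12OfRecord₁₂ F 2 (theta13OfThm1CCMWZB F 2 j γ a₀ ε₀ ε₂₉ B₃ B₃' a₀ a₁ (Efl F j γ ε₀ ε₂₉ B₃ B₃' a₀ a₁) (fun p i => Real.log (B16ZLower.zNorm (SU 2) (gOfRecord₁₃ F 2 (theta13OfThm1CCMWZB F 2 j γ a₀ ε₀ ε₂₉ B₃ B₃' a₀ a₁ (fun _ _ => 0) (fun _ _ => 0)) p i ^ 2) ε))).toStage12Params lam12 P) (lam12 P).consts)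
    (hN09T : ∀ (F : T4Family) {j : ℕ} {γ ε₀ ε₂₉ B₃ B₃' a₀ a₁ : ℝ} (hγ₀ : 0 < γ) (hγh : γ ≤ 1 / 2) (hε : 0 < ε₀) (hε' : 0 < ε₂₉) (hB : 0 ≤ B₃) (hB' : 0 ≤ B₃') (ha₀ : 0 < a₀) (ha₁ : 0 < a₁) (ha₀ρ : a₀ ≤ 1 / (109824 * (F.L : ℝ) ^ 2)) (hε₀ρ : ε₀ = a₀) {bl β' : ℝ} (hbox : BetaLowerH bl γ (betaOfRecord₁₃ F 2 (theta13OfThm1CCMWZB F 2 j γ a₀ ε₀ ε₂₉ B₃ B₃' a₀ a₁ (Efl F j γ ε₀ ε₂₉ B₃ B₃' a₀ a₁) (fun p i => Real.log (B16ZLower.zNorm (SU 2) (gOfRecord₁₃ F 2 (theta13OfThm1CCMWZB F 2 j γ a₀ ε₀ ε₂₉ B₃ B₃' a₀ a₁ (fun _ _ => 0) (fun _ _ => 0)) p i ^ 2) ε))))) (hbox' : BetaUpperH β' γ (betaOfRecord₁₃ F 2 (theta13OfThm1CCMWZB F 2 j γ a₀ ε₀ ε₂₉ B₃ B₃' a₀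 a₁ (Efl F j γ ε₀ ε₂₉ B₃ B₃' a₀ a₁) (fun p i => Real.log (B16ZLower.zNorm (SU 2) (gOfRecord₁₃ F 2 (theta13OfThm1CCMWZB F 2 j γ a₀ ε₀ ε₂₉ B₃ B₃' a₀ a₁ (fun _ _ => 0) (fun _ _ => 0)) p i ^ 2) ε))))) (hl : -bl * γ ^ 2 ≤ 3) (hβ' : β' * γ ^ 2 ≤ 3 / 4),
      ∃ cd : (P : B12.RunParams) → (i : ℕ) → ContourData (F.P P.K) i (SU 2),
        (∀ (P : B12.RunParams) (k : ℕ), k ≤ P.K → ∀ V ∈ domAltOfRecord F 2 (numerics7OfThm1CCM F.L j ε₀ B₃ B₃' a₀ a₁) P.K k, Uk F 2 P.K k a₀ V ∈ bgReg F 2 P.K k a₀) ∧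
        (∀ (P : B12.RunParams), ∀ i < P.K, ∀ W ∈ domAltOfRecord F 2 (numerics7OfThm1CCM F.L j ε₀ B₃ B₃' a₀ a₁) P.K (i + 1), AxialGauge (cd P i) (critCfgOfRecord F 2 (numerics7OfThm1CCM F.L j ε₀ B₃ B₃' a₀ a₁) P.K i W)) ∧
        (∀ (P : B12.RunParams) (k : ℕ), k ≤ P.K → ∀ V ∈ domAltOfRecord F 2 (numerics7OfThm1CCM F.L j ε₀ B₃ B₃' a₀ a₁) P.K k, ∀ i < k, AxialGauge (cd P i) (Averaging.iter (avOfRecord F 2 P.K) i (Uk F 2 P.K k a₀ V))) ∧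
        (∀ (P : B12.RunParams) (i : ℕ), i + 1 < P.K → ∀ U : GaugeField (F.P P.K) (i + 1) (SU 2), (avOfRecord F 2 P.K (i + 1)).avg U ∈ domAltOfRecord F 2 (numerics7OfThm1CCM F.L j ε₀ B₃ B₃' a₀ a₁) P.K (i + 2) →
          U ∉ regSetOfRecord F 2 P.K i (betaInputOfRecord F 2 (TβOfRecord₁₃ F 2) (chiβOfRecord₁₃ F 2 (theta13OfThm1CCMWZB F 2 j γ a₀ ε₀ ε₂₉ B₃ B₃' a₀ a₁ (Efl F j γ ε₀ ε₂₉ B₃ B₃' a₀ a₁) (fun p i => Real.log (B16ZLower.zNorm (SU 2) (gOfRecord₁₃ F 2 (theta13OfThm1CCMWZB F 2 j γ a₀ ε₀ ε₂₉ B₃ B₃' a₀ a₁ (fun _ _ => 0) (fun _ _ => 0)) p i ^ 2) ε)))) P.K (gOfRecord₁₃ F 2 (theta13OfThm1CCMWZB F 2 j γ a₀ ε₀ ε₂₉ B₃ B₃' a₀ a₁ (Efl F j γ ε₀ ε₂₉ B₃ B₃' a₀ a₁) (fun p i => Real.log (B16ZLower.zNorm (SU 2) (gOfRecord₁₃ F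 2 (theta13OfThm1CCMWZB F 2 j γ a₀ ε₀ ε₂₉ B₃ B₃' a₀ a₁ (fun _ _ => 0) (fun _ _ => 0)) p i ^ 2) ε))) P) i) ∩ domAltOfRecord F 2 (numerics7OfThm1CCM F.L j ε₀ B₃ B₃' a₀ a₁) P.K (i + 1) →
            chiβOfRecord₁₃ F 2 (theta13OfThm1CCMWZB F 2 j γ a₀ ε₀ ε₂₉ B₃ B₃' a₀ a₁ (Efl F j γ ε₀ ε₂₉ B₃ B₃' a₀ a₁) (fun p i => Real.log (B16ZLower.zNorm (SU 2) (gOfRecord₁₃ F 2 (theta13OfThm1CCMWZB F 2 j γ a₀ ε₀ ε₂₉ B₃ B₃' a₀ a₁ (fun _ _ => 0) (fun _ _ => 0)) p i ^ 2) ε))) P.K (gOfRecord₁₃ F 2 (theta13OfThm1CCMWZB F 2 j γ a₀ ε₀ ε₂₉ B₃ B₃' a₀ a₁ (Efl F j γ ε₀ ε₂₉ B₃ B₃' a₀ a₁) (fun p i => Real.log (B16ZLower.zNorm (SU 2) (gOfRecord₁₃ F 2 (theta13OfThm1CCMWZB F 2 j γ a₀ ε₀ ε₂₉ B₃ B₃'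 a₀ a₁ (fun _ _ => 0) (fun _ _ => 0)) p i ^ 2) ε))) P) (i + 1) U = 0) ∧
        (∀ (P : B12.RunParams), ∀ i < P.K, MeasureTheory.Integrable (betaInputOfRecord F 2 (TβOfRecord₁₃ F 2) (chiβOfRecord₁₃ F 2 (theta13OfThm1CCMWZB F 2 j γ a₀ ε₀ ε₂₉ B₃ B₃' a₀ a₁ (Efl F j γ ε₀ ε₂₉ B₃ B₃' a₀ a₁) (fun p i => Real.log (B16ZLower.zNorm (SU 2) (gOfRecord₁₃ F 2 (theta13OfThm1CCMWZB F 2 j γ a₀ ε₀ ε₂₉ B₃ B₃' a₀ a₁ (fun _ _ => 0) (fun _ _ => 0)) p i ^ 2) ε)))) P.K (gOfRecord₁₃ F 2 (theta13OfThm1CCMWZB F 2 j γ a₀ ε₀ ε₂₉ B₃ B₃' a₀ a₁ (Efl F j γ ε₀ ε₂₉ B₃ B₃' a₀ a₁) (fun p i => Real.log (B16ZLower.zNorm (SU 2) (gOfRecord₁₃ F 2 (theta13OfThm1CCMWZB F 2 j γ a₀ ε₀ ε₂₉ B₃ B₃' a₀ a₁ (fun _ _ => 0) (fun _ _ => 0))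 p i ^ 2) ε))) P) i) (fieldMeasure (F.P P.K) i (SU 2))) ∧
        (∀ (P : B12.RunParams) (k : ℕ), k ≤ P.K → ∀ V ∈ domAltOfRecord F 2 (numerics7OfThm1CCM F.L j ε₀ B₃ B₃' a₀ a₁) P.K k, UkExists F 2 P.K k a₀ V ∧ UniqueUkOrbit F 2 P.K k a₀ V) ∧
        (∀ (P : B12.RunParams) (k : ℕ), k ≤ P.K → HRestrict F 2 a₀ P.K k (domAltOfRecord F 2 (numerics7OfThm1CCM F.L j ε₀ B₃ B₃' a₀ a₁) P.K k)) ∧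
        (∀ (P : B12.RunParams) (k : ℕ), k ≤ P.K → ∀ V ∈ domAltOfRecord F 2 (numerics7OfThm1CCM F.L j ε₀ B₃ B₃' a₀ a₁) P.K k, ∀ i < k, UniqueUkOrbit F 2 P.K (i + 1) a₀ (Averaging.iter (avOfRecord F 2 P.K) (i + 1) (Uk F 2 P.K k a₀ V))))
    (h10 : ∀ F : T4Family, ∃ lam13 : B12.RunParams → ResidB13 (stage3OfFamily F), ∀ P : B12.RunParams, B13LeafOfRecord (stage3OfFamily F) (lam13 P))
    (h11N : ∀ (F : T4Family) {j : ℕ} {γ ε₀ ε₂₉ B₃ B₃' a₀ a₁ : ℝ} (hγ₀ : 0 < γ) (hγh : γ ≤ 1 / 2) (hε : 0 < ε₀) (hε' : 0 < ε₂₉) (hB : 0 ≤ B₃) (hB' : 0 ≤ B₃') (ha₀ : 0 < a₀) (ha₁ : 0 < a₁) (ha₀ρ : a₀ ≤ 1 / (109824 * (F.L : ℝ) ^ 2)) (hε₀ρ : ε₀ = a₀) {bl β' : ℝ} (hbox : BetaLowerH bl γ (betaOfRecord₁₃ F 2 (theta13OfThm1CCMWZB F 2 j γ a₀ ε₀ ε₂₉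 B₃ B₃' a₀ a₁ (Efl F j γ ε₀ ε₂₉ B₃ B₃' a₀ a₁) (fun p i => Real.log (B16ZLower.zNorm (SU 2) (gOfRecord₁₃ F 2 (theta13OfThm1CCMWZB F 2 j γ a₀ ε₀ ε₂₉ B₃ B₃' a₀ a₁ (fun _ _ => 0) (fun _ _ => 0)) p i ^ 2) ε))))) (hbox' : BetaUpperH β' γ (betaOfRecord₁₃ F 2 (theta13OfThm1CCMWZB F 2 j γ a₀ ε₀ ε₂₉ B₃ B₃' a₀ a₁ (Efl F j γ ε₀ ε₂₉ B₃ B₃' a₀ a₁) (fun p i => Real.log (B16ZLower.zNorm (SU 2) (gOfRecord₁₃ F 2 (theta13OfThm1CCMWZB F 2 j γ a₀ ε₀ ε₂₉ B₃ B₃' a₀ a₁ (fun _ _ => 0) (fun _ _ => 0)) p i ^ 2) ε))))) (hl : -bl * γ ^ 2 ≤ 3) (hβ' : β' * γ ^ 2 ≤ 3 / 4),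
      ∃ σ : (P : B12.RunParams) → Sect3Supplier (gaussPinH (Stage13HParams.ofHistoryBlind F 2 ⟨theta13OfThm1CCMWZB F 2 j γ a₀ ε₀ ε₂₉ B₃ B₃' a₀ a₁ (Efl F j γ ε₀ ε₂₉ B₃ B₃' a₀ a₁) (fun p i => Real.log (B16ZLower.zNorm (SU 2) (gOfRecord₁₃ F 2 (theta13OfThm1CCMWZB F 2 j γ a₀ ε₀ ε₂₉ B₃ B₃' a₀ a₁ (fun _ _ => 0) (fun _ _ => 0)) p i ^ 2) ε)), ZrOfRecord₁₃ F 2 (theta13OfThm1CCMWZB F 2 j γ a₀ ε₀ ε₂₉ B₃ B₃' a₀ a₁ (Efl F j γ ε₀ ε₂₉ B₃ B₃' a₀ a₁) (fun p i => Real.log (B16ZLower.zNorm (SU 2) (gOfRecord₁₃ F 2 (theta13OfThm1CCMWZB F 2 j γ a₀ ε₀ ε₂₉ B₃ B₃' a₀ a₁ (fun _ _ => 0) (fun _ _ => 0)) p i ^ 2) ε)))⟩)) P,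
        (∀ P : B12.RunParams, Step.InInterval γ P.K (gOfRecord₁₃ F 2 (theta13OfThm1CCMWZB F 2 j γ a₀ ε₀ ε₂₉ B₃ B₃' a₀ a₁ (Efl F j γ ε₀ ε₂₉ B₃ B₃' a₀ a₁) (fun p i => Real.log (B16ZLower.zNorm (SU 2) (gOfRecord₁₃ F 2 (theta13OfThm1CCMWZB F 2 j γ a₀ ε₀ ε₂₉ B₃ B₃' a₀ a₁ (fun _ _ => 0) (fun _ _ => 0)) p i ^ 2) ε))) P) → SupplierObligations (gaussPinH (Stage13HParams.ofHistoryBlind F 2 ⟨theta13OfThm1CCMWZB F 2 j γ a₀ ε₀ ε₂₉ B₃ B₃' a₀ a₁ (Efl F j γ ε₀ ε₂₉ B₃ B₃' a₀ a₁) (fun p i => Real.log (B16ZLower.zNorm (SU 2) (gOfRecord₁₃ F 2 (theta13OfThm1CCMWZB F 2 j γ a₀ ε₀ ε₂₉ B₃ B₃' a₀ a₁ (fun _ _ => 0) (fun _ _ => 0)) p i ^ 2) ε)), ZrOfRecord₁₃ F 2 (theta13OfThm1CCMWZB F 2 j γ a₀ ε₀ ε₂₉ B₃ B₃' a₀ a₁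 (Efl F j γ ε₀ ε₂₉ B₃ B₃' a₀ a₁) (fun p i => Real.log (B16ZLower.zNorm (SU 2) (gOfRecord₁₃ F 2 (theta13OfThm1CCMWZB F 2 j γ a₀ ε₀ ε₂₉ B₃ B₃' a₀ a₁ (fun _ _ => 0) (fun _ _ => 0)) p i ^ 2) ε)))⟩)) P (σ P)) ∧
        (∀ P : B12.RunParams, Step.InInterval γ P.K (gOfRecord₁₃ F 2 (theta13OfThm1CCMWZB F 2 j γ a₀ ε₀ ε₂₉ B₃ B₃' a₀ a₁ (Efl F j γ ε₀ ε₂₉ B₃ B₃' a₀ a₁) (fun p i => Real.log (B16ZLower.zNorm (SU 2) (gOfRecord₁₃ F 2 (theta13OfThm1CCMWZB F 2 j γ a₀ ε₀ ε₂₉ B₃ B₃' a₀ a₁ (fun _ _ => 0) (fun _ _ => 0)) p i ^ 2) ε))) P) → OperandRowsAlongChain (gaussPinH (Stage13HParams.ofHistoryBlind F 2 ⟨theta13OfThm1CCMWZB F 2 j γ a₀ ε₀ ε₂₉ B₃ B₃' a₀ a₁ (Efl F j γ ε₀ ε₂₉ B₃ B₃' a₀ a₁) (fun p i => Real.log (B16ZLower.zNorm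 (SU 2) (gOfRecord₁₃ F 2 (theta13OfThm1CCMWZB F 2 j γ a₀ ε₀ ε₂₉ B₃ B₃' a₀ a₁ (fun _ _ => 0) (fun _ _ => 0)) p i ^ 2) ε)), ZrOfRecord₁₃ F 2 (theta13OfThm1CCMWZB F 2 j γ a₀ ε₀ ε₂₉ B₃ B₃' a₀ a₁ (Efl F j γ ε₀ ε₂₉ B₃ B₃' a₀ a₁) (fun p i => Real.log (B16ZLower.zNorm (SU 2) (gOfRecord₁₃ F 2 (theta13OfThm1CCMWZB F 2 j γ a₀ ε₀ ε₂₉ B₃ B₃' a₀ a₁ (fun _ _ => 0) (fun _ _ => 0)) p i ^ 2) ε)))⟩)) P (σ P)))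
    (hEfl : ∀ (F : T4Family) (j : ℕ) (γ ε₀ ε₂₉ B₃ B₃' a₀ a₁ : ℝ), ∃ CE : ℝ, 0 ≤ CE ∧ ∀ (P : B12.RunParams) (i : ℕ), i < P.K → |Efl F j γ ε₀ ε₂₉ B₃ B₃' a₀ a₁ P i| ≤ CE * sitesCard (F.P P.K) (i + 1))
    (h13pos : ∀ (F : T4Family) {j : ℕ} {γ ε₀ ε₂₉ B₃ B₃' a₀ a₁ : ℝ} (hγ₀ : 0 < γ) (hγh : γ ≤ 1 / 2) (hε : 0 < ε₀) (hε' : 0 < ε₂₉) (hB : 0 ≤ B₃) (hB' : 0 ≤ B₃') (ha₀ : 0 < a₀) (ha₁ : 0 < a₁) (ha₀ρ : a₀ ≤ 1 / (109824 * (F.L : ℝ) ^ 2)) (hε₀ρ : ε₀ = a₀) {bl β' : ℝ} (hbox : BetaLowerH bl γ (betaOfRecord₁₃ F 2 (theta13OfThm1CCMWZB F 2 j γ a₀ ε₀ ε₂₉ B₃ B₃' a₀ a₁ (Efl F j γ ε₀ ε₂₉ B₃ B₃' a₀ a₁) (fun p i => Real.log (B16ZLower.zNorm (SU 2) (gOfRecord₁₃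 F 2 (theta13OfThm1CCMWZB F 2 j γ a₀ ε₀ ε₂₉ B₃ B₃' a₀ a₁ (fun _ _ => 0) (fun _ _ => 0)) p i ^ 2) ε))))) (hbox' : BetaUpperH β' γ (betaOfRecord₁₃ F 2 (theta13OfThm1CCMWZB F 2 j γ a₀ ε₀ ε₂₉ B₃ B₃' a₀ a₁ (Efl F j γ ε₀ ε₂₉ B₃ B₃' a₀ a₁) (fun p i => Real.log (B16ZLower.zNorm (SU 2) (gOfRecord₁₃ F 2 (theta13OfThm1CCMWZB F 2 j γ a₀ ε₀ ε₂₉ B₃ B₃' a₀ a₁ (fun _ _ => 0) (fun _ _ => 0)) p i ^ 2) ε))))) (hl : -bl * γ ^ 2 ≤ 3) (hβ' : β' * γ ^ 2 ≤ 3 / 4)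
      (hP : (gaussPinH (Stage13HParams.ofHistoryBlind F 2 ⟨theta13OfThm1CCMWZB F 2 j γ a₀ ε₀ ε₂₉ B₃ B₃' a₀ a₁ (Efl F j γ ε₀ ε₂₉ B₃ B₃' a₀ a₁) (fun p i => Real.log (B16ZLower.zNorm (SU 2) (gOfRecord₁₃ F 2 (theta13OfThm1CCMWZB F 2 j γ a₀ ε₀ ε₂₉ B₃ B₃' a₀ a₁ (fun _ _ => 0) (fun _ _ => 0)) p i ^ 2) ε)), ZrOfRecord₁₃ F 2 (theta13OfThm1CCMWZB F 2 j γ a₀ ε₀ ε₂₉ B₃ B₃' a₀ a₁ (Efl F j γ ε₀ ε₂₉ B₃ B₃' a₀ a₁) (fun p i => Real.log (B16ZLower.zNorm (SU 2) (gOfRecord₁₃ F 2 (theta13OfThm1CCMWZB F 2 j γ a₀ ε₀ ε₂₉ B₃ B₃' a₀ a₁ (fun _ _ => 0) (fun _ _ => 0)) p i ^ 2) ε)))⟩)).Provisos₁₃SepCoPH F 2),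
      ∃ γ₁₃ : ℝ, 0 < γ₁₃ ∧ ∃ em ep : ℝ → ℝ,
        (∀ P : B12.RunParams, ((datumOfRecord₁₃SepCoPH F 2 (gaussPinH (Stage13HParams.ofHistoryBlind F 2 ⟨theta13OfThm1CCMWZB F 2 j γ a₀ ε₀ ε₂₉ B₃ B₃' a₀ a₁ (Efl F j γ ε₀ ε₂₉ B₃ B₃' a₀ a₁) (fun p i => Real.log (B16ZLower.zNorm (SU 2) (gOfRecord₁₃ F 2 (theta13OfThm1CCMWZB F 2 j γ a₀ ε₀ ε₂₉ B₃ B₃' a₀ a₁ (fun _ _ => 0) (fun _ _ => 0)) p i ^ 2) ε)), ZrOfRecord₁₃ F 2 (theta13OfThm1CCMWZB F 2 j γ a₀ ε₀ ε₂₉ B₃ B₃' a₀ a₁ (Efl F j γ ε₀ ε₂₉ B₃ B₃' a₀ a₁) (fun p i => Real.log (B16ZLower.zNorm (SU 2) (gOfRecord₁₃ F 2 (theta13OfThm1CCMWZB F 2 j γ a₀ ε₀ ε₂₉ B₃ B₃' a₀ a₁ (fun _ _ => 0) (fun _ _ => 0)) p i ^ 2) ε)))⟩)) hP).C P).flow.InInterval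 γ₁₃ P.K → ∀ k, k + 1 ≤ P.K → SLaw₁₃CoPH F 2 (gaussPinH (Stage13HParams.ofHistoryBlind F 2 ⟨theta13OfThm1CCMWZB F 2 j γ a₀ ε₀ ε₂₉ B₃ B₃' a₀ a₁ (Efl F j γ ε₀ ε₂₉ B₃ B₃' a₀ a₁) (fun p i => Real.log (B16ZLower.zNorm (SU 2) (gOfRecord₁₃ F 2 (theta13OfThm1CCMWZB F 2 j γ a₀ ε₀ ε₂₉ B₃ B₃' a₀ a₁ (fun _ _ => 0) (fun _ _ => 0)) p i ^ 2) ε)), ZrOfRecord₁₃ F 2 (theta13OfThm1CCMWZB F 2 j γ a₀ ε₀ ε₂₉ B₃ B₃' a₀ a₁ (Efl F j γ ε₀ ε₂₉ B₃ B₃' a₀ a₁) (fun p i => Real.log (B16ZLower.zNorm (SU 2) (gOfRecord₁₃ F 2 (theta13OfThm1CCMWZB F 2 j γ a₀ ε₀ ε₂₉ B₃ B₃' a₀ a₁ (fun _ _ => 0) (fun _ _ => 0)) p i ^ 2) ε)))⟩)) P (k + 1) →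
      ∀ᵐ U ∂(fieldMeasure (F.P P.K) (k + 1) (SU 2)),
        chiβOfRecord₁₃ F 2 (theta13OfThm1CCMWZB F 2 j γ a₀ ε₀ ε₂₉ B₃ B₃' a₀ a₁ (Efl F j γ ε₀ ε₂₉ B₃ B₃' a₀ a₁) (fun p i => Real.log (B16ZLower.zNorm (SU 2) (gOfRecord₁₃ F 2 (theta13OfThm1CCMWZB F 2 j γ a₀ ε₀ ε₂₉ B₃ B₃' a₀ a₁ (fun _ _ => 0) (fun _ _ => 0)) p i ^ 2) ε))) P.K (gOfRecord₁₃ F 2 (theta13OfThm1CCMWZB F 2 j γ a₀ ε₀ ε₂₉ B₃ B₃' a₀ a₁ (Efl F j γ ε₀ ε₂₉ B₃ B₃' a₀ a₁) (fun p i => Real.log (B16ZLower.zNorm (SU 2) (gOfRecord₁₃ F 2 (theta13OfThm1CCMWZB F 2 j γ a₀ ε₀ ε₂₉ B₃ B₃' a₀ a₁ (fun _ _ => 0) (fun _ _ => 0)) p i ^ 2) ε))) P) (k + 1) U *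
              Real.exp (-(1 / (gOfRecord₁₃ F 2 (theta13OfThm1CCMWZB F 2 j γ a₀ ε₀ ε₂₉ B₃ B₃' a₀ a₁ (Efl F j γ ε₀ ε₂₉ B₃ B₃' a₀ a₁) (fun p i => Real.log (B16ZLower.zNorm (SU 2) (gOfRecord₁₃ F 2 (theta13OfThm1CCMWZB F 2 j γ a₀ ε₀ ε₂₉ B₃ B₃' a₀ a₁ (fun _ _ => 0) (fun _ _ => 0)) p i ^ 2) ε))) P (k + 1)) ^ 2 * wilsonBGOfRecord F 2 (theta13OfThm1CCMWZB F 2 j γ a₀ ε₀ ε₂₉ B₃ B₃' a₀ a₁ (Efl F j γ ε₀ ε₂₉ B₃ B₃' a₀ a₁) (fun p i => Real.log (B16ZLower.zNorm (SU 2) (gOfRecord₁₃ F 2 (theta13OfThm1CCMWZB F 2 j γ a₀ ε₀ ε₂₉ B₃ B₃' a₀ a₁ (fun _ _ => 0) (fun _ _ => 0)) p i ^ 2) ε))).εbg P (k + 1) U)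
                - em (gOfRecord₁₃ F 2 (theta13OfThm1CCMWZB F 2 j γ a₀ ε₀ ε₂₉ B₃ B₃' a₀ a₁ (Efl F j γ ε₀ ε₂₉ B₃ B₃' a₀ a₁) (fun p i => Real.log (B16ZLower.zNorm (SU 2) (gOfRecord₁₃ F 2 (theta13OfThm1CCMWZB F 2 j γ a₀ ε₀ ε₂₉ B₃ B₃' a₀ a₁ (fun _ _ => 0) (fun _ _ => 0)) p i ^ 2) ε))) P (k + 1)) * (Fintype.card (Literature.MathematicalPhysics.QuantumFieldTheory.Balaban1983to89.Site (F.P P.K) (k + 1)) : ℝ)) ≤ densOfRecord₁₃ F 2 (theta13OfThm1CCMWZB F 2 j γ a₀ ε₀ ε₂₉ B₃ B₃' a₀ a₁ (Efl F j γ ε₀ ε₂₉ B₃ B₃' a₀ a₁) (fun p i => Real.log (B16ZLower.zNorm (SU 2) (gOfRecord₁₃ F 2 (theta13OfThm1CCMWZB F 2 j γ a₀ ε₀ ε₂₉ B₃ B₃' a₀ a₁ (fun _ _ => 0) (fun _ _ => 0)) p i ^ 2) ε))) P (k + 1) U ∧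
          densOfRecord₁₃ F 2 (theta13OfThm1CCMWZB F 2 j γ a₀ ε₀ ε₂₉ B₃ B₃' a₀ a₁ (Efl F j γ ε₀ ε₂₉ B₃ B₃' a₀ a₁) (fun p i => Real.log (B16ZLower.zNorm (SU 2) (gOfRecord₁₃ F 2 (theta13OfThm1CCMWZB F 2 j γ a₀ ε₀ ε₂₉ B₃ B₃' a₀ a₁ (fun _ _ => 0) (fun _ _ => 0)) p i ^ 2) ε))) P (k + 1) U ≤ Real.exp (ep (gOfRecord₁₃ F 2 (theta13OfThm1CCMWZB F 2 j γ a₀ ε₀ ε₂₉ B₃ B₃' a₀ a₁ (Efl F j γ ε₀ ε₂₉ B₃ B₃' a₀ a₁) (fun p i => Real.log (B16ZLower.zNorm (SU 2) (gOfRecord₁₃ F 2 (theta13OfThm1CCMWZB F 2 j γ a₀ ε₀ ε₂₉ B₃ B₃' a₀ a₁ (fun _ _ => 0) (fun _ _ => 0)) p i ^ 2) ε))) P (k + 1)) * (Fintype.card (Literature.MathematicalPhysics.QuantumFieldTheory.Balaban1983to89.Site (F.P P.K) (k + 1)) : ℝ))))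
    -- ★ THE COFINAL β-SOCKET (director-ym №402 (R) ∕ P3 g84 spec (R1); = the engine's `hβc` VERBATIM): K0⁷'s sign-free β-BOX AND NODE O's four RUN ROWS AT A RADIUS SUPPLIED BY THE PRODUCER, per `F` —
    -- the box part is the body of k0's door `K0V23Stub3DoorSuppliers.K0BoxCofinalRadii` at `F` conjunct for conjunct, the rows part is K1⁹'s own rows conjunct at that β; replaces the face of
    -- ✓p781921's `h3` (∀-radius V23 stub text) AND `hrowsR` (∀-door rows): NODE O's wall in the (α_cof) currency, displayed, NOBODY's theorem
    (hβc : ∀ F : T4Family, ∀ a : ℝ, 0 < a → ∃ a₀ : ℝ, 0 < a₀ ∧ a₀ ≤ a ∧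
      ∃ (γ₀ ε₂₉ β' : ℝ) (j : ℕ) (ε₀ B₃ B₃' a₁ : ℝ) (Efl logz : B12.RunParams → ℕ → ℝ), 0 < γ₀ ∧ 0 < ε₂₉ ∧
        BetaLowerH (-β') γ₀ (betaOfRecord₁₃ F 2 (theta13OfThm1CCMWZB F 2 j (1 / 2) a₀ ε₀ ε₂₉ B₃ B₃' a₀ a₁ Efl logz)) ∧
        BetaUpperH β' γ₀ (betaOfRecord₁₃ F 2 (theta13OfThm1CCMWZB F 2 j (1 / 2) a₀ ε₀ ε₂₉ B₃ B₃' a₀ a₁ Efl logz)) ∧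
        ∃ (b : ℕ → ℝ) (r γ₁ M : ℝ), 0 < γ₁ ∧
          (∀ (n : ℕ) (gs : ℕ → ℝ), RGEqH n (betaOfRecord₁₃ F 2 (theta13OfThm1CCMWZB F 2 j (1 / 2) a₀ ε₀ ε₂₉ B₃ B₃' a₀ a₁ Efl logz)) gs → Step.InInterval γ₁ n gs → ∀ k, k ≤ n → |betaOfRecord₁₃ F 2 (theta13OfThm1CCMWZB F 2 j (1 / 2) a₀ ε₀ ε₂₉ B₃ B₃' a₀ a₁ Efl logz) k (prefixOf gs k) - b k| ≤ r) ∧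
          (∀ (n : ℕ) (gs : ℕ → ℝ), RGEqH n (betaOfRecord₁₃ F 2 (theta13OfThm1CCMWZB F 2 j (1 / 2) a₀ ε₀ ε₂₉ B₃ B₃' a₀ a₁ Efl logz)) gs → Step.InInterval γ₁ n gs → ∀ k, k ≤ n → -M ≤ ∑ i ∈ Finset.Ico k n, betaOfRecord₁₃ F 2 (theta13OfThm1CCMWZB F 2 j (1 / 2) a₀ ε₀ ε₂₉ B₃ B₃' a₀ a₁ Efl logz) i (prefixOf gs i)) ∧
          ∀ k : ℕ, ContinuousOn (fun x : ℝ => betaOfRecord₁₃ F 2 (theta13OfThm1CCMWZB F 2 j (1 / 2) a₀ ε₀ ε₂₉ B₃ B₃' a₀ a₁ Efl logz) k (clampPrefix (betaOfRecord₁₃ F 2 (theta13OfThm1CCMWZB F 2 j (1 / 2) a₀ ε₀ ε₂₉ B₃ B₃' a₀ a₁ Efl logz)) γ₁ k x))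
            {x : ℝ | 0 < x ∧ x ≤ γ₁ ∧ ∀ i, i ≤ k → 1 / γ₁ ^ 2 ≤ Y (betaOfRecord₁₃ F 2 (theta13OfThm1CCMWZB F 2 j (1 / 2) a₀ ε₀ ε₂₉ B₃ B₃' a₀ a₁ Efl logz)) γ₁ i x}) :
    Summit.QuantumFields.YangMills.Theses.BalabanUVNodes.StabilityBRunRowsAtRecordR13SepCoPHV := by
  -- NODE N07's leaf from its six remaining printed parts through NODE 00's Sect.-E presentation BY NAME (print's letters `L := F.L`, `η i := (F.P i.K).eta i.k`)
  have h07 : ∀ F : T4Family, ∃ ζ : ResidZ F 2, B11Leaf (Z11OfRecord F 2 ζ) := fun F => by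
    obtain ⟨β, iβ, iL, iη, ζ, E, βr, O₁, O₂, e₅, a, hC₄, ha₃, hα, laws, leaves, plaws, hB₀, hB₁, hB₃, hC₁, hB₀B₁, hc₁, hO₁, hO₂, he₅, ha, hbg,
      p2, p3, p5, p8, sF, p9⟩ := hN07 F
    exact ⟨ζ.withSectE E, b11Leaf_Z11OfRecord_withSectE_of_parts ζ E hC₄ ha₃ hα βr laws leaves plaws hB₀ hB₁ hB₃ hC₁ hB₀B₁ hc₁ hO₁ hO₂ he₅ ha hbg p2 p3 p5 p8 sF p9⟩
  -- NODE N08's slot from its (α)-AC residual through dag-n08-w4's slot theorem BY NAME (`N := 2`, `L := F.L`)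
  have h08 : ∀ F : T4Family, PrintedUV3V 2 F.L := fun F => by
    obtain ⟨𝔊, 𝔠, εbg, cm, X, 𝔖, 𝔄, c, hav, hUk, hε, R, hcm, hmass⟩ := hN08 F
    exact Summit.QuantumFields.YangMills.Theorems.BalabanUVNodesN08AlphaEq324RowACReMassedZSlot.printedUV3V_at_slotOfRecord_of_coreLTAtAC_of_massBoundZAE_of_consts (𝔄 := 𝔄) (c := c) hav hUk hε R hcm hmass
  -- NODE N06's leaf at every door, TYPED AT N06's OBJECT OF RECORD (CASCADE-K edition «KC»: knit object `opsYNuStOfRecordV11KSE …`, carrier `Y9OfRecordUPbParH`), from dag-n06-d's certificate BY NAME at the door witness's Stage-11 view (its Stage-3 dictionary IS `stage3OfFamily F`, `rfl`; its run-indexed weight binder is not read)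
  have h06 : ∀ (F : T4Family) {j : ℕ} {γ ε₀ ε₂₉ B₃ B₃' a₀ a₁ : ℝ}, 0 < γ → γ ≤ 1 / 2 → 0 < ε₀ → 0 < ε₂₉ → 0 ≤ B₃ → 0 ≤ B₃' → 0 < a₀ → 0 < a₁ →
      B9LeafX (Y9OfRecordUPbParH (J := SCMemberY (stage3OfFamily F).d₆ (stage3OfFamily F).ℓ₆ (stage3OfFamily F).hd' (stage3OfFamily F).hL' (stage3OfFamily F).b₀ (stage3OfFamily F).b₁ (Mstar F)) 2 (stage3OfFamily F) (Mstar F) (opsYNuStOfRecordV11KSE 2 (stage3OfFamily F) (Mstar F) (𝔯 F) (sectEStYOfRecordV7 2 (stage3OfFamily F) (Mstar F) (𝔢₀ F)) (𝔴 F) (𝔈 F)) SCMemberY.val (bR F) SCMemberY.ιBsc (C38 F) (fun (j : SCMemberY (stage3OfFamily F).d₆ (stage3OfFamily F).ℓ₆ (stage3OfFamily F).hd' (stage3OfFamily F).hL' (stage3OfFamily F).b₀ (stage3OfFamily F).b₁ (Mstar F)) => parKnitY j.val.toKIdx) (fun (j : SCMemberY (stage3OfFamily F).d₆ (stage3OfFamily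 F).ℓ₆ (stage3OfFamily F).hd' (stage3OfFamily F).hL' (stage3OfFamily F).b₀ (stage3OfFamily F).b₁ (Mstar F)) => parSymY j.val.toKIdx) (fun (j : SCMemberY (stage3OfFamily F).d₆ (stage3OfFamily F).ℓ₆ (stage3OfFamily F).hd' (stage3OfFamily F).hL' (stage3OfFamily F).b₀ (stage3OfFamily F).b₁ (Mstar F)) => GAQY j.val.toKIdx (qKnitOfRecord 2 (stage3OfFamily F) j.val.toKIdx) (qsKnitOfRecord 2 (stage3OfFamily F) j.val.toKIdx) (parKnitY j.val.toKIdx) (GpY j.val.toKIdx (parKnitY j.val.toKIdx)))) := by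
    intro F j γ ε₀ ε₂₉ B₃ B₃' a₀ a₁ dγ₀ dγh dε dε' dB dB' da₀ da₁
    exact @b9LeafXUR_opsYSectESt_knit_pairKC 2 _ _ F ((theta13OfThm1CCMWZB F 2 j γ a₀ ε₀ ε₂₉ B₃ B₃' a₀ a₁ (Efl F j γ ε₀ ε₂₉ B₃ B₃' a₀ a₁) (fun p i => Real.log (B16ZLower.zNorm (SU 2) (gOfRecord₁₃ F 2 (theta13OfThm1CCMWZB F 2 j γ a₀ ε₀ ε₂₉ B₃ B₃' a₀ a₁ (fun _ _ => 0) (fun _ _ => 0)) p i ^ 2) ε))).toStage12Params.toStage11 F 2 ⟨0, 0, 0⟩) ((admissible_theta13OfThm1CCMWZB_of_le_half F 2 (Efl F j γ ε₀ ε₂₉ B₃ B₃' a₀ a₁) (fun p i => Real.log (B16ZLower.zNorm (SU 2) (gOfRecord₁₃ F 2 (theta13OfThm1CCMWZB F 2 j γ a₀ ε₀ ε₂₉ B₃ B₃' a₀ a₁ (fun _ _ => 0) (fun _ _ => 0)) p i ^ 2) ε)) (j := j) dγ₀ dγh da₀ dε dε' dB dB' da₀ da₁).toStage12.toStage11 ⟨0,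 0, 0⟩) (Mstar F) (lettersYOfRecordV11K 2 (stage3OfFamily F) (Mstar F) (𝔯 F)) (fun _ => rfl) (fun _ => rfl) (fun _ => rfl) (fun _ => rfl) (𝔢₀ F) (𝔴 F) (𝔈 F) (𝔈₀ F) (R₁ F) (R₂ F) (c F) (hcB F) (hc F) (hGR F) (hRP1 F) (hP1 F) (hP2 F) (instN06_1 F) (instN06_2 F) (instN06_3 F) (instN06_4 F) (bI F) (hbI F) (α' F) (r39 F) (δ39 F) (B39 F) (a39 F) (M39 F) (hα'0 F) (hα'1 F) (hr39 F) (hrδ39 F) (hB39 F) (ha39 F) (hM39 F) (h348 F) (ιA F) (AA F) (instN06_5 F) (instN06_6 F) (p F) (q F) (hp F) (hq F) (α₀K F) (aK F) (hαK F) (hαK3 F) (hαK2 F) (hKplK F) (hpaK F) (hqaK F) (p3 F) (q3 F) (hp3 F) (hq3 F) (pM F) (qM F) (hpM F) (hqM F) (H F) (hM₀ F) (𝔭 F) (h𝔭 F) (bHX F) (hbHX F) (SH F) (S3 F) (SI F) (Bc F) (hBc F) (hM₀N F) (hB₀ge F) (O F) (near F) (hnear F) (hOagr F) (hOsym F) (hOloc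 F) (hOlocT F) (δM F) (hδM F) (hM1L F) (hδ1L F) (hθ1L F) (hMixO F) (hOneO F) (hmixO F) (h36b F) (h36H F) (hcntH F) (hcnt3 F) (hcntI F) (hMw F) (hNMw F) (hM3 F) (hρ3 F) (hNc F) (hN' F) (hCℓ F) (hKc F) (hθ₀ F) (𝔬A F) (rdA F) (𝔭A F) (h𝔭A F) (𝔡A F) (𝔩A F) (bHXA F) (κA F) (SHA F) (S3A F) (SIA F) (SMA F) (hbHXA F) (hstA F) (hκA F) (hrdA F) (hlocA F) (h36A' F) (h36HA F) (hcntHA F) (hcnt3A F) (hcntIA F) (hcntMA F) (hblkA F) (hblkYA F) (hGcoA F) (hDcoA F) (hDscoA F) (hLcoA F) (h𝔡Ad F) (h𝔡As F) (OcA F) (hGsqOA F) (BcA F) (hBcA F) (hB₀geA F) (h36Ab F) (𝔬12 F) (h𝔈 F) (E14₁ F) (E14₂ F) (T14₁ F) (T14₂ F) (X14₁ F) (M14₁ F) (X14₂ F) (M14₂ F) (diam14 F) (r14 F) (hr14 F) (near14₁ F) (first14₁ F) (chain14₁ F) (near14₂ F) (first14₂ F) (chain14₂ F) (h14₁ F)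 (h14₂ F) (W14₁ F) (W14₂ F) (hW14₁ F) (hW14₂ F) (hcnt14₁ F) (hcnt14₂ F) (hexp14 F) (a₀E F) (δ₁E F) (B₁E F) (ha₀E F) (hδ₁E F) (hB₁E F) (hE F) (SCMemberY (stage3OfFamily F).d₆ (stage3OfFamily F).ℓ₆ (stage3OfFamily F).hd' (stage3OfFamily
      F).hL' (stage3OfFamily F).b₀ (stage3OfFamily F).b₁ (Mstar F)) SCMemberY.val (ιR F) (instN06_7 F) (instN06_8 F) (bR F) SCMemberY.ιBsc (C38 F) (MR F) (hMR F) (hΔAK F) (s349K F) (s3132K F) (hBK F) (𝔯 F) (fun _ => rfl) (fun _ => rfl) (fun _ => rfl) (fun _ => rfl) (fun _ => rfl) (fun _ => rfl) (fun _ => rfl) (fun _ => rfl) (hRP2 F) (M46K F) (a46K F) (B46K F) (δ46K F) (hM46K F) (ha46K F) (hB46K F) (hα3 F) (bHXT F) (hbHXT F) (hopI F) (S2A F) (bHXTA F) (hbHXTA F) (hopIA F) (h36A2 F) (hcnt2A F) (hblk12 F) (hblkW12 F) (hblkY12 F) (hG0co12 F) (hGco12 F) (hG1co12 F) (hGGco12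 F) (hDco12 F) (hDsco12 F) (hblkZ12 F) (hHm12 F) (hH1m12 F) (hS0co12 F) (hTpico12 F) (hT2co12 F) (hQco12 F) (hQsco12 F) (hCco12 F) (hC1co12 F) (hDvco12 F) (hDvsco12 F) (hRco12 F) (bH13 F) (δ12₀ F) (δK12 F) (σ12 F) (ρ12 F) (a12 F) (M12 F) (B12₃ F) (δ12₃ F) (ρ13 F) (α12 F) (ρf12 F) (hρf12 F) (hρf1 F) (hρf2 F) (hB12₃ F) (hσ12 F) (hρ12 F) (hρS12 F) (hρδ12 F) (hρ₃12 F) (ha12 F) (hM12 F) (hα12 F) (hα12' F) (hδ₃₀ F) (hδ12₀ F) (t12 F) (δT12 F) (ρS F) (σS F) (ht12 F) (hσS F) (hρST F) (hρS₀ F) (hδKS F) (hσSK F) (bXH F) (w13 F) (wX F) (hw13₀ F) (hw13₁ F) (hwX₀ F) (hwX₁ F) (hbH13 F) (hbXH F) (hρ13 F) (hρ13ρ F) (hσρ13 F) (B13₄ F) (Bx13 F) (hB13₄ F) (hBx13 F) (tJ F) (δB F) (rT F) (ha1J F) (htJ F) (hrTP F) (hrTB F) (hδT12 F) (hδTr F)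 (ϑF F) (hϑF F) (sch F) (hsch0 F) (hsch1 F) (hschβ F) (hwsch F) (δ45 F) (hδ45 F) (BZ F) (hBZ F) (hBZge F) (hδ45le F) (δ₂ F) (hrT4 F) (hrT2 F) (hδ₃T F) (hδ12₃F F) (δ45Y F) (hδ45Y F) (BiY F) (hBiY F) (αW F) (σW F) (δFW F) (hαW0 F) (hαW1 F) (hσW F) (hδFW F) (hδFP F) (hbudW F) (hδ3W F) (hwschX F) (δ45W F) (hδ45W F) (B45W F) (hB45W F) (δhW F) (hδhW F) (BhW F) (hBhW F) (hB45Wge F) (hδ45Wle F) (hBhWge F) (hδhWle F) (CP F) (hCPge F) (hBxW F) (hBiYge F) (hδ45Yle F) (s44 F) (hs440 F) (hs441 F) (hws44 F) (δ44 F) (hδ44 F) (Bi44 F) (hBi44 F) (hB12₃d F) (hB12₃p F) (hBi44ge F) (hδ44le F) (hwX44 F) (B44G F) (δ44G F) (hB44G F) (hδ44G F) (hB44Gge F) (hδ44Gle F) (hB₃wG F) (BHG F) (hBHG F) (hwBhG F) (B43 F) (δ43 F) (hB43 F) (B₀D F) (hB₀D F) (hbudD F) (hB43ge F) (hδ43le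 F) (ρrg F) (hρrg0 F) (hbudrg F) (hbud43 F) (hδ₃rg F) (hB₃rg F) (τS F) (δP F) (hτS F) (hρP12 F) (hU8a F) (hU8b F) (hU8c F) (hU8d F) (hU8e F) (hU8f F) (hU8g F) (hU8h F) (hU8i F) (hU8j F) (hU8k F) (τR F) (hτR F) (hR8a F) (hR8b F) (hR8c F) (hR8d F) (hR8e F) (hR8f F) (hR8g F) (hR8h F) (hR8i F) (hR8j F) (hR8k F) (hsymDK F) (hΔ2 F) (hsymT F)
      (hsymRT F) (hUQG1K F) (hidsK F) (BQs F) (δQs F) (hBQs F) (hδQs1 F) (hδQs2 F) (hδQs3 F) (hqsK F) (BQL F) (hBQL F) (hqsL2K F) (hqL2K F) (BQp F) (hBQp F) (hqK F) (hC1TK F) (h46K F) (MD2 F) (aD₀ F) (θ₂ F) (haD00 F) (hθ₂ F) (hD2P F) (h348F F)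
  refine N24_stabilityBRunRowsAtRecordR13SepCoPHV_byName_of_cofinalBetaSocketZBV23_of_childrenSplitSlot8DoorPinnedN09Thm3InputsN11SupplierRowsThm1AEPos_atGaussPinPrintedZB_pinY
    (fun θ₃ lam8 => ∃ (P : ℕ) (c₁ : ℝ) (ρ₀ : ℕ) (ax : ∀ i : IdxB8SubDPer θ₃ P, (famB8OfRecordPer θ₃ (lam8.cutSubBP₅κPer P M₁ R c₁ ρ₀).β (lam8.cutSubBP₅κPer P M₁ R c₁ ρ₀).len P i).Cfg → (famB8OfRecordPer θ₃ (lam8.cutSubBP₅κPer P M₁ R c₁ ρ₀).β (lam8.cutSubBP₅κPer P M₁ R c₁ ρ₀).len P i).Pert → (famB8OfRecordPer θ₃ (lam8.cutSubBP₅κPer P M₁ R c₁ ρ₀).β (lam8.cutSubBP₅κPer P M₁ R c₁ ρ₀).len P i).Pert), (0 < P ∧ M₁ * θ₃.L ∣ P) ∧ 0 < c₁ ∧ 1 ≤ ρ₀ ∧ B8LeafOfRecordSubBP₂DPerκ θ₃ P M₁ R ⟨lam8.cutSubBP₅κPer P M₁ R c₁ ρ₀, ax⟩)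
    ε hεz Efl (fun F {j} {γ} {ε₀} {ε₂₉} {B₃} {B₃'} {a₀} {a₁} hγ₀ hγh hε hε' hB hB' ha₀ ha₁ ha₀ρ hε₀ρ {bl} {β'} hbox hbox' hl hβ' => ?_)
    (fun F {j} {γ} {ε₀} {ε₂₉} {B₃} {B₃'} {a₀} {a₁} hγ₀ hγh hε hε' hB hB' ha₀ ha₁ _ _ {bl} {β'} _ _ _ _ => ⟨_, @h06 F j γ ε₀ ε₂₉ B₃ B₃' a₀ a₁ hγ₀ hγh hε hε' hB hB' ha₀ ha₁⟩) h07 h08 h09 hN09T (fun F {j} {γ} {ε₀} {ε₂₉} {B₃} {B₃'} {a₀} {a₁} _ _ _ _ _ _ _ _ _ _ {bl} {β'} _ _ _ _ => h10 F) h11N hEfl h13pos hβc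
  -- the Stage-3 view of the printed-z member IS the family dictionary (`rfl`); ζ-L's door at `stage3OfFamily F`
  haveI : FiniteDimensional ℝ (stage3OfFamily F).𝔸 :=
    -- RE-KEY-NEUTRAL (director-ym №262, FLAG №14 T0 (β)): the by-name lemma of `Node00/Record12NumericsFamilyFiniteDim` (p692370), any `(stage3OfFamily F).𝔸`.
    Literature.MathematicalPhysics.QuantumFieldTheory.Balaban1983to89.Node00.finiteDimensional_𝔸_stage3OfFamily F
  -- print's trace state on the record algebra `(stage3OfFamily F).𝔸 = M₂(ℂ)` BY NAME (NODE 00 `Record12NumericsFamilyTraceState`): `τ := tr`, `C_τ := 2`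
  obtain ⟨τ, Cτ, hτp, hτt, hτs, hCτ⟩ := Literature.MathematicalPhysics.QuantumFieldTheory.Balaban1983to89.Node00.exists_traceState_stage3OfFamily F
  obtain ⟨β, len, B₀'H, B₂', BG, BR, cL, hβ, hlen, hB₀'H, hB₂', hBG, hBR, hcL, hLet, SLetUB⟩ := hN06 F
  -- dag-n06-b's theorem is UNIFORM in the base letters `ops₀` and the block parameter `M`: chosen here (`ops₀ := 0`, `M := 1`), off the display
  let ops₀ : ℝ → ZdIdx (stage3OfFamily F).D (stage3OfFamily F).L → ℕ → OpsZd (stage3OfFamily F).D (stage3OfFamily F).𝔸 :=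
    fun _ _ _ => ⟨fun _ _ _ _ => 0, fun _ _ _ _ => 0, fun _ _ _ _ => 0, fun _ _ _ _ => 0⟩
  haveI : NeZero (M₁ * (stage3OfFamily F).L) := ⟨Nat.pos_iff_ne_zero.mp (Nat.mul_pos hM₁ (by have := F.hL11; show 0 < F.L; omega))⟩
  -- N06's five binders with ONE constant set over all members, from dag-n06-b's η-free ∃∀ theorem (road (i): the η-scaling of the record)
  obtain ⟨aI, haI, aT, haT, B₀, hB₀, Cβ, hCβ, cS, hcS, cSβ, hcSβ, hB⟩ :=
    Literature.MathematicalPhysics.QuantumFieldTheory.Balaban1983to89.B9Thm33BindersUniformZdPerNestedEta.IdxB8SubDPerκ.binders_uniform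
      (P := M₁ * (stage3OfFamily F).L) (Mκ := M₁) (Rκ := R) τ hτp hτt hτs (by show 2 ≤ 4; norm_num) hCτ ops₀ 1 hβ hlen
  -- ζ-L's door with `a_S := a_T`, `C_β ↦ max C_β 1` (dag-n05-d's two glue lines), the Hölder binder weakened by `holderAtIH2Per_anti`
  exact exists_residB8_slot8κ'_of_bindersLettersPer_doorL (stage3OfFamily F) (by show 2 ≤ 4; norm_num) (by have := F.hL11; show 5 ≤ F.L; omega) M₁ R hM₁
    τ hτp hτt hτs hCτ ops₀ le_rfl haI haT haT hB₀ (lt_max_of_lt_right one_pos) hcS hcSβ hB₀'H hB₂' hBG hBR hcL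
    (fun a m hm => (hB a m hm).1) (fun a m hm => (hB a m hm).2.1) (fun a m hm => holderAtIH2Per_anti (ha := le_rfl) (hC := le_max_left Cβ 1) (h := (hB a m hm).2.2.1))
    (fun a m hm => (hB a m hm).2.2.2.1) (fun a m hm => (hB a m hm).2.2.2.2) hLet SLetUB

end Summit.QuantumFields.YangMills.BalabanUVNodes.N24K1FaceTrN06KCSCN07N08N09T5V23CofJunctionLSlot8KappaPrimeAtGaussPinPrintedZBY

end
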